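import Literature.Topology.FourManifolds.SphereTrisectionsHandlebodies
import HarnessLib

/-!
# Gay–Kirby's sectors of `S⁴` are `4`-balls with corners: clause (ii) proved

Topic `Literature/Topology/FourManifolds`; sibling file of `SphereTrisections.lean` and
`SphereTrisectionsHandlebodies.lean` (fact item `provefact-Literature.sphere_trisections`).  It DISCHARGES
the named fact `Literature.Topology.FourManifolds.sphereSector_sectors` (`SphereTrisections.lean`) — clause (ii) of
`Literature.Topology.FourManifolds.IsGKTrisection` for the explicit sectors `X_j = {2πj/3 ≤ θ ≤ 2π(j+1)/3}` of the round
`S⁴ ⊂ ℂ × ℝ³` (Gay–Kirby 2016, §2, first example, with Def. 1, first bullet: "for each `i` there is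
a diffeomorphism `φᵢ : Xᵢ → Z_k`", here `k = 0`, `Z₀ = B⁴`, read with corners along the central
surface `F` as explained in the docstring of `Literature.Topology.FourManifolds.IsGKTrisection`) — and with it the genus-`0`
trisection of `S⁴` (`Literature.Topology.FourManifolds.sphereSector_isBalancedGKTrisection_holds`,
`Literature.Topology.FourManifolds.sphere_genusZero_gkTrisection_holds`: the corrected trisection predicate is non-vacuous), by
an **explicit parametrisation of each sector by the closed unit `4`-ball**
`GayKirby.sectorMap α : 𝔻⁴ → S⁴` (sector of angles `[α, α + 2π/3]`; `α = 2πj/3` gives `X_j`).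
After this file the corrected fact (d′) `Literature.Topology.FourManifolds.sphere_gkTrisections` depends on the stabilisation
fact (c′) `Literature.Topology.FourManifolds.exists_stabilized_gkTrisection` alone (`Literature.Topology.FourManifolds.sphere_gkTrisections_of_stabilization`).

## The sector map

Write `w = (s, v) ∈ 𝔻⁴ ⊂ ℝ × ℝ³`, `u = 1 - ‖w‖²` (the boundary-defining function of the ball),
`ν = √(u² + 4s²)` and `(y₀, y₁) = (√((ν - 2s)/2), √((ν + 2s)/2))`, i.e.
`(y₀, y₁, ·, ·) = cornerUnbend (u, 2s, ·, ·)` (`Trisections.lean`): `y₁ + i y₀` is the principal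
square root of `2s + iu`.  With the unit edge vectors `E₁ = e^{iα}`, `E₀ = e^{i(α + 2π/3)}` of the
sector, `m = √((2 + ν - 2u)/2)` and `λ = 2/√((2 - u + ν)(2 + ν - 2u))` we put
`sectorMap α (s, v) = ((y₁ E₁ + y₀ E₀)/m, λ v) ∈ ℂ × ℝ³`.
The identities `y₀² + y₁² = ν`, `2 y₀ y₁ = u`, `|y₁ E₁ + y₀ E₀|² = ν - u/2` (the edges meet at
angle `2π/3`; `edge_combination_norm_sq`), so that `|z|² = (2ν - u)/(2 + ν - 2u)`, and
`(2 - u - ν)(2 - u + ν) = 4(1 - u - s²) = 4‖v‖²` show that the image lies on `S⁴`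
(`norm_sectorMapFun`).  Structure: in the plane normal to the central surface the map is
`h⁻¹ ∘ A ∘ csqrt ∘ τ` with `τ(s, u) = 2s + iu` *linear*, `csqrt` the principal square root (the
corner model `cornerUnbend` of `Literature.Topology.FourManifolds.IsCornerAt`), `A` the linear map taking the quadrant to the
sector (`A e₁ = E₁`, `A e₀ = E₀`; `GayKirby.cornerLinear`) and `h⁻¹(Y) = Y/√(1 + Q(Y))` the radial
diffeomorphism with `Q(A y) = |y|²/2 - 2 y₀ y₁`, chosen so that the level set `{|z| = 1}` (the arc
where the `ℝ³`-factor degenerates) corresponds exactly to the segment `{v = 0} = {u = 1 - s²}` of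
the ball; this is what makes a single closed formula work globally, and it makes the corner model
hold *literally* in the charts `φ = (u, 2s, ς(v/‖v‖))` of `𝔻⁴` and `ψ = (h(z), ς(t/‖t‖))` of `S⁴`
(`GayKirby.cornerLinear_symm_sphCornerFun_sectorMapFun`).  (The more obvious homeomorphism "graph of
`√(1 - x₁² - |t|²)` over the solid ellipsoid" is *not* admissible: for it the ambient coordinate
`x₁` is a smooth function on the ball, which is impossible for the corner model `A ∘ cornerUnbend`.)

The map has the explicit smooth left inverse `sectorInvFun α (z, t) = (s, t/λ)` with
`s = (y₁² - y₀²)/2`, `(y₀, y₁) = A⁻¹ h(z)` recovered *polynomially* from `h(z) = z/√(1 - Q(z))`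
(`sectorInvFun_sectorMapFun`), whence injectivity; conversely `sectorMapFun ∘ sectorInvFun = id`
on the sector (`sectorMapFun_sectorInvFun`), whence the range.

## Immersion off the corner locus

Replacing `y₀ = √((ν - 2s)/2)` by its analytic continuation `u/(2y₁)` where `ν + 2s > 0` (resp.
`y₁` by `u/(2y₀)` where `ν - 2s > 0`) gives smooth extensions `ẽ_±` (`GayKirby.sectorMapExtPos/Neg`)
of the sector map to the open sets `V_± ⊆ ℝ⁴`, still `S⁴`-valued (`2 y₀ y₁ = u` now holds by
definition) and still inverted by `sectorInvFun α`: `ẽ_±` and `sectorInvFun α` are mutually inverse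
diffeomorphisms `V_± ≅ U_± ⊆ S⁴` (`U₊ = {Q < 1, a > 0}`), packaged as charts
`GayKirby.posChart/negChart` of `S⁴` in the maximal `C^∞` atlas
(`IsManifold.mem_maximalAtlas_iff_contMDiffOn`).  In the chart of `𝔻⁴` at `w` (interior chart or
polar boundary chart of `ClosedBall.lean`, extended to the translation resp. `Literature.Topology.FourManifolds.polarChart`) and the
chart `posChart ≫ D` of `S⁴` the sector map reads as the identity, which is Mathlib's immersion
property with complement `PUnit` (`GayKirby.isImmersionAt_sectorMap`; `𝔻⁴ ∖ K ⊆ V₊ ∪ V₋`).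

## Corner charts along `K`

For `w ∈ K = {w₀ = 0, ‖w‖ = 1}` (the preimage of `F`), `q = v(w) ∈ S²` and `ς` the stereographic
chart of `S²` centred at `q`: `φ_q = (1 - ‖w‖², 2w₀, ς(v/‖v‖))` is a chart of `𝔻⁴` in the maximal
atlas of the half-space model (`GayKirby.ballCornerChart`; smoothness into/out of `𝔻⁴` is tested in
`ℝ⁴` by `Literature.Topology.FourManifolds.contMDiff_coe_closedBall`, `ContMDiffAt.codRestrict_closedBall`),
`ψ_{α,q} = (√(m²(z)) z, ς(t/‖t‖))` is a chart of `S⁴` in the maximal atlas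
(`GayKirby.sphCornerChart`), and `A⁻¹ ∘ ψ ∘ sectorMap α ∘ φ⁻¹ = cornerUnbend` on `φ`'s target
(`GayKirby.isCornerAt_sectorMap`).

## Main results (all proved, no `sorry`)

* `GayKirby.sectorMap α : 𝔻⁴ → S⁴`, `GayKirby.isEmbedding_sectorMap`, `GayKirby.range_sectorMap`
  (the closed sector), `GayKirby.range_sectorMap_eq_sphereSector`, `GayKirby.sectorMap_mem_iInter_iff`
  (corner locus `K` ↔ central surface `F`), `GayKirby.inter_sphereSector_subset_image_boundary`
  (`X_j ∩ X_l ⊆ e(∂𝔻⁴)`);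
* `GayKirby.isImmersionAt_sectorMap` (`Literature.Topology.FourManifolds.sectorMap_isImmersionAt_holds`),
  `GayKirby.isCornerAt_sectorMap` (`Literature.Topology.FourManifolds.sectorMap_isCornerAt_holds`);
* `Literature.sphereSector_sectors_holds : sphereSector_sectors` — clause (ii) discharged;
  `Literature.Topology.FourManifolds.sphereSector_isBalancedGKTrisection_holds`, `Literature.Topology.FourManifolds.sphere_genusZero_gkTrisection_holds`,
  `Literature.Topology.FourManifolds.sphere_gkTrisectionGenus_eq_zero_holds`, `Literature.Topology.FourManifolds.sphere_gkTrisections_of_stabilization`.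

## References

* D. Gay, R. Kirby, *Trisecting 4-manifolds*, Geom. Topol. 20 (2016) 3097–3132 (arXiv:1205.1565):
  Def. 1, first bullet (arXiv p. 3); §2, first example (arXiv p. 5).
* A. Douady, *Variétés à bord anguleux et voisinages tubulaires*, Sém. H. Cartan 14 (1961/62), exp. 1,
  §1 and §4 (manifolds with corners, the quadrant model); A. Douady, L. Hérault, *Arrondissement des
  variétés à coins*, Comment. Math. Helv. 48 (1973), Appendice (straightening the angle).
* M. W. Hirsch, *Differential Topology*, Springer GTM 33 (1976), §1.1 (stereographic atlas), §1.4
  (the closed ball as a manifold with boundary).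
* J. M. Lee, *Introduction to Smooth Manifolds*, 2nd ed., GTM 218 (2013), Ch. 1 (Problem 1-11),
  Ch. 5 (Prop. 5.46–5.47) (regular domains).
-/

noncomputable section

open scoped Manifold ContDiff Topology Real
open Set Function Metric WithLp

namespace Literature.Topology.FourManifolds

local notation "𝔼 " n:arg => EuclideanSpace ℝ (Fin n)
local notation "𝕊 " n:arg => (Metric.sphere (0 : EuclideanSpace ℝ (Fin (n + 1))) 1)
local notation "𝔻 " n:arg => (Metric.closedBall (0 : EuclideanSpace ℝ (Fin n)) 1)

attribute [local instance] fact_finrank_euclideanSpace_succ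

namespace GayKirby

/-! ### Coordinates of `ℝ⁴` and `ℝ⁵` -/

/-- Coordinate `0` of a vector of `ℝ⁵` given in coordinates. [folklore] -/
@[simp] theorem vec5_apply_zero (a b c d e : ℝ) : (!₂[a, b, c, d, e] : 𝔼 5) 0 = a := rfl
/-- Coordinate `1` of a vector of `ℝ⁵` given in coordinates. [folklore] -/
@[simp] theorem vec5_apply_one (a b c d e : ℝ) : (!₂[a, b, c, d, e] : 𝔼 5) 1 = b := rfl
/-- Coordinate `2` of a vector of `ℝ⁵` given in coordinates. [folklore] -/
@[simp] theorem vec5_apply_two (a b c d e : ℝ) : (!₂[a, b, c, d, e] : 𝔼 5) 2 = c := rfl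
/-- Coordinate `3` of a vector of `ℝ⁵` given in coordinates. [folklore] -/
@[simp] theorem vec5_apply_three (a b c d e : ℝ) : (!₂[a, b, c, d, e] : 𝔼 5) 3 = d := rfl
/-- Coordinate `4` of a vector of `ℝ⁵` given in coordinates. [folklore] -/
@[simp] theorem vec5_apply_four (a b c d e : ℝ) : (!₂[a, b, c, d, e] : 𝔼 5) 4 = e := rfl
/-- Coordinate `0` of a vector of `ℝ⁴` given in coordinates. [folklore] -/
@[simp] theorem vec4_apply_zero (a b c d : ℝ) : (!₂[a, b, c, d] : 𝔼 4) 0 = a := rfl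
/-- Coordinate `1` of a vector of `ℝ⁴` given in coordinates. [folklore] -/
@[simp] theorem vec4_apply_one (a b c d : ℝ) : (!₂[a, b, c, d] : 𝔼 4) 1 = b := rfl
/-- Coordinate `2` of a vector of `ℝ⁴` given in coordinates. [folklore] -/
@[simp] theorem vec4_apply_two (a b c d : ℝ) : (!₂[a, b, c, d] : 𝔼 4) 2 = c := rfl
/-- Coordinate `3` of a vector of `ℝ⁴` given in coordinates. [folklore] -/
@[simp] theorem vec4_apply_three (a b c d : ℝ) : (!₂[a, b, c, d] : 𝔼 4) 3 = d := rfl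

/-- `‖w‖² = w₀² + (w₁² + w₂² + w₃²)` in `ℝ⁴`. [folklore] -/
theorem norm_sq_eq_four' (w : 𝔼 4) : ‖w‖ ^ 2 = w 0 ^ 2 + (w 1 ^ 2 + w 2 ^ 2 + w 3 ^ 2) := by
  rw [EuclideanSpace.norm_sq_eq]
  simp [Fin.sum_univ_four]
  ring

/-- `‖x‖² = x₀² + x₁² + (x₂² + x₃² + x₄²)` in `ℝ⁵`. [folklore] -/
theorem norm_sq_eq_five (x : 𝔼 5) :
    ‖x‖ ^ 2 = x 0 ^ 2 + x 1 ^ 2 + (x 2 ^ 2 + x 3 ^ 2 + x 4 ^ 2) := by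
  rw [EuclideanSpace.norm_sq_eq]
  simp [Fin.sum_univ_five]
  ring

/-- Componentwise continuity criterion for maps into `ℝⁿ`. [folklore] -/
theorem continuous_euclidean {X : Type*} [TopologicalSpace X] {n : ℕ} {f : X → 𝔼 n}
    (h : ∀ i, Continuous fun x => f x i) : Continuous f := by
  have : Continuous (fun x => WithLp.ofLp (f x)) := continuous_pi h
  exact (PiLp.continuous_toLp 2 _).comp this

/-! ### Trigonometry of the sector of angle `2π/3` -/

/-- `cos (2π/3) = -1/2`. [folklore] -/
theorem cos_two_pi_div_three : Real.cos (2 * π / 3) = -1 / 2 := by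
  rw [show 2 * π / 3 = π - π / 3 by ring, Real.cos_pi_sub, Real.cos_pi_div_three]; ring

/-- `sin (2π/3) = √3/2`. [folklore] -/
theorem sin_two_pi_div_three : Real.sin (2 * π / 3) = √3 / 2 := by
  rw [show 2 * π / 3 = π - π / 3 by ring, Real.sin_pi_sub, Real.sin_pi_div_three]

/-- `⟪E₁, E₀⟫ = cos α cos α' + sin α sin α' = -1/2` for the edge directions `E₁ = e^{iα}`,
`E₀ = e^{iα'}`, `α' = α + 2π/3`. [folklore] -/
theorem cos_mul_cos_add_sin_mul_sin (α : ℝ) :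
    Real.cos α * Real.cos (α + 2 * π / 3) + Real.sin α * Real.sin (α + 2 * π / 3) = -1 / 2 := by
  have h := Real.cos_sub (α + 2 * π / 3) α
  rw [show α + 2 * π / 3 - α = 2 * π / 3 by ring, cos_two_pi_div_three] at h
  linarith [h]

/-- `det (E₁, E₀) = sin α' cos α - cos α' sin α = √3/2`. [folklore] -/
theorem sin_add_two_pi_div_three_sub (α : ℝ) :
    Real.sin (α + 2 * π / 3) * Real.cos α - Real.cos (α + 2 * π / 3) * Real.sin α = √3 / 2 := by
  rw [← Real.sin_sub, show α + 2 * π / 3 - α = 2 * π / 3 by ring, sin_two_pi_div_three]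

/-- `|a E₁ + b E₀|² = a² + b² - ab` (the edges meet at angle `2π/3`). [folklore] -/
theorem edge_combination_norm_sq (α a b : ℝ) :
    (a * Real.cos α + b * Real.cos (α + 2 * π / 3)) ^ 2 +
      (a * Real.sin α + b * Real.sin (α + 2 * π / 3)) ^ 2 = a ^ 2 + b ^ 2 - a * b := by
  have h1 := Real.cos_sq_add_sin_sq α
  have h2 := Real.cos_sq_add_sin_sq (α + 2 * π / 3)
  have h3 := cos_mul_cos_add_sin_mul_sin α
  nlinarith [h1, h2, h3]

/-! ### Scalar building blocks of the sector map -/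

/-- `s = w₀`, the coordinate of `𝔻⁴ ⊂ ℝ × ℝ³` normal to the equatorial `3`-disc. [folklore] -/
def secS (w : 𝔼 4) : ℝ := w 0

/-- `u = 1 - ‖w‖²`, the boundary-defining function of the closed unit ball. [folklore] -/
def secU (w : 𝔼 4) : ℝ := 1 - ‖w‖ ^ 2

/-- `ν = √(u² + (2s)²) = |2s + iu|`. [folklore] -/
def secN (w : 𝔼 4) : ℝ := √(secU w ^ 2 + (2 * secS w) ^ 2)

/-- `y₀ = √((ν - 2s)/2)`, the imaginary part of the principal square root `√(2s + iu)`
(`= cornerUnbend (u, 2s, ·, ·) 0`). [cite: DouadyHerault1973, Appendice] -/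
def secY₀ (w : 𝔼 4) : ℝ := √((secN w - 2 * secS w) / 2)

/-- `y₁ = √((ν + 2s)/2)`, the real part of the principal square root `√(2s + iu)`
(`= cornerUnbend (u, 2s, ·, ·) 1`). [cite: DouadyHerault1973, Appendice] -/
def secY₁ (w : 𝔼 4) : ℝ := √((secN w + 2 * secS w) / 2)

/-- `m = √((2 + ν - 2u)/2)`, the radial correction `√(1 + Q)` (see the module docstring). [folklore] -/
def secM (w : 𝔼 4) : ℝ := √((2 + secN w - 2 * secU w) / 2)

/-- `λ = 2 / √((2 - u + ν)(2 + ν - 2u))`, the scaling of the `ℝ³`-factor. [folklore] -/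
def secL (w : 𝔼 4) : ℝ := 2 / √((2 - secU w + secN w) * (2 + secN w - 2 * secU w))

/-- `u ≤ 1`. [folklore] -/
theorem secU_le_one (w : 𝔼 4) : secU w ≤ 1 := by
  unfold secU; nlinarith [norm_nonneg w]

/-- `0 ≤ u` on the closed ball. [folklore] -/
theorem secU_nonneg {w : 𝔼 4} (hw : ‖w‖ ≤ 1) : 0 ≤ secU w := by
  unfold secU; nlinarith [norm_nonneg w]

/-- `0 ≤ ν`. [folklore] -/
theorem secN_nonneg (w : 𝔼 4) : 0 ≤ secN w := Real.sqrt_nonneg _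

/-- `ν² = u² + (2s)²`. [folklore] -/
theorem secN_sq (w : 𝔼 4) : secN w ^ 2 = secU w ^ 2 + (2 * secS w) ^ 2 :=
  Real.sq_sqrt (by positivity)

/-- `u ≤ ν`. [folklore] -/
theorem secU_le_secN (w : 𝔼 4) : secU w ≤ secN w := by
  rw [secN]
  calc secU w ≤ |secU w| := le_abs_self _
    _ = √(secU w ^ 2) := (Real.sqrt_sq_eq_abs _).symm
    _ ≤ √(secU w ^ 2 + (2 * secS w) ^ 2) := Real.sqrt_le_sqrt (by nlinarith)

/-- `2|s| ≤ ν`. [folklore] -/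
theorem two_mul_abs_secS_le_secN (w : 𝔼 4) : 2 * |secS w| ≤ secN w := by
  rw [secN]
  calc 2 * |secS w| = √((2 * secS w) ^ 2) := by
        rw [Real.sqrt_sq_eq_abs, abs_mul, abs_two]
    _ ≤ √(secU w ^ 2 + (2 * secS w) ^ 2) := Real.sqrt_le_sqrt (by nlinarith)

/-- `0 ≤ ν - 2s`. [folklore] -/
theorem secN_sub_nonneg (w : 𝔼 4) : 0 ≤ secN w - 2 * secS w := by
  linarith [two_mul_abs_secS_le_secN w, le_abs_self (secS w)]

/-- `0 ≤ ν + 2s`. [folklore] -/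
theorem secN_add_nonneg (w : 𝔼 4) : 0 ≤ secN w + 2 * secS w := by
  linarith [two_mul_abs_secS_le_secN w, neg_abs_le (secS w)]

/-- `0 ≤ y₀`. [folklore] -/
theorem secY₀_nonneg (w : 𝔼 4) : 0 ≤ secY₀ w := Real.sqrt_nonneg _

/-- `0 ≤ y₁`. [folklore] -/
theorem secY₁_nonneg (w : 𝔼 4) : 0 ≤ secY₁ w := Real.sqrt_nonneg _

/-- `y₀² = (ν - 2s)/2`. [folklore] -/
theorem secY₀_sq (w : 𝔼 4) : secY₀ w ^ 2 = (secN w - 2 * secS w) / 2 :=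
  Real.sq_sqrt (by linarith [secN_sub_nonneg w])

/-- `y₁² = (ν + 2s)/2`. [folklore] -/
theorem secY₁_sq (w : 𝔼 4) : secY₁ w ^ 2 = (secN w + 2 * secS w) / 2 :=
  Real.sq_sqrt (by linarith [secN_add_nonneg w])

/-- `y₀² + y₁² = ν` (`|√τ|² = |τ|`). [folklore] -/
theorem secY₀_sq_add_secY₁_sq (w : 𝔼 4) : secY₀ w ^ 2 + secY₁ w ^ 2 = secN w := by
  rw [secY₀_sq, secY₁_sq]; ring

/-- `y₁² - y₀² = 2s` (`Re (√τ)² = Re τ`). [folklore] -/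
theorem secY₁_sq_sub_secY₀_sq (w : 𝔼 4) : secY₁ w ^ 2 - secY₀ w ^ 2 = 2 * secS w := by
  rw [secY₀_sq, secY₁_sq]; ring

/-- `2 y₀ y₁ = u` on the closed ball (`Im (√τ)² = Im τ`; this is `cornerFold ∘ cornerUnbend = id`
in the first coordinate). [cite: DouadyHerault1973, Appendice] -/
theorem two_mul_secY₀_mul_secY₁ {w : 𝔼 4} (hw : ‖w‖ ≤ 1) : 2 * secY₀ w * secY₁ w = secU w := by
  have hu := secU_nonneg hw
  have h : (2 * secY₀ w * secY₁ w) ^ 2 = secU w ^ 2 := by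
    calc (2 * secY₀ w * secY₁ w) ^ 2 = 4 * secY₀ w ^ 2 * secY₁ w ^ 2 := by ring
      _ = secN w ^ 2 - (2 * secS w) ^ 2 := by rw [secY₀_sq, secY₁_sq]; ring
      _ = secU w ^ 2 := by rw [secN_sq]; ring
  exact (pow_left_inj₀ (mul_nonneg (mul_nonneg zero_le_two (secY₀_nonneg w)) (secY₁_nonneg w))
    hu two_ne_zero).mp h

/-- `0 < 2 + ν - 2u` (as `u ≤ ν` and `u ≤ 1`). [folklore] -/
theorem two_add_secN_sub_pos (w : 𝔼 4) : 0 < 2 + secN w - 2 * secU w := by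
  linarith [secU_le_secN w, secU_le_one w]

/-- `0 < 2 - u + ν`. [folklore] -/
theorem two_sub_secU_add_pos (w : 𝔼 4) : 0 < 2 - secU w + secN w := by
  linarith [secN_nonneg w, secU_le_one w]

/-- `0 < m`. [folklore] -/
theorem secM_pos (w : 𝔼 4) : 0 < secM w :=
  Real.sqrt_pos.2 (by linarith [two_add_secN_sub_pos w])

/-- `m² = (2 + ν - 2u)/2`. [folklore] -/
theorem secM_sq (w : 𝔼 4) : secM w ^ 2 = (2 + secN w - 2 * secU w) / 2 :=
  Real.sq_sqrt (by linarith [two_add_secN_sub_pos w])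

/-- `0 < λ`. [folklore] -/
theorem secL_pos (w : 𝔼 4) : 0 < secL w :=
  div_pos two_pos (Real.sqrt_pos.2 (mul_pos (two_sub_secU_add_pos w) (two_add_secN_sub_pos w)))

/-- `λ² = 4 / ((2 - u + ν)(2 + ν - 2u))`. [folklore] -/
theorem secL_sq (w : 𝔼 4) :
    secL w ^ 2 = 4 / ((2 - secU w + secN w) * (2 + secN w - 2 * secU w)) := by
  rw [secL, div_pow, Real.sq_sqrt (mul_pos (two_sub_secU_add_pos w) (two_add_secN_sub_pos w)).le]
  norm_num

/-- `‖w‖² = s² + (w₁² + w₂² + w₃²)`. [folklore] -/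
theorem norm_sq_eq_four (w : 𝔼 4) : ‖w‖ ^ 2 = secS w ^ 2 + (w 1 ^ 2 + w 2 ^ 2 + w 3 ^ 2) :=
  norm_sq_eq_four' w

/-! ### The sector map -/

/-- **The sector map as a formula `ℝ⁴ → ℝ⁵`** for the sector of angles `[α, α + 2π/3]`:
`w ↦ ((y₁ E₁ + y₀ E₀)/m, λ w₁, λ w₂, λ w₃)` with `E₁ = (cos α, sin α)`, `E₀ = (cos α', sin α')`,
`α' = α + 2π/3` (see the module docstring). [cite: GayKirby2016, §2 (arXiv p. 5), first example] -/
def sectorMapFun (α : ℝ) (w : 𝔼 4) : 𝔼 5 :=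
  !₂[(secY₁ w * Real.cos α + secY₀ w * Real.cos (α + 2 * π / 3)) / secM w,
     (secY₁ w * Real.sin α + secY₀ w * Real.sin (α + 2 * π / 3)) / secM w,
     secL w * w 1, secL w * w 2, secL w * w 3]

/-- Coordinate `0` of the sector map: `(y₁ cos α + y₀ cos α')/m`. [cite: GayKirby2016, §2 (arXiv p. 5), first example] -/
@[simp] theorem sectorMapFun_apply_zero (α : ℝ) (w : 𝔼 4) :
    sectorMapFun α w 0 = (secY₁ w * Real.cos α + secY₀ w * Real.cos (α + 2 * π / 3)) / secM w := rfl

/-- Coordinate `1` of the sector map: `(y₁ sin α + y₀ sin α')/m`. [cite: GayKirby2016, §2 (arXiv p. 5), first example] -/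
@[simp] theorem sectorMapFun_apply_one (α : ℝ) (w : 𝔼 4) :
    sectorMapFun α w 1 = (secY₁ w * Real.sin α + secY₀ w * Real.sin (α + 2 * π / 3)) / secM w := rfl

/-- Coordinate `2` of the sector map: `λ w₁`. [cite: GayKirby2016, §2 (arXiv p. 5), first example] -/
@[simp] theorem sectorMapFun_apply_two (α : ℝ) (w : 𝔼 4) : sectorMapFun α w 2 = secL w * w 1 := rfl

/-- Coordinate `3` of the sector map: `λ w₂`. [cite: GayKirby2016, §2 (arXiv p. 5), first example] -/
@[simp] theorem sectorMapFun_apply_three (α : ℝ) (w : 𝔼 4) : sectorMapFun α w 3 = secL w * w 2 := rfl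

/-- Coordinate `4` of the sector map: `λ w₃`. [cite: GayKirby2016, §2 (arXiv p. 5), first example] -/
@[simp] theorem sectorMapFun_apply_four (α : ℝ) (w : 𝔼 4) : sectorMapFun α w 4 = secL w * w 3 := rfl

/-- The sector map written with the edge coefficients `a = y₁/m`, `b = y₀/m`. [cite: GayKirby2016, §2 (arXiv p. 5), first example] -/
theorem sectorMapFun_eq (α : ℝ) (w : 𝔼 4) : sectorMapFun α w =
    !₂[(secY₁ w / secM w) * Real.cos α + (secY₀ w / secM w) * Real.cos (α + 2 * π / 3),
      (secY₁ w / secM w) * Real.sin α + (secY₀ w / secM w) * Real.sin (α + 2 * π / 3),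
      secL w * w 1, secL w * w 2, secL w * w 3] := by
  ext i; fin_cases i <;> simp [sectorMapFun] <;> ring

/-- **The sector map lands on the unit sphere** for `‖w‖ ≤ 1`:
`|y₁ E₁ + y₀ E₀|²/m² + λ² ‖v‖² = (2ν - u)/(2 + ν - 2u) + (2 - ν - u)/(2 + ν - 2u) = 1`.
[cite: GayKirby2016, §2 (arXiv p. 5), first example] -/
theorem norm_sectorMapFun {α : ℝ} {w : 𝔼 4} (hw : ‖w‖ ≤ 1) : ‖sectorMapFun α w‖ = 1 := by
  have hM := secM_pos w
  have hMsq := secM_sq w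
  have hL := secL_sq w
  have hν := secN_sq w
  have hy := secY₀_sq_add_secY₁_sq w
  have hyy := two_mul_secY₀_mul_secY₁ hw
  have hn := norm_sq_eq_four w
  have hA := two_sub_secU_add_pos w
  have hB := two_add_secN_sub_pos w
  have hsq : ‖sectorMapFun α w‖ ^ 2 = 1 := by
    rw [EuclideanSpace.norm_sq_eq]
    simp only [Fin.sum_univ_five, Real.norm_eq_abs, sq_abs, sectorMapFun_apply_zero,
      sectorMapFun_apply_one, sectorMapFun_apply_two, sectorMapFun_apply_three,
      sectorMapFun_apply_four]
    rw [div_pow, div_pow, ← add_div, edge_combination_norm_sq, mul_pow, mul_pow, mul_pow, hL, hMsq]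
    have hu : secU w = 1 - ‖w‖ ^ 2 := rfl
    field_simp
    nlinarith [hν, hy, hyy, hn, hu]
  have h0 : 0 ≤ ‖sectorMapFun α w‖ := norm_nonneg _
  nlinarith [hsq, h0]

/-- `s` is continuous. [folklore] -/
theorem continuous_secS : Continuous secS := by unfold secS; fun_prop
/-- `u` is continuous. [folklore] -/
theorem continuous_secU : Continuous secU := by unfold secU; fun_prop
/-- `ν` is continuous. [folklore] -/
theorem continuous_secN : Continuous secN :=
  Real.continuous_sqrt.comp ((continuous_secU.pow 2).add ((continuous_const.mul continuous_secS).pow 2))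
/-- `y₀` is continuous. [folklore] -/
theorem continuous_secY₀ : Continuous secY₀ :=
  Real.continuous_sqrt.comp ((continuous_secN.sub (continuous_const.mul continuous_secS)).div_const _)
/-- `y₁` is continuous. [folklore] -/
theorem continuous_secY₁ : Continuous secY₁ :=
  Real.continuous_sqrt.comp ((continuous_secN.add (continuous_const.mul continuous_secS)).div_const _)
/-- `m` is continuous. [folklore] -/
theorem continuous_secM : Continuous secM :=
  Real.continuous_sqrt.comp (((continuous_const.add continuous_secN).sub
    (continuous_const.mul continuous_secU)).div_const _)
/-- `λ` is continuous. [folklore] -/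
theorem continuous_secL : Continuous secL := by
  refine continuous_const.div (Real.continuous_sqrt.comp ?_) fun w => ?_
  · exact ((continuous_const.sub continuous_secU).add continuous_secN).mul
      ((continuous_const.add continuous_secN).sub (continuous_const.mul continuous_secU))
  · exact (Real.sqrt_pos.2 (mul_pos (two_sub_secU_add_pos w) (two_add_secN_sub_pos w))).ne'

/-- The sector map formula is continuous on all of `ℝ⁴` (it is not differentiable along `K`). [folklore] -/
theorem continuous_sectorMapFun (α : ℝ) : Continuous (sectorMapFun α) := by
  have hc : ∀ i : Fin 4, Continuous fun w : 𝔼 4 => w i := fun i => by fun_prop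
  refine continuous_euclidean fun i => ?_
  fin_cases i
  · exact ((continuous_secY₁.mul continuous_const).add (continuous_secY₀.mul continuous_const)).div
      continuous_secM fun w => (secM_pos w).ne'
  · exact ((continuous_secY₁.mul continuous_const).add (continuous_secY₀.mul continuous_const)).div
      continuous_secM fun w => (secM_pos w).ne'
  · exact continuous_secL.mul (hc 1)
  · exact continuous_secL.mul (hc 2)
  · exact continuous_secL.mul (hc 3)

/-- **The sector map `𝔻⁴ → S⁴`** of the sector of angles `[α, α + 2π/3]` (Gay–Kirby's `X_j` for
`α = 2πj/3`): the closed unit `4`-ball parametrises the sector, with the corner of the sector along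
`F = {z = 0}` opened by the principal square root. [cite: GayKirby2016, §2 (arXiv p. 5), first example] -/
def sectorMap (α : ℝ) (w : 𝔻 4) : 𝕊 4 :=
  ⟨sectorMapFun α w, mem_sphere_zero_iff_norm.2 (norm_sectorMapFun (mem_closedBall_zero_iff.1 w.2))⟩

/-- The sector map in `ℝ⁵` is the formula `sectorMapFun`. [cite: GayKirby2016, §2 (arXiv p. 5), first example] -/
@[simp] theorem coe_sectorMap (α : ℝ) (w : 𝔻 4) : (sectorMap α w : 𝔼 5) = sectorMapFun α w := rfl

/-- The sector map is continuous. [cite: GayKirby2016, §2 (arXiv p. 5), first example] -/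
theorem continuous_sectorMap (α : ℝ) : Continuous (sectorMap α) :=
  ((continuous_sectorMapFun α).comp continuous_subtype_val).subtype_mk _

/-! ### The smooth left inverse -/

/-- The coefficient `a` of `z = (x₀, x₁)` along `E₁ = e^{iα}` in the basis `(E₁, E₀)`:
`a = (2/√3) (x₀ sin α' - x₁ cos α')`. [folklore] -/
def invA (α : ℝ) (x : 𝔼 5) : ℝ :=
  2 / √3 * (x 0 * Real.sin (α + 2 * π / 3) - x 1 * Real.cos (α + 2 * π / 3))

/-- The coefficient `b` of `z` along `E₀ = e^{i(α + 2π/3)}`: `b = (2/√3) (x₁ cos α - x₀ sin α)`. [folklore] -/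
def invB (α : ℝ) (x : 𝔼 5) : ℝ := 2 / √3 * (x 1 * Real.cos α - x 0 * Real.sin α)

/-- The quadratic form `Q = (a² + b²)/2 - 2ab` of the radial correction `h(z) = z/√(1 - Q(z))`. [folklore] -/
def invQ (α : ℝ) (x : 𝔼 5) : ℝ := (invA α x ^ 2 + invB α x ^ 2) / 2 - 2 * invA α x * invB α x

/-- `m² = 1/(1 - Q)` (junk value `0`-ish off `{Q < 1}`, never used there). [folklore] -/
def invM2 (α : ℝ) (x : 𝔼 5) : ℝ := 1 / (1 - invQ α x)

/-- The recovered `s = (y₁² - y₀²)/2 = m² (a² - b²)/2`. [folklore] -/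
def invS (α : ℝ) (x : 𝔼 5) : ℝ := invM2 α x * (invA α x ^ 2 - invB α x ^ 2) / 2

/-- The recovered `u = 2 y₀ y₁ = 2 m² a b`. [folklore] -/
def invU (α : ℝ) (x : 𝔼 5) : ℝ := 2 * invM2 α x * invA α x * invB α x

/-- The recovered `ν = y₀² + y₁² = m² (a² + b²)`. [folklore] -/
def invN (α : ℝ) (x : 𝔼 5) : ℝ := invM2 α x * (invA α x ^ 2 + invB α x ^ 2)

/-- The recovered `1/λ = √((2 - u + ν)(2 + ν - 2u))/2`. [folklore] -/
def invScale (α : ℝ) (x : 𝔼 5) : ℝ := √((2 - invU α x + invN α x) * (2 + invN α x - 2 * invU α x)) / 2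

/-- **The left inverse of the sector map** as a map `ℝ⁵ → ℝ⁴`, `(z, t) ↦ (s, t/λ)`; all its
ingredients are polynomial in `(a, b, m²)`, so it is smooth on `{Q < 1}` (which contains the sector). [folklore] -/
def sectorInvFun (α : ℝ) (x : 𝔼 5) : 𝔼 4 :=
  !₂[invS α x, invScale α x * x 2, invScale α x * x 3, invScale α x * x 4]

/-- Coordinate `0` of the left inverse: `s`. [folklore] -/
@[simp] theorem sectorInvFun_apply_zero (α : ℝ) (x : 𝔼 5) : sectorInvFun α x 0 = invS α x := rfl
/-- Coordinate `1` of the left inverse: `x₂/λ`. [folklore] -/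
@[simp] theorem sectorInvFun_apply_one (α : ℝ) (x : 𝔼 5) : sectorInvFun α x 1 = invScale α x * x 2 := rfl
/-- Coordinate `2` of the left inverse: `x₃/λ`. [folklore] -/
@[simp] theorem sectorInvFun_apply_two (α : ℝ) (x : 𝔼 5) : sectorInvFun α x 2 = invScale α x * x 3 := rfl
/-- Coordinate `3` of the left inverse: `x₄/λ`. [folklore] -/
@[simp] theorem sectorInvFun_apply_three (α : ℝ) (x : 𝔼 5) : sectorInvFun α x 3 = invScale α x * x 4 := rfl

/-- The `E₁`-coefficient of `a E₁ + b E₀` is `a`. [folklore] -/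
theorem invA_edge (α a b x₂ x₃ x₄ : ℝ) :
    invA α !₂[a * Real.cos α + b * Real.cos (α + 2 * π / 3),
      a * Real.sin α + b * Real.sin (α + 2 * π / 3), x₂, x₃, x₄] = a := by
  have h := sin_add_two_pi_div_three_sub α
  have h3 : (√3 : ℝ) ≠ 0 := by positivity
  have key : (a * Real.cos α + b * Real.cos (α + 2 * π / 3)) * Real.sin (α + 2 * π / 3) -
      (a * Real.sin α + b * Real.sin (α + 2 * π / 3)) * Real.cos (α + 2 * π / 3) = a * (√3 / 2) := by
    linear_combination a * h
  calc invA α !₂[a * Real.cos α + b * Real.cos (α + 2 * π / 3),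
        a * Real.sin α + b * Real.sin (α + 2 * π / 3), x₂, x₃, x₄]
        = 2 / √3 * ((a * Real.cos α + b * Real.cos (α + 2 * π / 3)) * Real.sin (α + 2 * π / 3) -
          (a * Real.sin α + b * Real.sin (α + 2 * π / 3)) * Real.cos (α + 2 * π / 3)) := rfl
    _ = 2 / √3 * (a * (√3 / 2)) := by rw [key]
    _ = a := by field_simp

/-- The `E₀`-coefficient of `a E₁ + b E₀` is `b`. [folklore] -/
theorem invB_edge (α a b x₂ x₃ x₄ : ℝ) :
    invB α !₂[a * Real.cos α + b * Real.cos (α + 2 * π / 3),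
      a * Real.sin α + b * Real.sin (α + 2 * π / 3), x₂, x₃, x₄] = b := by
  have h := sin_add_two_pi_div_three_sub α
  have h3 : (√3 : ℝ) ≠ 0 := by positivity
  have key : (a * Real.sin α + b * Real.sin (α + 2 * π / 3)) * Real.cos α -
      (a * Real.cos α + b * Real.cos (α + 2 * π / 3)) * Real.sin α = b * (√3 / 2) := by
    linear_combination b * h
  calc invB α !₂[a * Real.cos α + b * Real.cos (α + 2 * π / 3),
        a * Real.sin α + b * Real.sin (α + 2 * π / 3), x₂, x₃, x₄]
        = 2 / √3 * ((a * Real.sin α + b * Real.sin (α + 2 * π / 3)) * Real.cos α -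
          (a * Real.cos α + b * Real.cos (α + 2 * π / 3)) * Real.sin α) := rfl
    _ = 2 / √3 * (b * (√3 / 2)) := by rw [key]
    _ = b := by field_simp

/-- `a (sectorMap w) = y₁/m`. [folklore] -/
theorem invA_sectorMapFun (α : ℝ) (w : 𝔼 4) : invA α (sectorMapFun α w) = secY₁ w / secM w := by
  rw [sectorMapFun_eq, invA_edge]

/-- `b (sectorMap w) = y₀/m`. [folklore] -/
theorem invB_sectorMapFun (α : ℝ) (w : 𝔼 4) : invB α (sectorMapFun α w) = secY₀ w / secM w := by
  rw [sectorMapFun_eq, invB_edge]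

/-- `m² (sectorMap w) = m²`: `1 - Q = (m² - ν/2 + u)/m² = 1/m²`. [folklore] -/
theorem invM2_sectorMapFun {α : ℝ} {w : 𝔼 4} (hw : ‖w‖ ≤ 1) :
    invM2 α (sectorMapFun α w) = secM w ^ 2 := by
  have hM := secM_pos w
  have hQ : 1 - invQ α (sectorMapFun α w) = 1 / secM w ^ 2 := by
    rw [invQ, invA_sectorMapFun, invB_sectorMapFun]
    have h1 := secY₀_sq_add_secY₁_sq w
    have h2 := two_mul_secY₀_mul_secY₁ hw
    have h3 := secM_sq w
    field_simp
    nlinarith [h1, h2, h3]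
  rw [invM2, hQ, one_div_one_div]

/-- `s (sectorMap w) = s`. [folklore] -/
theorem invS_sectorMapFun {α : ℝ} {w : 𝔼 4} (hw : ‖w‖ ≤ 1) : invS α (sectorMapFun α w) = secS w := by
  rw [invS, invM2_sectorMapFun hw, invA_sectorMapFun, invB_sectorMapFun]
  have hM := secM_pos w
  have h := secY₁_sq_sub_secY₀_sq w
  field_simp
  nlinarith [h]

/-- `u (sectorMap w) = u`. [folklore] -/
theorem invU_sectorMapFun {α : ℝ} {w : 𝔼 4} (hw : ‖w‖ ≤ 1) : invU α (sectorMapFun α w) = secU w := by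
  rw [invU, invM2_sectorMapFun hw, invA_sectorMapFun, invB_sectorMapFun]
  have hM := secM_pos w
  have h := two_mul_secY₀_mul_secY₁ hw
  field_simp
  nlinarith [h]

/-- `ν (sectorMap w) = ν`. [folklore] -/
theorem invN_sectorMapFun {α : ℝ} {w : 𝔼 4} (hw : ‖w‖ ≤ 1) : invN α (sectorMapFun α w) = secN w := by
  rw [invN, invM2_sectorMapFun hw, invA_sectorMapFun, invB_sectorMapFun]
  have hM := secM_pos w
  have h := secY₀_sq_add_secY₁_sq w
  field_simp
  nlinarith [h]

/-- `(1/λ) (sectorMap w) = 1/λ`. [folklore] -/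
theorem invScale_sectorMapFun {α : ℝ} {w : 𝔼 4} (hw : ‖w‖ ≤ 1) :
    invScale α (sectorMapFun α w) = (secL w)⁻¹ := by
  rw [invScale, invU_sectorMapFun hw, invN_sectorMapFun hw, secL, inv_div]

/-- **`sectorInvFun` is a left inverse of the sector map on the closed ball.** [folklore] -/
theorem sectorInvFun_sectorMapFun {α : ℝ} {w : 𝔼 4} (hw : ‖w‖ ≤ 1) :
    sectorInvFun α (sectorMapFun α w) = w := by
  have hL := (secL_pos w).ne'
  ext i
  fin_cases i
  · exact invS_sectorMapFun hw
  · simp [invScale_sectorMapFun hw, hL]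
  · simp [invScale_sectorMapFun hw, hL]
  · simp [invScale_sectorMapFun hw, hL]

/-- `sectorInvFun ∘ sectorMap = id` on `𝔻⁴`. [folklore] -/
theorem sectorInvFun_sectorMap (α : ℝ) (w : 𝔻 4) : sectorInvFun α (sectorMap α w) = w :=
  sectorInvFun_sectorMapFun (mem_closedBall_zero_iff.1 w.2)

/-- **The sector map is injective.** [cite: GayKirby2016, §2 (arXiv p. 5), first example] -/
theorem injective_sectorMap (α : ℝ) : Injective (sectorMap α) := fun w w' h =>
  Subtype.ext (by rw [← sectorInvFun_sectorMap α w, ← sectorInvFun_sectorMap α w', h])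

/-- **The sector map is a (closed) topological embedding** (injective and continuous on the compact
ball). [cite: GayKirby2016, §2 (arXiv p. 5), first example] -/
theorem isEmbedding_sectorMap (α : ℝ) : Topology.IsEmbedding (sectorMap α) :=
  ((continuous_sectorMap α).isClosedEmbedding (injective_sectorMap α)).isEmbedding

/-! ### The image lies in the sector -/

/-- Elementary inequality behind `β ≤ 2π/3` in `exists_polar_of_edge_combination`. [folklore] -/
theorem sub_two_mul_le_of_sq_eq {a b ρ : ℝ} (ha : 0 ≤ a) (hρ : 0 ≤ ρ)
    (hρab : ρ ^ 2 = a ^ 2 - a * b + b ^ 2) : b - 2 * a ≤ ρ := by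
  by_contra hlt
  push Not at hlt
  nlinarith [mul_pos (sub_pos.2 hlt) (by linarith : 0 < b - 2 * a + ρ),
    mul_nonneg ha (by linarith : 0 ≤ b - a)]

/-- **A nonnegative combination of the two edge vectors lies in the closed angular sector**:
for `a, b ≥ 0` the plane vector `a e^{iα} + b e^{i(α + 2π/3)}` is `r e^{iθ}` with `r ≥ 0` and
`α ≤ θ ≤ α + 2π/3` (`θ = α + arccos (p₁/ρ)` for the rotated vector `(p₁, p₂)`). [folklore] -/
theorem exists_polar_of_edge_combination (α : ℝ) {a b : ℝ} (ha : 0 ≤ a) (hb : 0 ≤ b) :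
    ∃ r θ : ℝ, 0 ≤ r ∧ α ≤ θ ∧ θ ≤ α + 2 * π / 3 ∧
      a * Real.cos α + b * Real.cos (α + 2 * π / 3) = r * Real.cos θ ∧
      a * Real.sin α + b * Real.sin (α + 2 * π / 3) = r * Real.sin θ := by
  -- rotate back by `α`: the vector is `Rot_α (p₁, p₂)` with `p₂ ≥ 0`
  obtain ⟨p₁, hp₁⟩ : ∃ p₁ : ℝ, p₁ = a - b / 2 := ⟨_, rfl⟩
  obtain ⟨p₂, hp₂⟩ : ∃ p₂ : ℝ, p₂ = √3 / 2 * b := ⟨_, rfl⟩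
  have h3 : (√3 : ℝ) ^ 2 = 3 := Real.sq_sqrt (by norm_num)
  have hx : a * Real.cos α + b * Real.cos (α + 2 * π / 3) = p₁ * Real.cos α - p₂ * Real.sin α := by
    rw [Real.cos_add, cos_two_pi_div_three, sin_two_pi_div_three, hp₁, hp₂]; ring
  have hy : a * Real.sin α + b * Real.sin (α + 2 * π / 3) = p₁ * Real.sin α + p₂ * Real.cos α := by
    rw [Real.sin_add, cos_two_pi_div_three, sin_two_pi_div_three, hp₁, hp₂]; ring
  rw [hx, hy]
  have hp₂0 : 0 ≤ p₂ := by rw [hp₂]; positivity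
  obtain ⟨ρ, hρ⟩ : ∃ ρ : ℝ, ρ = √(p₁ ^ 2 + p₂ ^ 2) := ⟨_, rfl⟩
  have hρ0 : 0 ≤ ρ := hρ ▸ Real.sqrt_nonneg _
  have hρsq : ρ ^ 2 = p₁ ^ 2 + p₂ ^ 2 := hρ ▸ Real.sq_sqrt (by positivity)
  have hρab : ρ ^ 2 = a ^ 2 - a * b + b ^ 2 := by
    rw [hρsq, hp₁, hp₂, mul_pow, div_pow, h3]; ring
  have hπ : 0 < π := Real.pi_pos
  by_cases hρz : ρ = 0
  · -- the vector vanishes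
    have hp : p₁ ^ 2 + p₂ ^ 2 = 0 := by rw [← hρsq, hρz]; ring
    have h1 : p₁ = 0 := by nlinarith [sq_nonneg p₁, sq_nonneg p₂]
    have h2 : p₂ = 0 := by nlinarith [sq_nonneg p₁, sq_nonneg p₂]
    exact ⟨0, α, le_rfl, le_rfl, by linarith, by rw [h1, h2]; ring, by rw [h1, h2]; ring⟩
  · have hρpos : 0 < ρ := lt_of_le_of_ne hρ0 (Ne.symm hρz)
    have habs : -ρ ≤ p₁ ∧ p₁ ≤ ρ :=
      abs_le_of_sq_le_sq' (by rw [hρsq]; exact le_add_of_nonneg_right (sq_nonneg p₂)) hρ0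
    have hq1 : -1 ≤ p₁ / ρ := by rw [le_div_iff₀ hρpos]; linarith [habs.1]
    have hq2 : p₁ / ρ ≤ 1 := by rw [div_le_iff₀ hρpos]; linarith [habs.2]
    have hcosβ : Real.cos (Real.arccos (p₁ / ρ)) = p₁ / ρ := Real.cos_arccos hq1 hq2
    have hsinβ : Real.sin (Real.arccos (p₁ / ρ)) = p₂ / ρ := by
      rw [Real.sin_arccos]
      have : 1 - (p₁ / ρ) ^ 2 = (p₂ / ρ) ^ 2 := by
        rw [eq_comm, eq_sub_iff_add_eq, div_pow, div_pow, ← add_div, add_comm, ← hρsq,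
          div_self (pow_ne_zero 2 hρz)]
      rw [this, Real.sqrt_sq (div_nonneg hp₂0 hρ0)]
    -- `β ≤ 2π/3` since `p₁/ρ ≥ -1/2`, i.e. `ρ ≥ b - 2a`
    have hlow : b - 2 * a ≤ ρ := sub_two_mul_le_of_sq_eq ha hρ0 hρab
    have hhalf : -1 / 2 ≤ p₁ / ρ := by
      rw [le_div_iff₀ hρpos, hp₁]; linarith
    have hβle : Real.arccos (p₁ / ρ) ≤ 2 * π / 3 := by
      calc Real.arccos (p₁ / ρ) ≤ Real.arccos (-1 / 2) := Real.arccos_le_arccos hhalf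
        _ = 2 * π / 3 := by
          rw [← cos_two_pi_div_three, Real.arccos_cos (by positivity) (by linarith)]
    refine ⟨ρ, α + Real.arccos (p₁ / ρ), hρ0, by linarith [Real.arccos_nonneg (p₁ / ρ)],
      by linarith, ?_, ?_⟩
    · rw [Real.cos_add, hcosβ, hsinβ]; field_simp
    · rw [Real.sin_add, hcosβ, hsinβ]; field_simp

/-- The sector map takes values in the sector `{α ≤ θ ≤ α + 2π/3}` (its edge coefficients
`y₁/m, y₀/m` are nonnegative). [cite: GayKirby2016, §2 (arXiv p. 5), first example] -/
theorem exists_polar_sectorMapFun (α : ℝ) (w : 𝔼 4) :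
    ∃ r θ : ℝ, 0 ≤ r ∧ α ≤ θ ∧ θ ≤ α + 2 * π / 3 ∧
      sectorMapFun α w 0 = r * Real.cos θ ∧ sectorMapFun α w 1 = r * Real.sin θ := by
  obtain ⟨r, θ, hr, h1, h2, hc, hs⟩ := exists_polar_of_edge_combination α
    (div_nonneg (secY₁_nonneg w) (secM_pos w).le) (div_nonneg (secY₀_nonneg w) (secM_pos w).le)
  refine ⟨r, θ, hr, h1, h2, ?_, ?_⟩
  · rw [← hc, sectorMapFun_apply_zero]; ring
  · rw [← hs, sectorMapFun_apply_one]; ring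

/-! ### Right-inverse identities: the sector map after its left inverse -/

/-- Reconstruction of `x₀` from the edge coefficients: `x₀ = a cos α + b cos α'`. [folklore] -/
theorem apply_zero_eq_invA_invB (α : ℝ) (x : 𝔼 5) :
    x 0 = invA α x * Real.cos α + invB α x * Real.cos (α + 2 * π / 3) := by
  have h := sin_add_two_pi_div_three_sub α
  have h3 : (√3 : ℝ) ≠ 0 := by positivity
  have key : (x 0 * Real.sin (α + 2 * π / 3) - x 1 * Real.cos (α + 2 * π / 3)) * Real.cos α +
      (x 1 * Real.cos α - x 0 * Real.sin α) * Real.cos (α + 2 * π / 3) = x 0 * (√3 / 2) := by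
    linear_combination x 0 * h
  calc x 0 = 2 / √3 * (x 0 * (√3 / 2)) := by field_simp
    _ = _ := by rw [← key, invA, invB]; ring

/-- Reconstruction of `x₁`: `x₁ = a sin α + b sin α'`. [folklore] -/
theorem apply_one_eq_invA_invB (α : ℝ) (x : 𝔼 5) :
    x 1 = invA α x * Real.sin α + invB α x * Real.sin (α + 2 * π / 3) := by
  have h := sin_add_two_pi_div_three_sub α
  have h3 : (√3 : ℝ) ≠ 0 := by positivity
  have key : (x 0 * Real.sin (α + 2 * π / 3) - x 1 * Real.cos (α + 2 * π / 3)) * Real.sin α +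
      (x 1 * Real.cos α - x 0 * Real.sin α) * Real.sin (α + 2 * π / 3) = x 1 * (√3 / 2) := by
    linear_combination x 1 * h
  calc x 1 = 2 / √3 * (x 1 * (√3 / 2)) := by field_simp
    _ = _ := by rw [← key, invA, invB]; ring

/-- `x₀² + x₁² = a² + b² - ab`. [folklore] -/
theorem sq_add_sq_eq_invA_invB (α : ℝ) (x : 𝔼 5) :
    x 0 ^ 2 + x 1 ^ 2 = invA α x ^ 2 + invB α x ^ 2 - invA α x * invB α x := by
  rw [apply_zero_eq_invA_invB α x, apply_one_eq_invA_invB α x, edge_combination_norm_sq]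

/-- `Q < 1` when `x₀² + x₁² ≤ 1` and the edge coefficients are nonnegative
(`Q = (x₀² + x₁²) - (a + b)²/2`). [folklore] -/
theorem invQ_lt_one_of_nonneg {α : ℝ} {x : 𝔼 5} (hx : x 0 ^ 2 + x 1 ^ 2 ≤ 1)
    (ha : 0 ≤ invA α x) (hb : 0 ≤ invB α x) : invQ α x < 1 := by
  have h := sq_add_sq_eq_invA_invB α x
  rw [invQ]
  by_contra hQ
  push Not at hQ
  have hab : (invA α x + invB α x) ^ 2 ≤ 0 := by nlinarith
  have hsum : invA α x + invB α x = 0 := by nlinarith [sq_nonneg (invA α x + invB α x)]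
  have ha0 : invA α x = 0 := by linarith
  have hb0 : invB α x = 0 := by linarith
  rw [ha0, hb0] at hQ
  norm_num at hQ

/-- For a point of the unit sphere with nonnegative edge coefficients, `Q < 1`. [folklore] -/
theorem invQ_lt_one_of_norm_eq_one {α : ℝ} {x : 𝔼 5} (hx : ‖x‖ = 1)
    (ha : 0 ≤ invA α x) (hb : 0 ≤ invB α x) : invQ α x < 1 := by
  refine invQ_lt_one_of_nonneg ?_ ha hb
  have hn := norm_sq_eq_five x
  rw [hx, one_pow] at hn
  nlinarith [sq_nonneg (x 2), sq_nonneg (x 3), sq_nonneg (x 4)]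

section Identities

variable {α : ℝ} {x : 𝔼 5}

/-- `0 < m²` on `{Q < 1}`. [folklore] -/
theorem invM2_pos (hQ : invQ α x < 1) : 0 < invM2 α x := by
  rw [invM2]; exact div_pos one_pos (by linarith)

/-- The defining relation `m² (1 - Q) = 1`, written as `m² (1 - Q) - 1 = 0`. [folklore] -/
theorem invM2_rel (hQ : invQ α x < 1) : invM2 α x * (1 - invQ α x) - 1 = 0 := by
  rw [invM2, one_div, inv_mul_cancel₀ (by linarith)]; ring

/-- `2 + ν - 2u = 2 m²`. [folklore] -/
theorem two_add_invN_sub (hQ : invQ α x < 1) : 2 + invN α x - 2 * invU α x = 2 * invM2 α x := by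
  have h := invM2_rel hQ
  rw [invQ] at h
  rw [invN, invU]
  linear_combination (-2 : ℝ) * h

/-- `2 - u + ν = 2 + m² (a - b)²`. [folklore] -/
theorem two_sub_invU_add (α : ℝ) (x : 𝔼 5) :
    2 - invU α x + invN α x = 2 + invM2 α x * (invA α x - invB α x) ^ 2 := by
  rw [invN, invU]; ring

/-- `ν² = u² + (2s)²`. [folklore] -/
theorem invN_sq (α : ℝ) (x : 𝔼 5) : invN α x ^ 2 = invU α x ^ 2 + (2 * invS α x) ^ 2 := by
  rw [invN, invU, invS]; ring

/-- `0 ≤ ν` on `{Q < 1}`. [folklore] -/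
theorem invN_nonneg (hQ : invQ α x < 1) : 0 ≤ invN α x := by
  rw [invN]; exact mul_nonneg (invM2_pos hQ).le (by positivity)

/-- `(ν + 2s)/2 = m² a²` (`= y₁²`). [folklore] -/
theorem invN_add_two_invS (α : ℝ) (x : 𝔼 5) :
    (invN α x + 2 * invS α x) / 2 = invM2 α x * invA α x ^ 2 := by
  rw [invN, invS]; ring

/-- `(ν - 2s)/2 = m² b²` (`= y₀²`). [folklore] -/
theorem invN_sub_two_invS (α : ℝ) (x : 𝔼 5) :
    (invN α x - 2 * invS α x) / 2 = invM2 α x * invB α x ^ 2 := by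
  rw [invN, invS]; ring

/-- `(1/λ)² = m² (2 + m² (a - b)²)/2`. [folklore] -/
theorem invScale_sq (hQ : invQ α x < 1) :
    invScale α x ^ 2 = invM2 α x * (2 + invM2 α x * (invA α x - invB α x) ^ 2) / 2 := by
  rw [invScale, div_pow, Real.sq_sqrt, two_sub_invU_add, two_add_invN_sub hQ]
  · ring
  · rw [two_sub_invU_add, two_add_invN_sub hQ]
    have := invM2_pos hQ
    positivity

/-- `0 < 1/λ` on `{Q < 1}`. [folklore] -/
theorem invScale_pos (hQ : invQ α x < 1) : 0 < invScale α x := by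
  rw [invScale, two_sub_invU_add, two_add_invN_sub hQ]
  have := invM2_pos hQ
  positivity

/-- **`‖sectorInvFun x‖² = 1 - u`** for `x` on the unit sphere with `Q < 1` (a polynomial identity
modulo `m² (1 - Q) = 1`). [folklore] -/
theorem norm_sq_sectorInvFun (hx : ‖x‖ = 1) (hQ : invQ α x < 1) :
    ‖sectorInvFun α x‖ ^ 2 = 1 - invU α x := by
  have hn := norm_sq_eq_five x
  rw [hx, one_pow, sq_add_sq_eq_invA_invB α x] at hn
  have htail : x 2 ^ 2 + x 3 ^ 2 + x 4 ^ 2 =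
      1 - (invA α x ^ 2 + invB α x ^ 2 - invA α x * invB α x) := by linarith
  have hrel := invM2_rel hQ
  rw [invQ] at hrel
  rw [norm_sq_eq_four, secS, sectorInvFun_apply_zero, sectorInvFun_apply_one,
    sectorInvFun_apply_two, sectorInvFun_apply_three, mul_pow, mul_pow, mul_pow, ← mul_add,
    ← mul_add, htail, invScale_sq hQ, invS, invU]
  linear_combination (1 + invM2 α x * (invA α x - invB α x) ^ 2 / 2) * hrel

/-- `s (sectorInvFun x) = s` (definitional). [folklore] -/
theorem secS_sectorInvFun (α : ℝ) (x : 𝔼 5) : secS (sectorInvFun α x) = invS α x := rfl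

/-- `u (sectorInvFun x) = u`. [folklore] -/
theorem secU_sectorInvFun (hx : ‖x‖ = 1) (hQ : invQ α x < 1) :
    secU (sectorInvFun α x) = invU α x := by
  rw [secU, norm_sq_sectorInvFun hx hQ]; ring

/-- `ν (sectorInvFun x) = ν`. [folklore] -/
theorem secN_sectorInvFun (hx : ‖x‖ = 1) (hQ : invQ α x < 1) :
    secN (sectorInvFun α x) = invN α x := by
  rw [secN, secU_sectorInvFun hx hQ, secS_sectorInvFun, ← invN_sq, Real.sqrt_sq (invN_nonneg hQ)]

/-- `m (sectorInvFun x) = √(m²)`. [folklore] -/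
theorem secM_sectorInvFun (hx : ‖x‖ = 1) (hQ : invQ α x < 1) :
    secM (sectorInvFun α x) = √(invM2 α x) := by
  rw [secM, secN_sectorInvFun hx hQ, secU_sectorInvFun hx hQ, two_add_invN_sub hQ]
  congr 1; ring

/-- `λ (sectorInvFun x) = (1/λ)⁻¹`. [folklore] -/
theorem secL_sectorInvFun (hx : ‖x‖ = 1) (hQ : invQ α x < 1) :
    secL (sectorInvFun α x) = (invScale α x)⁻¹ := by
  rw [secL, secN_sectorInvFun hx hQ, secU_sectorInvFun hx hQ, invScale, inv_div]

/-- `(y₁/m) (sectorInvFun x) = |a|`. [folklore] -/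
theorem secY₁_div_secM_sectorInvFun (hx : ‖x‖ = 1) (hQ : invQ α x < 1) :
    secY₁ (sectorInvFun α x) / secM (sectorInvFun α x) = |invA α x| := by
  have hm := invM2_pos hQ
  rw [secY₁, secM_sectorInvFun hx hQ, secN_sectorInvFun hx hQ, secS_sectorInvFun,
    invN_add_two_invS, ← Real.sqrt_div' _ hm.le, mul_div_cancel_left₀ _ hm.ne',
    Real.sqrt_sq_eq_abs]

/-- `(y₀/m) (sectorInvFun x) = |b|`. [folklore] -/
theorem secY₀_div_secM_sectorInvFun (hx : ‖x‖ = 1) (hQ : invQ α x < 1) :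
    secY₀ (sectorInvFun α x) / secM (sectorInvFun α x) = |invB α x| := by
  have hm := invM2_pos hQ
  rw [secY₀, secM_sectorInvFun hx hQ, secN_sectorInvFun hx hQ, secS_sectorInvFun,
    invN_sub_two_invS, ← Real.sqrt_div' _ hm.le, mul_div_cancel_left₀ _ hm.ne',
    Real.sqrt_sq_eq_abs]

/-- **The sector map inverts `sectorInvFun` on the sector**: for `x ∈ S⁴` with nonnegative edge
coefficients, `sectorMapFun α (sectorInvFun α x) = x`. [folklore] -/
theorem sectorMapFun_sectorInvFun (hx : ‖x‖ = 1) (ha : 0 ≤ invA α x) (hb : 0 ≤ invB α x) :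
    sectorMapFun α (sectorInvFun α x) = x := by
  have hQ : invQ α x < 1 := invQ_lt_one_of_norm_eq_one hx ha hb
  have hsc := (invScale_pos hQ).ne'
  have h0 := secY₁_div_secM_sectorInvFun hx hQ
  have h1 := secY₀_div_secM_sectorInvFun hx hQ
  rw [abs_of_nonneg ha] at h0
  rw [abs_of_nonneg hb] at h1
  rw [sectorMapFun_eq, h0, h1, secL_sectorInvFun hx hQ]
  ext i
  fin_cases i
  · exact (apply_zero_eq_invA_invB α x).symm
  · exact (apply_one_eq_invA_invB α x).symm
  · simp [hsc]
  · simp [hsc]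
  · simp [hsc]

/-- `‖sectorInvFun x‖ ≤ 1` when moreover `ab ≥ 0` (then `u = 2 m² a b ≥ 0`). [folklore] -/
theorem norm_sectorInvFun_le_one (hx : ‖x‖ = 1) (hQ : invQ α x < 1)
    (hab : 0 ≤ invA α x * invB α x) : ‖sectorInvFun α x‖ ≤ 1 := by
  have h := norm_sq_sectorInvFun hx hQ
  have hu : 0 ≤ invU α x := by
    rw [invU, mul_assoc]; exact mul_nonneg (mul_nonneg zero_le_two (invM2_pos hQ).le) hab
  nlinarith [norm_nonneg (sectorInvFun α x)]

end Identities

/-! ### The range of the sector map is the sector -/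

/-- The `E₁`-coefficient of a point of the sector is nonnegative: `a = (2/√3) r sin (α' - θ)`. [folklore] -/
theorem invA_nonneg_of_polar {α r θ : ℝ} {x : 𝔼 5} (hr : 0 ≤ r) (h₁ : α ≤ θ) (h₂ : θ ≤ α + 2 * π / 3)
    (hx₀ : x 0 = r * Real.cos θ) (hx₁ : x 1 = r * Real.sin θ) : 0 ≤ invA α x := by
  have hπ := Real.pi_pos
  have h : invA α x = 2 / √3 * (r * Real.sin (α + 2 * π / 3 - θ)) := by
    rw [invA, hx₀, hx₁, Real.sin_sub]; ring
  rw [h]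
  exact mul_nonneg (by positivity)
    (mul_nonneg hr (Real.sin_nonneg_of_nonneg_of_le_pi (by linarith) (by linarith)))

/-- The `E₀`-coefficient of a point of the sector is nonnegative: `b = (2/√3) r sin (θ - α)`. [folklore] -/
theorem invB_nonneg_of_polar {α r θ : ℝ} {x : 𝔼 5} (hr : 0 ≤ r) (h₁ : α ≤ θ) (h₂ : θ ≤ α + 2 * π / 3)
    (hx₀ : x 0 = r * Real.cos θ) (hx₁ : x 1 = r * Real.sin θ) : 0 ≤ invB α x := by
  have hπ := Real.pi_pos
  have h : invB α x = 2 / √3 * (r * Real.sin (θ - α)) := by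
    rw [invB, hx₀, hx₁, Real.sin_sub]; ring
  rw [h]
  exact mul_nonneg (by positivity)
    (mul_nonneg hr (Real.sin_nonneg_of_nonneg_of_le_pi (by linarith) (by linarith)))

/-- **The range of the sector map is the closed sector `{α ≤ θ ≤ α + 2π/3}` of `S⁴`** (points
`(r e^{iθ}, t)`, `r ≥ 0`). [cite: GayKirby2016, §2 (arXiv p. 5), first example] -/
theorem range_sectorMap (α : ℝ) : range (sectorMap α) =
    {x : 𝕊 4 | ∃ r θ : ℝ, 0 ≤ r ∧ α ≤ θ ∧ θ ≤ α + 2 * π / 3 ∧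
      (x : 𝔼 5) 0 = r * Real.cos θ ∧ (x : 𝔼 5) 1 = r * Real.sin θ} := by
  refine Subset.antisymm ?_ ?_
  · rintro _ ⟨w, rfl⟩
    exact exists_polar_sectorMapFun α w
  · rintro x ⟨r, θ, hr, h₁, h₂, hx₀, hx₁⟩
    have hx : ‖(x : 𝔼 5)‖ = 1 := norm_eq_of_mem_sphere x
    have ha := invA_nonneg_of_polar hr h₁ h₂ hx₀ hx₁
    have hb := invB_nonneg_of_polar hr h₁ h₂ hx₀ hx₁
    have hQ : invQ α (x : 𝔼 5) < 1 := invQ_lt_one_of_norm_eq_one hx ha hb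
    refine ⟨⟨sectorInvFun α x, mem_closedBall_zero_iff.2
      (norm_sectorInvFun_le_one hx hQ (mul_nonneg ha hb))⟩, Subtype.ext ?_⟩
    exact sectorMapFun_sectorInvFun hx ha hb

/-- **The range of `sectorMap (2πj/3)` is Gay–Kirby's sector `X_j`.** [cite: GayKirby2016, §2 (arXiv p. 5), first example] -/
theorem range_sectorMap_eq_sphereSector (j : Fin 3) :
    range (sectorMap (2 * π * (j : ℕ) / 3)) = sphereSector j := by
  rw [range_sectorMap]
  ext x
  rw [mem_setOf_eq, mem_sphereSector_iff]
  have h : 2 * π * (j : ℕ) / 3 + 2 * π / 3 = 2 * π * ((j : ℕ) + 1) / 3 := by ring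
  simp only [h]

/-! ### The corner locus `K = {s = 0, ‖w‖ = 1}` is the preimage of the central surface -/

/-- `ν = 0` iff `s = 0` and `u = 0`. [folklore] -/
theorem secN_eq_zero_iff (w : 𝔼 4) : secN w = 0 ↔ secS w = 0 ∧ secU w = 0 := by
  rw [secN, Real.sqrt_eq_zero (by positivity)]
  constructor
  · intro h
    have hu : secU w ^ 2 = 0 := by nlinarith [sq_nonneg (secU w), sq_nonneg (2 * secS w)]
    have hs : (2 * secS w) ^ 2 = 0 := by nlinarith [sq_nonneg (secU w), sq_nonneg (2 * secS w)]
    exact ⟨by simpa using pow_eq_zero_iff two_ne_zero |>.1 hs, pow_eq_zero_iff two_ne_zero |>.1 hu⟩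
  · rintro ⟨hs, hu⟩
    rw [hs, hu]; ring

/-- `u = 0` iff `‖w‖ = 1`. [folklore] -/
theorem secU_eq_zero_iff (w : 𝔼 4) : secU w = 0 ↔ ‖w‖ = 1 := by
  rw [secU, sub_eq_zero, eq_comm, pow_eq_one_iff_of_nonneg (norm_nonneg w) two_ne_zero]

/-- The sector map hits the central surface `{x₀ = x₁ = 0}` exactly on `K = {s = 0, ‖w‖ = 1}`
(`z = 0 ⇔ y₀ = y₁ = 0 ⇔ ν = 0`). [cite: GayKirby2016, §2 (arXiv p. 5), first example] -/
theorem sectorMapFun_apply_zero_one_eq_zero_iff (α : ℝ) (w : 𝔼 4) :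
    sectorMapFun α w 0 = 0 ∧ sectorMapFun α w 1 = 0 ↔ w 0 = 0 ∧ ‖w‖ = 1 := by
  have hM := secM_pos w
  constructor
  · rintro ⟨h0, h1⟩
    have ha := invA_sectorMapFun α w
    have hb := invB_sectorMapFun α w
    rw [invA, h0, h1] at ha
    rw [invB, h0, h1] at hb
    simp only [zero_mul, sub_zero, mul_zero] at ha hb
    have hy₁ : secY₁ w = 0 := by
      have := div_eq_zero_iff.1 ha.symm; exact this.resolve_right hM.ne'
    have hy₀ : secY₀ w = 0 := by
      have := div_eq_zero_iff.1 hb.symm; exact this.resolve_right hM.ne'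
    have hν : secN w = 0 := by rw [← secY₀_sq_add_secY₁_sq, hy₀, hy₁]; ring
    obtain ⟨hs, hu⟩ := (secN_eq_zero_iff w).1 hν
    exact ⟨hs, (secU_eq_zero_iff w).1 hu⟩
  · rintro ⟨hs, hn⟩
    have hu : secU w = 0 := (secU_eq_zero_iff w).2 hn
    have hν : secN w = 0 := (secN_eq_zero_iff w).2 ⟨hs, hu⟩
    have hy₀ : secY₀ w = 0 := by rw [secY₀, hν, show secS w = 0 from hs]; simp
    have hy₁ : secY₁ w = 0 := by rw [secY₁, hν, show secS w = 0 from hs]; simp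
    simp [hy₀, hy₁]

/-- **`sectorMap α w` lies on the central surface `F = X₀ ∩ X₁ ∩ X₂` iff `w ∈ K`**, i.e.
`w₀ = 0` and `‖w‖ = 1` (`K ⊆ ∂𝔻⁴` is the equatorial `2`-sphere of the boundary `3`-sphere).
[cite: GayKirby2016, §2 (arXiv p. 5), first example] -/
theorem sectorMap_mem_iInter_iff (α : ℝ) (w : 𝔻 4) :
    sectorMap α w ∈ (⋂ l, sphereSector l) ↔ (w : 𝔼 4) 0 = 0 ∧ ‖(w : 𝔼 4)‖ = 1 := by
  rw [iInter_sphereSector_eq, mem_setOf_eq, coe_sectorMap, sectorMapFun_apply_zero_one_eq_zero_iff]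

/-! ### The faces: `X_j ∩ X_l ⊆ e(∂𝔻⁴)` -/

/-- On the ray at angle `α + 2π/3` the `E₁`-coefficient vanishes. [folklore] -/
theorem invA_eq_zero_of_ray {α s : ℝ} {x : 𝔼 5} (hx₀ : x 0 = s * Real.cos (α + 2 * π / 3))
    (hx₁ : x 1 = s * Real.sin (α + 2 * π / 3)) : invA α x = 0 := by
  rw [invA, hx₀, hx₁]; ring

/-- On the ray at angle `α` the `E₀`-coefficient vanishes. [folklore] -/
theorem invB_eq_zero_of_ray {α s : ℝ} {x : 𝔼 5} (hx₀ : x 0 = s * Real.cos α)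
    (hx₁ : x 1 = s * Real.sin α) : invB α x = 0 := by
  rw [invB, hx₀, hx₁]; ring

/-- A point of the sector with `ab = 0` (i.e. on one of the two boundary rays, or on `F`) is the
image of a boundary point of `𝔻⁴` (`‖sectorInvFun x‖² = 1 - 2 m² a b = 1`, and
`∂𝔻⁴ = {‖w‖ = 1}` by `Literature.Topology.FourManifolds.boundary_closedBall`). [cite: GayKirby2016, §2 (arXiv p. 5), first example] -/
theorem mem_image_boundary_of_invA_mul_invB {α : ℝ} {x : 𝕊 4} (hx : x ∈ range (sectorMap α))
    (hab : invA α (x : 𝔼 5) * invB α (x : 𝔼 5) = 0) :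
    x ∈ sectorMap α '' (𝓡∂ 4).boundary (𝔻 4) := by
  rw [range_sectorMap] at hx
  obtain ⟨r, θ, hr, h₁, h₂, hx₀, hx₁⟩ := hx
  have hx1 : ‖(x : 𝔼 5)‖ = 1 := norm_eq_of_mem_sphere x
  have ha := invA_nonneg_of_polar hr h₁ h₂ hx₀ hx₁
  have hb := invB_nonneg_of_polar hr h₁ h₂ hx₀ hx₁
  have hQ : invQ α (x : 𝔼 5) < 1 := invQ_lt_one_of_norm_eq_one hx1 ha hb
  have hnorm : ‖sectorInvFun α x‖ = 1 := by
    have h := norm_sq_sectorInvFun hx1 hQ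
    rw [invU, mul_assoc, hab, mul_zero, sub_zero] at h
    have h0 := norm_nonneg (sectorInvFun α (x : 𝔼 5))
    nlinarith
  refine ⟨⟨sectorInvFun α x, mem_closedBall_zero_iff.2 hnorm.le⟩, ?_, Subtype.ext ?_⟩
  · rw [boundary_closedBall]; exact hnorm
  · exact sectorMapFun_sectorInvFun hx1 ha hb

/-- A point of `S⁴` on the closed ray at angle `α + 2π/3` is the image of a boundary point. [cite: GayKirby2016, §2 (arXiv p. 5), first example] -/
theorem mem_image_boundary_of_ray_right {α s : ℝ} {x : 𝕊 4} (hs : 0 ≤ s)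
    (hx₀ : (x : 𝔼 5) 0 = s * Real.cos (α + 2 * π / 3)) (hx₁ : (x : 𝔼 5) 1 = s * Real.sin (α + 2 * π / 3)) :
    x ∈ sectorMap α '' (𝓡∂ 4).boundary (𝔻 4) := by
  have hπ := Real.pi_pos
  refine mem_image_boundary_of_invA_mul_invB ?_ (by rw [invA_eq_zero_of_ray hx₀ hx₁, zero_mul])
  rw [range_sectorMap]
  exact ⟨s, α + 2 * π / 3, hs, by linarith, le_rfl, hx₀, hx₁⟩

/-- A point of `S⁴` on the closed ray at angle `α` is the image of a boundary point. [cite: GayKirby2016, §2 (arXiv p. 5), first example] -/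
theorem mem_image_boundary_of_ray_left {α s : ℝ} {x : 𝕊 4} (hs : 0 ≤ s)
    (hx₀ : (x : 𝔼 5) 0 = s * Real.cos α) (hx₁ : (x : 𝔼 5) 1 = s * Real.sin α) :
    x ∈ sectorMap α '' (𝓡∂ 4).boundary (𝔻 4) := by
  have hπ := Real.pi_pos
  refine mem_image_boundary_of_invA_mul_invB ?_ (by rw [invB_eq_zero_of_ray hx₀ hx₁, mul_zero])
  rw [range_sectorMap]
  exact ⟨s, α, hs, le_rfl, by linarith, hx₀, hx₁⟩

/-- **The double intersections `X_j ∩ X_l` (`l ≠ j`) lie in the image of `∂𝔻⁴`** under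
`sectorMap (2πj/3)` (they are the closed half great `3`-spheres at the two boundary angles of the
sector, `GayKirby.sphereSector_zero_inter_one` etc.). [cite: GayKirby2016, §2 (arXiv p. 5), first example] -/
theorem inter_sphereSector_subset_image_boundary (j l : Fin 3) (hjl : l ≠ j) :
    sphereSector j ∩ sphereSector l ⊆ sectorMap (2 * π * (j : ℕ) / 3) '' (𝓡∂ 4).boundary (𝔻 4) := by
  fin_cases j <;> fin_cases l
  · exact absurd rfl hjl
  · -- `X₀ ∩ X₁`: ray at `2π/3 = α + 2π/3`
    intro x hx
    have hx' : x ∈ sphereSector 0 ∩ sphereSector 1 := hx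
    rw [sphereSector_zero_inter_one] at hx'
    obtain ⟨s, hs, h0, h1⟩ := hx'
    refine mem_image_boundary_of_ray_right hs ?_ ?_
    · rw [h0]; congr 1; congr 1; simp
    · rw [h1]; congr 1; congr 1; simp
  · -- `X₀ ∩ X₂`: ray at `0 = α`
    intro x hx
    have hx' : x ∈ sphereSector 2 ∩ sphereSector 0 := ⟨hx.2, hx.1⟩
    rw [sphereSector_two_inter_zero] at hx'
    obtain ⟨h0, h1⟩ := hx'
    refine mem_image_boundary_of_ray_left (s := (x : 𝔼 5) 0) h0 ?_ ?_
    · simp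
    · rw [h1]; simp
  · -- `X₁ ∩ X₀`: ray at `2π/3 = α`
    intro x hx
    have hx' : x ∈ sphereSector 0 ∩ sphereSector 1 := ⟨hx.2, hx.1⟩
    rw [sphereSector_zero_inter_one] at hx'
    obtain ⟨s, hs, h0, h1⟩ := hx'
    refine mem_image_boundary_of_ray_left hs ?_ ?_
    · rw [h0]; congr 1; congr 1; simp
    · rw [h1]; congr 1; congr 1; simp
  · exact absurd rfl hjl
  · -- `X₁ ∩ X₂`: ray at `4π/3 = α + 2π/3`
    intro x hx
    have hx' : x ∈ sphereSector 1 ∩ sphereSector 2 := hx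
    rw [sphereSector_one_inter_two] at hx'
    obtain ⟨s, hs, h0, h1⟩ := hx'
    refine mem_image_boundary_of_ray_right hs ?_ ?_
    · rw [h0]; congr 1; congr 1; simp; ring
    · rw [h1]; congr 1; congr 1; simp; ring
  · -- `X₂ ∩ X₀`: ray at `2π = α + 2π/3`
    intro x hx
    have hx' : x ∈ sphereSector 2 ∩ sphereSector 0 := hx
    rw [sphereSector_two_inter_zero] at hx'
    obtain ⟨h0, h1⟩ := hx'
    have hang : (2 * π * ((2 : Fin 3) : ℕ) / 3 + 2 * π / 3 : ℝ) = 2 * π := by simp; ring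
    refine mem_image_boundary_of_ray_right (s := (x : 𝔼 5) 0) h0 ?_ ?_
    · show (x : 𝔼 5) 0 = (x : 𝔼 5) 0 * Real.cos (2 * π * ((2 : Fin 3) : ℕ) / 3 + 2 * π / 3)
      rw [hang, Real.cos_two_pi, mul_one]
    · show (x : 𝔼 5) 1 = (x : 𝔼 5) 0 * Real.sin (2 * π * ((2 : Fin 3) : ℕ) / 3 + 2 * π / 3)
      rw [hang, Real.sin_two_pi, mul_zero, h1]
  · -- `X₂ ∩ X₁`: ray at `4π/3 = α`
    intro x hx
    have hx' : x ∈ sphereSector 1 ∩ sphereSector 2 := ⟨hx.2, hx.1⟩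
    rw [sphereSector_one_inter_two] at hx'
    obtain ⟨s, hs, h0, h1⟩ := hx'
    exact mem_image_boundary_of_ray_left hs h0 h1
  · exact absurd rfl hjl

end GayKirby

/-! ### The two remaining differential-topological inputs (named facts) and the assembly -/

/-- **Named fact (sub-result of clause (ii) of `Literature.Topology.FourManifolds.IsGKTrisection` for the sectors of `S⁴`): the
sector map is a `C^∞` immersion off the corner locus.**  For every `α` and every `w ∈ 𝔻⁴` off
`K = {w₀ = 0, ‖w‖ = 1}` (equivalently, by `GayKirby.sectorMap_mem_iInter_iff`, with
`sectorMap α w ∉ F`), the sector map `GayKirby.sectorMap α : 𝔻⁴ → S⁴` is an immersion at `w` in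
Mathlib's chart sense (`Manifold.IsImmersionAt`, codimension `0`) — the first half of "`e` is a
`C^∞` immersion at every point not mapped to `F`" in clause (ii), i.e. of Gay–Kirby's "there is a
diffeomorphism `φᵢ : Xᵢ → Z_k`" away from the corner.  Blueprint: the smooth left inverse
`GayKirby.sectorInvFun α` (`s = (y₁² - y₀²)/2`, `t ↦ t/λ`, smooth on `{Q < 1}`) and the smooth
extensions `ẽ_±` of the sector map across `∂𝔻⁴` (replace `y₀ = √((ν - 2s)/2)` by
`u/√(2(ν + 2s))` where `ν + 2s > 0`, resp. `y₁` by `u/√(2(ν - 2s))` where `ν - 2s > 0`; both still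
land in `S⁴`) are mutually inverse diffeomorphisms between open sets `V_± ⊆ ℝ⁴` and `U_± ⊆ S⁴`
covering `𝔻⁴ ∖ K`; composing `ẽ_±⁻¹` with the chart of `𝔻⁴` at `w` (extended to `Literature.Topology.FourManifolds.polarChart`,
resp. the translation) gives charts in the maximal atlases in which the sector map reads as the
identity.  Discharged below (`Literature.Topology.FourManifolds.sectorMap_isImmersionAt_holds`, via `GayKirby.isImmersionAt_sectorMap`).
[cite: GayKirby2016, §2 (arXiv p. 5), first example; Def. 1, first bullet (arXiv p. 3)] -/
def sectorMap_isImmersionAt : Prop :=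
  ∀ (α : ℝ) (w : 𝔻 4), ¬ ((w : 𝔼 4) 0 = 0 ∧ ‖(w : 𝔼 4)‖ = 1) →
    Manifold.IsImmersionAt (𝓡∂ 4) (𝓡 4) ∞ (GayKirby.sectorMap α) w

/-- **Named fact (sub-result of clause (ii) of `Literature.Topology.FourManifolds.IsGKTrisection` for the sectors of `S⁴`): the
sector map has the corner model along `K`.**  For every `α` and every `w ∈ K = {w₀ = 0, ‖w‖ = 1}`
(the preimage of the central surface `F`), `Literature.IsCornerAt (sectorMap α) w`: with the chart
`φ = (1 - ‖w‖², 2 w₀, ς(v/‖v‖))` of `𝔻⁴` near `K` (`v = (w₁, w₂, w₃)`, `ς` a stereographic chart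
of `S²`; in the maximal `C^∞` atlas of `Literature.Topology.FourManifolds.instChartedSpaceClosedBall`), the chart
`ψ(z, t) = (h(z), ς(t/‖t‖))` of `S⁴` near `F` (`h(z) = z/√(1 - Q(z))`; in the maximal atlas of
the sphere) and `A (y₀, y₁, y₂, y₃) = (y₁ E₁ + y₀ E₀, y₂, y₃)` one has literally
`ψ ∘ sectorMap α ∘ φ⁻¹ = A ∘ cornerUnbend` on `φ`'s target, because by construction
`(y₀, y₁) = cornerUnbend (u, 2s, ·, ·)` and `h((y₁ E₁ + y₀ E₀)/m) = y₁ E₁ + y₀ E₀` — this is the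
"corners along `F`" reading of Gay–Kirby's Def. 1 spelled out in the docstring of
`Literature.Topology.FourManifolds.IsGKTrisection` (Douady's quadrant model).  Discharged below (`Literature.Topology.FourManifolds.sectorMap_isCornerAt_holds`, via `GayKirby.isCornerAt_sectorMap`).
[cite: GayKirby2016, §2 (arXiv p. 5), first example; Def. 1, first bullet (arXiv p. 3)] -/
def sectorMap_isCornerAt : Prop :=
  ∀ (α : ℝ) (w : 𝔻 4), (w : 𝔼 4) 0 = 0 → ‖(w : 𝔼 4)‖ = 1 → IsCornerAt (GayKirby.sectorMap α) w

/-- **Clause (ii) of `Literature.Topology.FourManifolds.IsGKTrisection` for Gay–Kirby's sectors from the two named facts.**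
`W := 𝔻⁴` (compact, connected, `IsManifold (𝓡∂ 4) ∞`, one `0`-handle and no `1`-handle:
`Literature.hasHandleDecomposition_closedBall 3`, `Literature.connectedSpace_closedBall 3`), `e := GayKirby.sectorMap (2πj/3)`
(a topological embedding with range `X_j`: `GayKirby.isEmbedding_sectorMap`,
`GayKirby.range_sectorMap_eq_sphereSector`; faces `X_j ∩ X_l ⊆ e(∂𝔻⁴)`:
`GayKirby.inter_sphereSector_subset_image_boundary`; corner locus:
`GayKirby.sectorMap_mem_iInter_iff`); the immersion and corner-chart clauses are the two inputs.
[cite: GayKirby2016, §2 (arXiv p. 5), first example; Def. 1, first bullet (arXiv p. 3)] -/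
theorem sphereSector_sectors_of_sectorMap (h₁ : sectorMap_isImmersionAt)
    (h₂ : sectorMap_isCornerAt) : sphereSector_sectors := by
  intro i
  haveI : ConnectedSpace (𝔻 4) := connectedSpace_closedBall 3
  refine ⟨𝔻 4, inferInstance, inferInstance, GayKirby.sectorMap (2 * π * (i : ℕ) / 3), inferInstance,
    inferInstance, inferInstance, hasHandleDecomposition_closedBall 3, GayKirby.isEmbedding_sectorMap _,
    GayKirby.range_sectorMap_eq_sphereSector i, fun w hw => ?_, fun w hw => ?_, fun j hj => ?_⟩
  · exact h₁ _ w (mt (GayKirby.sectorMap_mem_iInter_iff _ w).2 hw)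
  · obtain ⟨h0, h1⟩ := (GayKirby.sectorMap_mem_iInter_iff _ w).1 hw
    exact h₂ _ w h0 h1
  · exact GayKirby.inter_sphereSector_subset_image_boundary i j hj

/-- **Gay–Kirby's genus-`0` trisection of `S⁴` from the two named facts** (clauses (i) and (iii) of
`Literature.Topology.FourManifolds.IsGKTrisection` being proved: `GayKirby.iUnion_sphereSector_eq_univ`,
`Literature.Topology.FourManifolds.sphereSector_handlebodies_holds`).
[cite: GayKirby2016, §2 (arXiv p. 5), first example] -/
theorem sphereSector_isBalancedGKTrisection_of_sectorMap (h₁ : sectorMap_isImmersionAt)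
    (h₂ : sectorMap_isCornerAt) : sphereSector_isBalancedGKTrisection :=
  sphereSector_isBalancedGKTrisection_of_sectors (sphereSector_sectors_of_sectorMap h₁ h₂)

/-- **(d′) `Literature.Topology.FourManifolds.sphere_gkTrisections` from the two named facts and the stabilisation fact (c′).**
[cite: GayKirby2016, §2 (arXiv p. 5), first three examples; Def. 8 and Lemma 10 (arXiv p. 4)] -/
theorem sphere_gkTrisections_of_sectorMap (h₁ : sectorMap_isImmersionAt) (h₂ : sectorMap_isCornerAt)
    (hc : exists_stabilized_gkTrisection.{0}) : sphere_gkTrisections :=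
  sphere_gkTrisections_of_sectors (sphereSector_sectors_of_sectorMap h₁ h₂) hc

end Literature.Topology.FourManifolds

end


noncomputable section

open scoped Manifold ContDiff Topology Real
open Set Function Metric WithLp

namespace Literature.Topology.FourManifolds

local notation "𝔼 " n:arg => EuclideanSpace ℝ (Fin n)
local notation "𝕊 " n:arg => (Metric.sphere (0 : EuclideanSpace ℝ (Fin (n + 1))) 1)
local notation "𝔻 " n:arg => (Metric.closedBall (0 : EuclideanSpace ℝ (Fin n)) 1)

attribute [local instance] fact_finrank_euclideanSpace_succ

namespace GayKirby

/-! ### The smooth extensions `ẽ_±` of the sector map across `∂𝔻⁴` -/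

/-- `P_σ = √((ν + 2σs)/2)`: for `σ = 1` this is `y₁`, for `σ = -1` it is `y₀` (the square root
that stays positive near the boundary piece `{u = 0, σ s > 0}`). [folklore] -/
def extP (σ : ℝ) (w : 𝔼 4) : ℝ := √((secN w + 2 * (σ * secS w)) / 2)

/-- `R_σ = u / (2 P_σ)`: the analytic continuation of the other square root across `u = 0`
(for `σ = 1`, `R = y₀` on the ball; for `σ = -1`, `R = y₁`). [folklore] -/
def extR (σ : ℝ) (w : 𝔼 4) : ℝ := secU w / (2 * extP σ w)

/-- The domain `V_σ = {ν + 2σs > 0}` of the extension (the complement of the closed half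
`{‖w‖ = 1, σ s ≤ 0}` of the unit sphere). [folklore] -/
def extDom (σ : ℝ) : Set (𝔼 4) := {w | 0 < secN w + 2 * (σ * secS w)}

/-- `V_σ` is open. [folklore] -/
theorem isOpen_extDom (σ : ℝ) : IsOpen (extDom σ) :=
  isOpen_lt continuous_const (continuous_secN.add (continuous_const.mul (continuous_const.mul continuous_secS)))

section ExtScalars

variable {σ : ℝ} {w : 𝔼 4}

/-- Membership in `V_σ` (definitional). [folklore] -/
theorem mem_extDom_iff : w ∈ extDom σ ↔ 0 < secN w + 2 * (σ * secS w) := Iff.rfl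

/-- `0 < P_σ` on `V_σ`. [folklore] -/
theorem extP_pos (hw : w ∈ extDom σ) : 0 < extP σ w :=
  Real.sqrt_pos.2 (half_pos (mem_extDom_iff.1 hw))

/-- `P_σ² = (ν + 2σs)/2` on `V_σ`. [folklore] -/
theorem extP_sq (hw : w ∈ extDom σ) : extP σ w ^ 2 = (secN w + 2 * (σ * secS w)) / 2 :=
  Real.sq_sqrt (half_pos (mem_extDom_iff.1 hw)).le

/-- `2 P_σ R_σ = u` on `V_σ` (by definition of `R_σ`). [folklore] -/
theorem two_mul_extP_mul_extR (hw : w ∈ extDom σ) : 2 * extP σ w * extR σ w = secU w := by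
  rw [extR]; field_simp [(extP_pos hw).ne']

/-- `R_σ² = (ν - 2σs)/2` on `V_σ` (as `u² = ν² - 4s²`). [folklore] -/
theorem extR_sq (hσ : σ ^ 2 = 1) (hw : w ∈ extDom σ) : extR σ w ^ 2 = (secN w - 2 * (σ * secS w)) / 2 := by
  have hP := extP_pos hw
  have hP2 := extP_sq hw
  have hν := secN_sq w
  have h4 : (2 * extP σ w) ^ 2 * extR σ w ^ 2 = secU w ^ 2 := by
    rw [← mul_pow, two_mul_extP_mul_extR hw]
  have hkey : secU w ^ 2 = (secN w + 2 * (σ * secS w)) * (secN w - 2 * (σ * secS w)) := by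
    have : (secN w + 2 * (σ * secS w)) * (secN w - 2 * (σ * secS w)) =
        secN w ^ 2 - σ ^ 2 * (2 * secS w) ^ 2 := by ring
    rw [this, hσ, hν]; ring
  have hne : (2 * extP σ w) ^ 2 ≠ 0 := by positivity
  have hpos : 0 < secN w + 2 * (σ * secS w) := hw
  calc extR σ w ^ 2 = secU w ^ 2 / (2 * extP σ w) ^ 2 := by rw [eq_div_iff hne, mul_comm, h4]
    _ = (secN w - 2 * (σ * secS w)) * (secN w + 2 * (σ * secS w)) / (2 * (secN w + 2 * (σ * secS w))) := by
      rw [hkey, mul_pow, hP2]; ring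
    _ = (secN w - 2 * (σ * secS w)) / 2 := mul_div_mul_right _ _ hpos.ne'

/-- `P_σ² + R_σ² = ν` on `V_σ`. [folklore] -/
theorem extP_sq_add_extR_sq (hσ : σ ^ 2 = 1) (hw : w ∈ extDom σ) :
    extP σ w ^ 2 + extR σ w ^ 2 = secN w := by
  rw [extP_sq hw, extR_sq hσ hw]; ring

/-- On the ball, `P₁ = y₁`. [folklore] -/
theorem extP_one (w : 𝔼 4) : extP 1 w = secY₁ w := by
  rw [extP, secY₁, one_mul]

/-- On the ball, `P₋₁ = y₀`. [folklore] -/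
theorem extP_neg_one (w : 𝔼 4) : extP (-1) w = secY₀ w := by
  rw [extP, secY₀]; congr 1; ring

/-- On the ball (where `2 y₀ y₁ = u`), `R₁ = y₀`. [folklore] -/
theorem extR_one (hw1 : ‖w‖ ≤ 1) (hw : w ∈ extDom 1) : extR 1 w = secY₀ w := by
  have hP := extP_pos hw
  rw [extP_one] at hP
  rw [extR, extP_one, ← two_mul_secY₀_mul_secY₁ hw1]
  field_simp

/-- On the ball, `R₋₁ = y₁`. [folklore] -/
theorem extR_neg_one (hw1 : ‖w‖ ≤ 1) (hw : w ∈ extDom (-1)) : extR (-1) w = secY₁ w := by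
  have hP := extP_pos hw
  rw [extP_neg_one] at hP
  rw [extR, extP_neg_one, ← two_mul_secY₀_mul_secY₁ hw1]
  field_simp

end ExtScalars

/-- **The extension `ẽ₊` of the sector map** across the boundary piece `{u = 0, s > 0}`:
the formula of `sectorMapFun α` with `(y₀, y₁)` replaced by `(R₁, P₁) = (u/(2y₁), y₁)`. [folklore] -/
def sectorMapExtPos (α : ℝ) (w : 𝔼 4) : 𝔼 5 :=
  !₂[(extP 1 w * Real.cos α + extR 1 w * Real.cos (α + 2 * π / 3)) / secM w,
     (extP 1 w * Real.sin α + extR 1 w * Real.sin (α + 2 * π / 3)) / secM w,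
     secL w * w 1, secL w * w 2, secL w * w 3]

/-- **The extension `ẽ₋` of the sector map** across the boundary piece `{u = 0, s < 0}`:
`(y₀, y₁)` replaced by `(P₋₁, R₋₁) = (y₀, u/(2y₀))`. [folklore] -/
def sectorMapExtNeg (α : ℝ) (w : 𝔼 4) : 𝔼 5 :=
  !₂[(extR (-1) w * Real.cos α + extP (-1) w * Real.cos (α + 2 * π / 3)) / secM w,
     (extR (-1) w * Real.sin α + extP (-1) w * Real.sin (α + 2 * π / 3)) / secM w,
     secL w * w 1, secL w * w 2, secL w * w 3]

/-- `ẽ₊` written with the edge coefficients `P₁/m`, `R₁/m`. [folklore] -/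
theorem sectorMapExtPos_eq (α : ℝ) (w : 𝔼 4) : sectorMapExtPos α w =
    !₂[(extP 1 w / secM w) * Real.cos α + (extR 1 w / secM w) * Real.cos (α + 2 * π / 3),
      (extP 1 w / secM w) * Real.sin α + (extR 1 w / secM w) * Real.sin (α + 2 * π / 3),
      secL w * w 1, secL w * w 2, secL w * w 3] := by
  ext i; fin_cases i <;> simp [sectorMapExtPos] <;> ring

/-- `ẽ₋` written with the edge coefficients `R₋₁/m`, `P₋₁/m`. [folklore] -/
theorem sectorMapExtNeg_eq (α : ℝ) (w : 𝔼 4) : sectorMapExtNeg α w =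
    !₂[(extR (-1) w / secM w) * Real.cos α + (extP (-1) w / secM w) * Real.cos (α + 2 * π / 3),
      (extR (-1) w / secM w) * Real.sin α + (extP (-1) w / secM w) * Real.sin (α + 2 * π / 3),
      secL w * w 1, secL w * w 2, secL w * w 3] := by
  ext i; fin_cases i <;> simp [sectorMapExtNeg] <;> ring

/-- `ẽ₊ = e` on `𝔻⁴ ∩ V₊`. [folklore] -/
theorem sectorMapExtPos_eq_sectorMapFun {α : ℝ} {w : 𝔼 4} (hw1 : ‖w‖ ≤ 1) (hw : w ∈ extDom 1) :
    sectorMapExtPos α w = sectorMapFun α w := by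
  rw [sectorMapExtPos, sectorMapFun, extP_one, extR_one hw1 hw]

/-- `ẽ₋ = e` on `𝔻⁴ ∩ V₋`. [folklore] -/
theorem sectorMapExtNeg_eq_sectorMapFun {α : ℝ} {w : 𝔼 4} (hw1 : ‖w‖ ≤ 1) (hw : w ∈ extDom (-1)) :
    sectorMapExtNeg α w = sectorMapFun α w := by
  rw [sectorMapExtNeg, sectorMapFun, extP_neg_one, extR_neg_one hw1 hw]

/-- The scalar identity behind `‖ẽ w‖ = 1`:
`(ν - u/2)/m² + λ² (1 - u - s²) = 1` when `ν² = u² + 4s²`. [folklore] -/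
theorem norm_aux {ν u s : ℝ} (hν : ν ^ 2 = u ^ 2 + (2 * s) ^ 2) (hA : 0 < 2 - u + ν)
    (hB : 0 < 2 + ν - 2 * u) :
    (ν - u / 2) / ((2 + ν - 2 * u) / 2) + 4 / ((2 - u + ν) * (2 + ν - 2 * u)) * (1 - u - s ^ 2) = 1 := by
  have hB' : (2 + ν - 2 * u) / 2 ≠ 0 := by positivity
  have hD : (2 - u + ν) * (2 + ν - 2 * u) ≠ 0 := by positivity
  rw [div_mul_eq_mul_div, div_add_div _ _ hB' hD, div_eq_one_iff_eq (mul_ne_zero hB' hD)]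
  linear_combination ((2 + ν - 2 * u) / 2) * hν

/-- The common shape `((P E_P + R E_R)/m, λ v)` of the sector map and its extensions. [folklore] -/
def prVec (θP θR P R : ℝ) (w : 𝔼 4) : 𝔼 5 :=
  !₂[(P * Real.cos θP + R * Real.cos θR) / secM w, (P * Real.sin θP + R * Real.sin θR) / secM w,
    secL w * w 1, secL w * w 2, secL w * w 3]

/-- Coordinate `0` of the common shape. [folklore] -/
@[simp] theorem prVec_apply_zero (θP θR P R : ℝ) (w : 𝔼 4) :
    prVec θP θR P R w 0 = (P * Real.cos θP + R * Real.cos θR) / secM w := rfl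
/-- Coordinate `1` of the common shape. [folklore] -/
@[simp] theorem prVec_apply_one (θP θR P R : ℝ) (w : 𝔼 4) :
    prVec θP θR P R w 1 = (P * Real.sin θP + R * Real.sin θR) / secM w := rfl
/-- Coordinate `2` of the common shape. [folklore] -/
@[simp] theorem prVec_apply_two (θP θR P R : ℝ) (w : 𝔼 4) : prVec θP θR P R w 2 = secL w * w 1 := rfl
/-- Coordinate `3` of the common shape. [folklore] -/
@[simp] theorem prVec_apply_three (θP θR P R : ℝ) (w : 𝔼 4) : prVec θP θR P R w 3 = secL w * w 2 := rfl
/-- Coordinate `4` of the common shape. [folklore] -/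
@[simp] theorem prVec_apply_four (θP θR P R : ℝ) (w : 𝔼 4) : prVec θP θR P R w 4 = secL w * w 3 := rfl

/-- `ẽ₊` is the common shape with `(P, R) = (P₁, R₁)` (definitional). [folklore] -/
theorem sectorMapExtPos_eq_prVec (α : ℝ) (w : 𝔼 4) :
    sectorMapExtPos α w = prVec α (α + 2 * π / 3) (extP 1 w) (extR 1 w) w := rfl

/-- `ẽ₋` is the common shape with `(P, R) = (R₋₁, P₋₁)` (definitional). [folklore] -/
theorem sectorMapExtNeg_eq_prVec (α : ℝ) (w : 𝔼 4) :
    sectorMapExtNeg α w = prVec α (α + 2 * π / 3) (extR (-1) w) (extP (-1) w) w := rfl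

/-- A vector `((P E_P + R E_R)/m, λ v)` with `P² + R² = ν`, `2 P R = u` and edge directions at
angle `2π/3` has norm `1` (the computation of `norm_sectorMapFun`, with `2 P R = u` now an
assumption rather than a consequence of `u ≥ 0`). [folklore] -/
theorem norm_prVec {θP θR P R : ℝ} {w : 𝔼 4}
    (hθ : Real.cos θP * Real.cos θR + Real.sin θP * Real.sin θR = -1 / 2)
    (hPR2 : P ^ 2 + R ^ 2 = secN w) (hPR : 2 * P * R = secU w) : ‖prVec θP θR P R w‖ = 1 := by
  have hcomb : (P * Real.cos θP + R * Real.cos θR) ^ 2 + (P * Real.sin θP + R * Real.sin θR) ^ 2 =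
      P ^ 2 + R ^ 2 - P * R := by
    have h1 := Real.cos_sq_add_sin_sq θP
    have h2 := Real.cos_sq_add_sin_sq θR
    nlinarith [h1, h2, hθ]
  have htail : w 1 ^ 2 + w 2 ^ 2 + w 3 ^ 2 = 1 - secU w - secS w ^ 2 := by
    have hn := norm_sq_eq_four w
    have hu : secU w = 1 - ‖w‖ ^ 2 := rfl
    linarith
  have hPR' : P * R = secU w / 2 := by linarith
  have hsq : ‖prVec θP θR P R w‖ ^ 2 = 1 := by
    rw [norm_sq_eq_five, prVec_apply_zero, prVec_apply_one, prVec_apply_two, prVec_apply_three,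
      prVec_apply_four, div_pow, div_pow, ← add_div, hcomb, mul_pow, mul_pow, mul_pow, ← mul_add,
      ← mul_add, secL_sq, secM_sq, hPR2, hPR', htail]
    exact norm_aux (secN_sq w) (two_sub_secU_add_pos w) (two_add_secN_sub_pos w)
  have h0 : 0 ≤ ‖prVec θP θR P R w‖ := norm_nonneg _
  nlinarith [hsq, h0]

/-- `ẽ₊` lands on the unit sphere on `V₊`. [folklore] -/
theorem norm_sectorMapExtPos (α : ℝ) {w : 𝔼 4} (hw : w ∈ extDom 1) : ‖sectorMapExtPos α w‖ = 1 :=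
  norm_prVec (cos_mul_cos_add_sin_mul_sin α) (extP_sq_add_extR_sq (by norm_num) hw)
    (two_mul_extP_mul_extR hw)

/-- `ẽ₋` lands on the unit sphere on `V₋`. [folklore] -/
theorem norm_sectorMapExtNeg (α : ℝ) {w : 𝔼 4} (hw : w ∈ extDom (-1)) : ‖sectorMapExtNeg α w‖ = 1 := by
  rw [sectorMapExtNeg_eq_prVec]
  refine norm_prVec (cos_mul_cos_add_sin_mul_sin α) ?_ ?_
  · rw [add_comm]; exact extP_sq_add_extR_sq (by norm_num) hw
  · rw [mul_assoc, mul_comm (extR (-1) w), ← mul_assoc]; exact two_mul_extP_mul_extR hw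

/-! ### Left inverse: `sectorInvFun ∘ ẽ_± = id` on `V_±` -/

/-- The left-inverse computation of `sectorInvFun_sectorMapFun`, abstracted: if the edge
coefficients `a, b` of `x` satisfy `a² + b² = ν/m²`, `2ab = u/m²`, `a² - b² = 2s/m²` and the
tail of `x` is `λ v`, then `sectorInvFun α x = w`. [folklore] -/
theorem sectorInvFun_eq_of_coeffs {α : ℝ} {x : 𝔼 5} {w : 𝔼 4}
    (h₁ : invA α x ^ 2 + invB α x ^ 2 = secN w / secM w ^ 2)
    (h₂ : 2 * invA α x * invB α x = secU w / secM w ^ 2)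
    (h₃ : invA α x ^ 2 - invB α x ^ 2 = 2 * secS w / secM w ^ 2)
    (hx₂ : x 2 = secL w * w 1) (hx₃ : x 3 = secL w * w 2) (hx₄ : x 4 = secL w * w 3) :
    sectorInvFun α x = w := by
  have hM := secM_pos w
  have hM2 := secM_sq w
  have hQ : invM2 α x = secM w ^ 2 := by
    have : 1 - invQ α x = 1 / secM w ^ 2 := by
      rw [invQ, show (invA α x ^ 2 + invB α x ^ 2) / 2 - 2 * invA α x * invB α x =
        (secN w / secM w ^ 2) / 2 - secU w / secM w ^ 2 by rw [h₁, h₂]]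
      field_simp
      nlinarith [hM2]
    rw [invM2, this, one_div_one_div]
  have hS : invS α x = secS w := by
    rw [invS, hQ, h₃]; field_simp
  have hU : invU α x = secU w := by
    rw [invU, hQ, show 2 * secM w ^ 2 * invA α x * invB α x = secM w ^ 2 * (2 * invA α x * invB α x) by ring,
      h₂]; field_simp
  have hN : invN α x = secN w := by
    rw [invN, hQ, h₁]; field_simp
  have hSc : invScale α x = (secL w)⁻¹ := by
    rw [invScale, hU, hN, secL, inv_div]
  have hL := (secL_pos w).ne'
  ext i
  fin_cases i
  · exact hS
  · simp [hSc, hx₂, hL]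
  · simp [hSc, hx₃, hL]
  · simp [hSc, hx₄, hL]

/-- **`sectorInvFun ∘ ẽ₊ = id` on `V₊`.** [folklore] -/
theorem sectorInvFun_sectorMapExtPos {α : ℝ} {w : 𝔼 4} (hw : w ∈ extDom 1) :
    sectorInvFun α (sectorMapExtPos α w) = w := by
  have hM := secM_pos w
  have hP2R2 := extP_sq_add_extR_sq (σ := 1) (by norm_num) hw
  have hPR := two_mul_extP_mul_extR hw
  have hP2 := extP_sq hw
  have hR2 := extR_sq (σ := 1) (by norm_num) hw
  refine sectorInvFun_eq_of_coeffs ?_ ?_ ?_ rfl rfl rfl <;> rw [sectorMapExtPos_eq, invA_edge, invB_edge]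
  · rw [div_pow, div_pow, ← add_div, hP2R2]
  · rw [← hPR]; field_simp
  · rw [div_pow, div_pow, ← sub_div, hP2, hR2]; congr 1; ring

/-- **`sectorInvFun ∘ ẽ₋ = id` on `V₋`.** [folklore] -/
theorem sectorInvFun_sectorMapExtNeg {α : ℝ} {w : 𝔼 4} (hw : w ∈ extDom (-1)) :
    sectorInvFun α (sectorMapExtNeg α w) = w := by
  have hM := secM_pos w
  have hP2R2 := extP_sq_add_extR_sq (σ := -1) (by norm_num) hw
  have hPR := two_mul_extP_mul_extR hw
  have hP2 := extP_sq hw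
  have hR2 := extR_sq (σ := -1) (by norm_num) hw
  refine sectorInvFun_eq_of_coeffs ?_ ?_ ?_ rfl rfl rfl <;> rw [sectorMapExtNeg_eq, invA_edge, invB_edge]
  · rw [div_pow, div_pow, ← add_div, add_comm, hP2R2]
  · rw [← hPR]; field_simp
  · rw [div_pow, div_pow, ← sub_div, hP2, hR2]; field_simp; ring

/-! ### Right inverse: `ẽ_± ∘ sectorInvFun = id` on `U_±` -/

section RightInv

variable {α : ℝ} {x : 𝔼 5}

/-- `P₁ (sectorInvFun x) = √(m²) a` for `a > 0`. [folklore] -/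
theorem extP_one_sectorInvFun (hx : ‖x‖ = 1) (hQ : invQ α x < 1) (ha : 0 < invA α x) :
    extP 1 (sectorInvFun α x) = √(invM2 α x) * invA α x := by
  rw [extP, one_mul, secN_sectorInvFun hx hQ, secS_sectorInvFun, invN_add_two_invS,
    Real.sqrt_mul (invM2_pos hQ).le, Real.sqrt_sq ha.le]

/-- `R₁ (sectorInvFun x) = √(m²) b` for `a > 0`. [folklore] -/
theorem extR_one_sectorInvFun (hx : ‖x‖ = 1) (hQ : invQ α x < 1) (ha : 0 < invA α x) :
    extR 1 (sectorInvFun α x) = √(invM2 α x) * invB α x := by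
  have hm := invM2_pos hQ
  have hsq : √(invM2 α x) ≠ 0 := (Real.sqrt_pos.2 hm).ne'
  have hden : 2 * (√(invM2 α x) * invA α x) ≠ 0 := by positivity
  rw [extR, extP_one_sectorInvFun hx hQ ha, secU_sectorInvFun hx hQ, invU, div_eq_iff hden]
  linear_combination (-(2 * invA α x * invB α x)) * Real.mul_self_sqrt hm.le

/-- `P₋₁ (sectorInvFun x) = √(m²) b` for `b > 0`. [folklore] -/
theorem extP_neg_one_sectorInvFun (hx : ‖x‖ = 1) (hQ : invQ α x < 1) (hb : 0 < invB α x) :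
    extP (-1) (sectorInvFun α x) = √(invM2 α x) * invB α x := by
  rw [extP, secN_sectorInvFun hx hQ, secS_sectorInvFun,
    show (invN α x + 2 * (-1 * invS α x)) / 2 = (invN α x - 2 * invS α x) / 2 by ring,
    invN_sub_two_invS, Real.sqrt_mul (invM2_pos hQ).le, Real.sqrt_sq hb.le]

/-- `R₋₁ (sectorInvFun x) = √(m²) a` for `b > 0`. [folklore] -/
theorem extR_neg_one_sectorInvFun (hx : ‖x‖ = 1) (hQ : invQ α x < 1) (hb : 0 < invB α x) :
    extR (-1) (sectorInvFun α x) = √(invM2 α x) * invA α x := by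
  have hm := invM2_pos hQ
  have hsq : √(invM2 α x) ≠ 0 := (Real.sqrt_pos.2 hm).ne'
  have hden : 2 * (√(invM2 α x) * invB α x) ≠ 0 := by positivity
  rw [extR, extP_neg_one_sectorInvFun hx hQ hb, secU_sectorInvFun hx hQ, invU, div_eq_iff hden]
  linear_combination (-(2 * invA α x * invB α x)) * Real.mul_self_sqrt hm.le

/-- **`ẽ₊ ∘ sectorInvFun = id` on `U₊ = {Q < 1, a > 0} ∩ S⁴`.** [folklore] -/
theorem sectorMapExtPos_sectorInvFun (hx : ‖x‖ = 1) (hQ : invQ α x < 1) (ha : 0 < invA α x) :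
    sectorMapExtPos α (sectorInvFun α x) = x := by
  have hm := invM2_pos hQ
  have hsq : √(invM2 α x) ≠ 0 := (Real.sqrt_pos.2 hm).ne'
  have hsc := (invScale_pos hQ).ne'
  rw [sectorMapExtPos_eq, extP_one_sectorInvFun hx hQ ha, extR_one_sectorInvFun hx hQ ha,
    secM_sectorInvFun hx hQ, secL_sectorInvFun hx hQ, mul_div_cancel_left₀ _ hsq,
    mul_div_cancel_left₀ _ hsq]
  ext i
  fin_cases i
  · exact (apply_zero_eq_invA_invB α x).symm
  · exact (apply_one_eq_invA_invB α x).symm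
  · simp [hsc]
  · simp [hsc]
  · simp [hsc]

/-- **`ẽ₋ ∘ sectorInvFun = id` on `U₋ = {Q < 1, b > 0} ∩ S⁴`.** [folklore] -/
theorem sectorMapExtNeg_sectorInvFun (hx : ‖x‖ = 1) (hQ : invQ α x < 1) (hb : 0 < invB α x) :
    sectorMapExtNeg α (sectorInvFun α x) = x := by
  have hm := invM2_pos hQ
  have hsq : √(invM2 α x) ≠ 0 := (Real.sqrt_pos.2 hm).ne'
  have hsc := (invScale_pos hQ).ne'
  rw [sectorMapExtNeg_eq, extP_neg_one_sectorInvFun hx hQ hb, extR_neg_one_sectorInvFun hx hQ hb,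
    secM_sectorInvFun hx hQ, secL_sectorInvFun hx hQ, mul_div_cancel_left₀ _ hsq,
    mul_div_cancel_left₀ _ hsq]
  ext i
  fin_cases i
  · exact (apply_zero_eq_invA_invB α x).symm
  · exact (apply_one_eq_invA_invB α x).symm
  · simp [hsc]
  · simp [hsc]
  · simp [hsc]

end RightInv

/-! ### Domains -/

/-- `ẽ₊ (V₊) ⊆ U₊`: the edge coefficient `a = P/m` is positive and `Q = 1 - 1/m² < 1`. [folklore] -/
theorem invA_sectorMapExtPos (α : ℝ) (w : 𝔼 4) : invA α (sectorMapExtPos α w) = extP 1 w / secM w := by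
  rw [sectorMapExtPos_eq, invA_edge]

/-- The `E₀`-coefficient of `ẽ₋ w` is `P₋₁/m`. [folklore] -/
theorem invB_sectorMapExtNeg (α : ℝ) (w : 𝔼 4) : invB α (sectorMapExtNeg α w) = extP (-1) w / secM w := by
  rw [sectorMapExtNeg_eq, invB_edge]

/-- `Q (ẽ₊ w) = 1 - 1/m²` on `V₊`. [folklore] -/
theorem invQ_sectorMapExtPos {α : ℝ} {w : 𝔼 4} (hw : w ∈ extDom 1) :
    invQ α (sectorMapExtPos α w) = 1 - 1 / secM w ^ 2 := by
  have hM := secM_pos w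
  have hP2R2 := extP_sq_add_extR_sq (σ := 1) (by norm_num) hw
  have hPR := two_mul_extP_mul_extR hw
  have hM2 := secM_sq w
  rw [invQ, sectorMapExtPos_eq, invA_edge, invB_edge]
  field_simp
  nlinarith [hP2R2, hPR, hM2]

/-- `Q (ẽ₋ w) = 1 - 1/m²` on `V₋`. [folklore] -/
theorem invQ_sectorMapExtNeg {α : ℝ} {w : 𝔼 4} (hw : w ∈ extDom (-1)) :
    invQ α (sectorMapExtNeg α w) = 1 - 1 / secM w ^ 2 := by
  have hM := secM_pos w
  have hP2R2 := extP_sq_add_extR_sq (σ := -1) (by norm_num) hw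
  have hPR := two_mul_extP_mul_extR hw
  have hM2 := secM_sq w
  rw [invQ, sectorMapExtNeg_eq, invA_edge, invB_edge]
  field_simp
  nlinarith [hP2R2, hPR, hM2]

/-- `sectorInvFun (U₊) ⊆ V₊`: `ν + 2s = 2 m² a² > 0` at `sectorInvFun x`. [folklore] -/
theorem sectorInvFun_mem_extDom_one {α : ℝ} {x : 𝔼 5} (hx : ‖x‖ = 1) (hQ : invQ α x < 1)
    (ha : 0 < invA α x) : sectorInvFun α x ∈ extDom 1 := by
  show 0 < secN (sectorInvFun α x) + 2 * (1 * secS (sectorInvFun α x))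
  rw [one_mul, secN_sectorInvFun hx hQ, secS_sectorInvFun]
  have h := invN_add_two_invS α x
  have hm := invM2_pos hQ
  nlinarith [mul_pos hm (pow_pos ha 2)]

/-- `sectorInvFun (U₋) ⊆ V₋`: `ν - 2s = 2 m² b² > 0` at `sectorInvFun x`. [folklore] -/
theorem sectorInvFun_mem_extDom_neg_one {α : ℝ} {x : 𝔼 5} (hx : ‖x‖ = 1) (hQ : invQ α x < 1)
    (hb : 0 < invB α x) : sectorInvFun α x ∈ extDom (-1) := by
  show 0 < secN (sectorInvFun α x) + 2 * (-1 * secS (sectorInvFun α x))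
  rw [secN_sectorInvFun hx hQ, secS_sectorInvFun]
  have h := invN_sub_two_invS α x
  have hm := invM2_pos hQ
  nlinarith [mul_pos hm (pow_pos hb 2)]

/-- Off the corner locus `K`, a point of the closed ball lies in `V₊` or in `V₋`. [folklore] -/
theorem mem_extDom_or {w : 𝔼 4} (hK : ¬ (w 0 = 0 ∧ ‖w‖ = 1)) : w ∈ extDom 1 ∨ w ∈ extDom (-1) := by
  by_contra h
  push Not at h
  obtain ⟨h1, h2⟩ := h
  simp only [extDom, mem_setOf_eq, not_lt, one_mul, neg_one_mul] at h1 h2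
  have hν : secN w = 0 := by linarith [secN_nonneg w]
  obtain ⟨hs, hu⟩ := (secN_eq_zero_iff w).1 hν
  exact hK ⟨hs, (secU_eq_zero_iff w).1 hu⟩

end GayKirby
end Literature.Topology.FourManifolds

namespace Literature.Topology.FourManifolds.GayKirby

local notation "𝔼 " n:arg => EuclideanSpace ℝ (Fin n)
local notation "𝕊 " n:arg => (Metric.sphere (0 : EuclideanSpace ℝ (Fin (n + 1))) 1)
local notation "𝔻 " n:arg => (Metric.closedBall (0 : EuclideanSpace ℝ (Fin n)) 1)

attribute [local instance] fact_finrank_euclideanSpace_succ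

/-! ### Smoothness of the left inverse and of the extensions -/

section Smooth

/-- The edge coefficient `a` is smooth (linear). [folklore] -/
theorem contDiff_invA (α : ℝ) : ContDiff ℝ ∞ (invA α) := by
  have hc : ∀ i : Fin 5, ContDiff ℝ ∞ fun x : 𝔼 5 => x i := fun i => contDiff_euclidean.mp contDiff_id i
  unfold invA
  exact contDiff_const.mul (((hc 0).mul contDiff_const).sub ((hc 1).mul contDiff_const))

/-- The edge coefficient `b` is smooth (linear). [folklore] -/
theorem contDiff_invB (α : ℝ) : ContDiff ℝ ∞ (invB α) := by
  have hc : ∀ i : Fin 5, ContDiff ℝ ∞ fun x : 𝔼 5 => x i := fun i => contDiff_euclidean.mp contDiff_id i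
  unfold invB
  exact contDiff_const.mul (((hc 1).mul contDiff_const).sub ((hc 0).mul contDiff_const))

/-- `Q` is smooth (polynomial). [folklore] -/
theorem contDiff_invQ (α : ℝ) : ContDiff ℝ ∞ (invQ α) := by
  unfold invQ
  exact ((((contDiff_invA α).pow 2).add ((contDiff_invB α).pow 2)).div_const _).sub
    ((contDiff_const.mul (contDiff_invA α)).mul (contDiff_invB α))

/-- The open set `{Q < 1} ⊆ ℝ⁵` on which the left inverse is smooth. [folklore] -/
def invDom (α : ℝ) : Set (𝔼 5) := {x | invQ α x < 1}

/-- Membership in `{Q < 1}` (definitional). [folklore] -/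
theorem mem_invDom_iff {α : ℝ} {x : 𝔼 5} : x ∈ invDom α ↔ invQ α x < 1 := Iff.rfl

/-- `{Q < 1}` is open. [folklore] -/
theorem isOpen_invDom (α : ℝ) : IsOpen (invDom α) := isOpen_lt (contDiff_invQ α).continuous continuous_const

/-- `m² = 1/(1 - Q)` is smooth on `{Q < 1}`. [folklore] -/
theorem contDiffOn_invM2 (α : ℝ) : ContDiffOn ℝ ∞ (invM2 α) (invDom α) := by
  unfold invM2
  exact contDiffOn_const.div (contDiff_const.sub (contDiff_invQ α)).contDiffOn
    fun x hx => by have : invQ α x < 1 := hx; linarith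

/-- The recovered `s` is smooth on `{Q < 1}`. [folklore] -/
theorem contDiffOn_invS (α : ℝ) : ContDiffOn ℝ ∞ (invS α) (invDom α) := by
  unfold invS
  exact ((contDiffOn_invM2 α).mul (((contDiff_invA α).pow 2).sub ((contDiff_invB α).pow 2)).contDiffOn).div_const _

/-- The recovered `u` is smooth on `{Q < 1}`. [folklore] -/
theorem contDiffOn_invU (α : ℝ) : ContDiffOn ℝ ∞ (invU α) (invDom α) := by
  unfold invU
  exact ((contDiffOn_const.mul (contDiffOn_invM2 α)).mul (contDiff_invA α).contDiffOn).mul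
    (contDiff_invB α).contDiffOn

/-- The recovered `ν` is smooth on `{Q < 1}`. [folklore] -/
theorem contDiffOn_invN (α : ℝ) : ContDiffOn ℝ ∞ (invN α) (invDom α) := by
  unfold invN
  exact (contDiffOn_invM2 α).mul (((contDiff_invA α).pow 2).add ((contDiff_invB α).pow 2)).contDiffOn

/-- The recovered `1/λ` is smooth on `{Q < 1}` (its radicand is `2m²(2 + m²(a - b)²) > 0`). [folklore] -/
theorem contDiffOn_invScale (α : ℝ) : ContDiffOn ℝ ∞ (invScale α) (invDom α) := by
  unfold invScale
  refine (ContDiffOn.sqrt ?_ fun x hx => ?_).div_const _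
  · exact ((contDiffOn_const.sub (contDiffOn_invU α)).add (contDiffOn_invN α)).mul
      ((contDiffOn_const.add (contDiffOn_invN α)).sub (contDiffOn_const.mul (contDiffOn_invU α)))
  · have hQ : invQ α x < 1 := hx
    rw [two_sub_invU_add, two_add_invN_sub hQ]
    have := invM2_pos hQ
    positivity

/-- **The left inverse is smooth on `{Q < 1}`.** [folklore] -/
theorem contDiffOn_sectorInvFun (α : ℝ) : ContDiffOn ℝ ∞ (sectorInvFun α) (invDom α) := by
  have hc : ∀ i : Fin 5, ContDiff ℝ ∞ fun x : 𝔼 5 => x i := fun i => contDiff_euclidean.mp contDiff_id i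
  rw [contDiffOn_euclidean]
  intro i
  fin_cases i
  · exact contDiffOn_invS α
  · exact (contDiffOn_invScale α).mul (hc 2).contDiffOn
  · exact (contDiffOn_invScale α).mul (hc 3).contDiffOn
  · exact (contDiffOn_invScale α).mul (hc 4).contDiffOn

/-- `s` is smooth. [folklore] -/
theorem contDiff_secS : ContDiff ℝ ∞ secS := contDiff_euclidean.mp (contDiff_id (E := 𝔼 4)) 0

/-- `u = 1 - ‖w‖²` is smooth. [folklore] -/
theorem contDiff_secU : ContDiff ℝ ∞ secU := contDiff_const.sub (contDiff_norm_sq ℝ)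

/-- `ν > 0` on `V_σ`. [folklore] -/
theorem secN_pos_of_mem_extDom {σ : ℝ} {w : 𝔼 4} (hw : w ∈ extDom σ) : 0 < secN w := by
  have h : 0 < secN w + 2 * (σ * secS w) := hw
  rcases (secN_nonneg w).eq_or_lt with h0 | hpos
  · obtain ⟨hs, -⟩ := (secN_eq_zero_iff w).1 h0.symm
    rw [← h0, hs] at h
    norm_num at h
  · exact hpos

/-- `ν` is smooth on `V_σ` (where `ν > 0`). [folklore] -/
theorem contDiffOn_secN (σ : ℝ) : ContDiffOn ℝ ∞ secN (extDom σ) := by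
  unfold secN
  refine ((contDiff_secU.pow 2).add ((contDiff_const.mul contDiff_secS).pow 2)).contDiffOn.sqrt
    fun w hw => ?_
  have h := secN_pos_of_mem_extDom hw
  rw [← secN_sq]
  positivity

/-- `P_σ` is smooth on `V_σ`. [folklore] -/
theorem contDiffOn_extP (σ : ℝ) : ContDiffOn ℝ ∞ (extP σ) (extDom σ) := by
  unfold extP
  refine (((contDiffOn_secN σ).add (contDiff_const.mul (contDiff_const.mul contDiff_secS)).contDiffOn).div_const
    _).sqrt fun w hw => ?_
  have h : 0 < secN w + 2 * (σ * secS w) := hw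
  positivity

/-- `R_σ` is smooth on `V_σ`. [folklore] -/
theorem contDiffOn_extR (σ : ℝ) : ContDiffOn ℝ ∞ (extR σ) (extDom σ) := by
  unfold extR
  exact contDiff_secU.contDiffOn.div (contDiffOn_const.mul (contDiffOn_extP σ))
    fun w hw => (mul_pos two_pos (extP_pos hw)).ne'

/-- `m` is smooth on `V_σ`. [folklore] -/
theorem contDiffOn_secM (σ : ℝ) : ContDiffOn ℝ ∞ secM (extDom σ) := by
  unfold secM
  exact (((contDiffOn_const.add (contDiffOn_secN σ)).sub (contDiff_const.mul contDiff_secU).contDiffOn).div_const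
    _).sqrt fun w _ => (half_pos (two_add_secN_sub_pos w)).ne'

/-- `λ` is smooth on `V_σ`. [folklore] -/
theorem contDiffOn_secL (σ : ℝ) : ContDiffOn ℝ ∞ secL (extDom σ) := by
  unfold secL
  refine contDiffOn_const.div (ContDiffOn.sqrt ?_ fun w _ => ?_) fun w _ => ?_
  · exact ((contDiffOn_const.sub contDiff_secU.contDiffOn).add (contDiffOn_secN σ)).mul
      ((contDiffOn_const.add (contDiffOn_secN σ)).sub (contDiff_const.mul contDiff_secU).contDiffOn)
  · exact (mul_pos (two_sub_secU_add_pos w) (two_add_secN_sub_pos w)).ne'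
  · exact (Real.sqrt_pos.2 (mul_pos (two_sub_secU_add_pos w) (two_add_secN_sub_pos w))).ne'

/-- The common shape is smooth in `(P, R, w)` where its scalar ingredients are. [folklore] -/
theorem contDiffOn_prVec {σ : ℝ} (θP θR : ℝ) {P R : (𝔼 4) → ℝ} (hP : ContDiffOn ℝ ∞ P (extDom σ))
    (hR : ContDiffOn ℝ ∞ R (extDom σ)) :
    ContDiffOn ℝ ∞ (fun w => prVec θP θR (P w) (R w) w) (extDom σ) := by
  have hc : ∀ i : Fin 4, ContDiff ℝ ∞ fun w : 𝔼 4 => w i := fun i => contDiff_euclidean.mp contDiff_id i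
  rw [contDiffOn_euclidean]
  intro i
  fin_cases i
  · exact ((hP.mul contDiffOn_const).add (hR.mul contDiffOn_const)).div (contDiffOn_secM σ)
      fun w _ => (secM_pos w).ne'
  · exact ((hP.mul contDiffOn_const).add (hR.mul contDiffOn_const)).div (contDiffOn_secM σ)
      fun w _ => (secM_pos w).ne'
  · exact (contDiffOn_secL σ).mul (hc 1).contDiffOn
  · exact (contDiffOn_secL σ).mul (hc 2).contDiffOn
  · exact (contDiffOn_secL σ).mul (hc 3).contDiffOn

/-- **`ẽ₊` is smooth on `V₊`.** [folklore] -/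
theorem contDiffOn_sectorMapExtPos (α : ℝ) : ContDiffOn ℝ ∞ (sectorMapExtPos α) (extDom 1) :=
  contDiffOn_prVec α _ (contDiffOn_extP 1) (contDiffOn_extR 1)

/-- **`ẽ₋` is smooth on `V₋`.** [folklore] -/
theorem contDiffOn_sectorMapExtNeg (α : ℝ) : ContDiffOn ℝ ∞ (sectorMapExtNeg α) (extDom (-1)) :=
  contDiffOn_prVec α _ (contDiffOn_extR (-1)) (contDiffOn_extP (-1))

end Smooth

/-! ### The charts `Λ_±` of `S⁴` inverting the sector map -/

/-- The stereographic chart from the pole `v`, read on `ℝⁿ⁺²` via `stereoToFun`, composed with a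
map `f` from any normed space which is smooth at a point where it takes a unit value other than the
pole, is smooth there (variant of `Literature.Topology.FourManifolds.contDiffAt_repr_stereoToFun_comp` with arbitrary domain). [folklore] -/
theorem contDiffAt_repr_stereoToFun_comp' {n : ℕ} {F : Type*} [NormedAddCommGroup F] [NormedSpace ℝ F]
    (v : 𝕊 n) {f : F → 𝔼 (n + 1)} {y : F} (hf : ContDiffAt ℝ ∞ f y) (h1 : ‖f y‖ = 1)
    (hv : f y ≠ (v : 𝔼 (n + 1))) :
    ContDiffAt ℝ ∞ (fun y => (OrthonormalBasis.fromOrthogonalSpanSingleton n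
      (ne_zero_of_mem_unit_sphere v)).repr (stereoToFun (v : 𝔼 (n + 1)) (f y))) y := by
  refine (LinearIsometryEquiv.contDiff _).comp_contDiffAt y
    (ContDiffAt.comp (g := stereoToFun (v : 𝔼 (n + 1))) y ?_ hf)
  refine contDiffOn_stereoToFun.contDiffAt ((isOpen_ne_fun (innerSL ℝ _).continuous
    continuous_const).mem_nhds ?_)
  rw [mem_setOf_eq, innerSL_apply_apply]
  intro h
  have := (sphere_ext_iff v ⟨f y, mem_sphere_zero_iff_norm.2 h1⟩).2 h
  exact hv (congrArg Subtype.val this).symm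

/-- A map into `S⁴` which, near `y`, is a smooth `ℝ⁵`-valued map (restricted to the sphere) is
`C^∞` at `y` in the manifold sense. [folklore] -/
theorem contMDiffAt_sphere_of_contDiffAt {F : Type*} [NormedAddCommGroup F] [NormedSpace ℝ F]
    {G : F → 𝕊 4} {g : F → 𝔼 5} {y : F} {s : Set F} (hs : IsOpen s) (hy : y ∈ s)
    (hGg : ∀ y' ∈ s, ((G y' : 𝕊 4) : 𝔼 5) = g y') (hg : ContDiffAt ℝ ∞ g y) (hG : ContinuousAt G y) :
    ContMDiffAt 𝓘(ℝ, F) (𝓡 4) ∞ G y := by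
  rw [contMDiffAt_iff_target]
  refine ⟨hG, ?_⟩
  have h1 : ‖g y‖ = 1 := by rw [← hGg y hy]; exact norm_eq_of_mem_sphere (G y)
  have hv : g y ≠ ((-G y : 𝕊 4) : 𝔼 5) := by
    rw [← hGg y hy, coe_neg_sphere]
    intro h
    have h0 : ((G y : 𝕊 4) : 𝔼 5) = 0 := by
      have : (2 : ℝ) • ((G y : 𝕊 4) : 𝔼 5) = 0 := by rw [two_smul]; nth_rewrite 2 [h]; exact add_neg_cancel _
      exact (smul_eq_zero.1 this).resolve_left two_ne_zero
    exact ne_zero_of_mem_unit_sphere (G y) h0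
  have key := contDiffAt_repr_stereoToFun_comp' (-G y) hg h1 hv
  refine (key.contMDiffAt).congr_of_eventuallyEq ?_
  filter_upwards [hs.mem_nhds hy] with y' hy'
  rw [Function.comp_apply, extChartAt_coe, Function.comp_apply]
  show stereographic' 4 (-G y) (G y') = _
  rw [stereographic'_eq_repr_stereoToFun, hGg y' hy']

/-- The source `U₊ = {Q < 1, a > 0} ⊆ S⁴` of `Λ₊`. [folklore] -/
def posSource (α : ℝ) : Set (𝕊 4) := {x | invQ α x < 1 ∧ 0 < invA α x}

/-- The source `U₋ = {Q < 1, b > 0} ⊆ S⁴` of `Λ₋`. [folklore] -/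
def negSource (α : ℝ) : Set (𝕊 4) := {x | invQ α x < 1 ∧ 0 < invB α x}

/-- A base point of `S⁴` used as junk value. [folklore] -/
def junkPoint (α : ℝ) : 𝕊 4 := ⟨sectorMapFun α 0, mem_sphere_zero_iff_norm.2 (norm_sectorMapFun (by simp))⟩

open Classical in
/-- The (total) inverse of `Λ₊`: `ẽ₊` on `V₊`, junk elsewhere. [folklore] -/
def posInv (α : ℝ) (w : 𝔼 4) : 𝕊 4 :=
  if h : w ∈ extDom 1 then ⟨sectorMapExtPos α w, mem_sphere_zero_iff_norm.2 (norm_sectorMapExtPos α h)⟩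
  else junkPoint α

open Classical in
/-- The (total) inverse of `Λ₋`: `ẽ₋` on `V₋`, junk elsewhere. [folklore] -/
def negInv (α : ℝ) (w : 𝔼 4) : 𝕊 4 :=
  if h : w ∈ extDom (-1) then ⟨sectorMapExtNeg α w, mem_sphere_zero_iff_norm.2 (norm_sectorMapExtNeg α h)⟩
  else junkPoint α

/-- On `V₊` the total inverse is `ẽ₊`. [folklore] -/
theorem coe_posInv (α : ℝ) {w : 𝔼 4} (hw : w ∈ extDom 1) : ((posInv α w : 𝕊 4) : 𝔼 5) = sectorMapExtPos α w := by
  rw [posInv, dif_pos hw]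

/-- On `V₋` the total inverse is `ẽ₋`. [folklore] -/
theorem coe_negInv (α : ℝ) {w : 𝔼 4} (hw : w ∈ extDom (-1)) : ((negInv α w : 𝕊 4) : 𝔼 5) = sectorMapExtNeg α w := by
  rw [negInv, dif_pos hw]

variable (α : ℝ)

/-- **The chart `Λ₊` of `S⁴`**: `sectorInvFun α` on `U₊ = {Q < 1, a > 0}`, with inverse `ẽ₊` on
`V₊ = {ν + 2s > 0}`. [folklore] -/
def posChart : OpenPartialHomeomorph (𝕊 4) (𝔼 4) where
  toFun x := sectorInvFun α x
  invFun := posInv α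
  source := posSource α
  target := extDom 1
  map_source' x hx := sectorInvFun_mem_extDom_one (norm_eq_of_mem_sphere x) hx.1 hx.2
  map_target' w hw := by
    refine ⟨?_, ?_⟩
    · show invQ α ((posInv α w : 𝕊 4) : 𝔼 5) < 1
      rw [coe_posInv α hw, invQ_sectorMapExtPos hw]
      have := secM_pos w
      have : 0 < 1 / secM w ^ 2 := by positivity
      linarith
    · show 0 < invA α ((posInv α w : 𝕊 4) : 𝔼 5)
      rw [coe_posInv α hw, invA_sectorMapExtPos]
      exact div_pos (extP_pos hw) (secM_pos w)
  left_inv' x hx := by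
    have hmem : sectorInvFun α x ∈ extDom 1 :=
      sectorInvFun_mem_extDom_one (norm_eq_of_mem_sphere x) hx.1 hx.2
    apply Subtype.ext
    rw [coe_posInv α hmem]
    exact sectorMapExtPos_sectorInvFun (norm_eq_of_mem_sphere x) hx.1 hx.2
  right_inv' w hw := by
    show sectorInvFun α ((posInv α w : 𝕊 4) : 𝔼 5) = w
    rw [coe_posInv α hw]
    exact sectorInvFun_sectorMapExtPos hw
  open_source := by
    have h : IsOpen {x : 𝔼 5 | invQ α x < 1 ∧ 0 < invA α x} :=
      (isOpen_lt (contDiff_invQ α).continuous continuous_const).inter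
        (isOpen_lt continuous_const (contDiff_invA α).continuous)
    exact h.preimage continuous_subtype_val
  open_target := isOpen_extDom 1
  continuousOn_toFun :=
    (contDiffOn_sectorInvFun α).continuousOn.comp continuous_subtype_val.continuousOn fun x hx => hx.1
  continuousOn_invFun := by
    rw [Topology.IsInducing.subtypeVal.continuousOn_iff]
    exact (contDiffOn_sectorMapExtPos α).continuousOn.congr fun w hw => coe_posInv α hw

/-- **The chart `Λ₋` of `S⁴`**: `sectorInvFun α` on `U₋ = {Q < 1, b > 0}`, with inverse `ẽ₋` on
`V₋ = {ν - 2s > 0}`. [folklore] -/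
def negChart : OpenPartialHomeomorph (𝕊 4) (𝔼 4) where
  toFun x := sectorInvFun α x
  invFun := negInv α
  source := negSource α
  target := extDom (-1)
  map_source' x hx := sectorInvFun_mem_extDom_neg_one (norm_eq_of_mem_sphere x) hx.1 hx.2
  map_target' w hw := by
    refine ⟨?_, ?_⟩
    · show invQ α ((negInv α w : 𝕊 4) : 𝔼 5) < 1
      rw [coe_negInv α hw, invQ_sectorMapExtNeg hw]
      have := secM_pos w
      have : 0 < 1 / secM w ^ 2 := by positivity
      linarith
    · show 0 < invB α ((negInv α w : 𝕊 4) : 𝔼 5)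
      rw [coe_negInv α hw, invB_sectorMapExtNeg]
      exact div_pos (extP_pos hw) (secM_pos w)
  left_inv' x hx := by
    have hmem : sectorInvFun α x ∈ extDom (-1) :=
      sectorInvFun_mem_extDom_neg_one (norm_eq_of_mem_sphere x) hx.1 hx.2
    apply Subtype.ext
    rw [coe_negInv α hmem]
    exact sectorMapExtNeg_sectorInvFun (norm_eq_of_mem_sphere x) hx.1 hx.2
  right_inv' w hw := by
    show sectorInvFun α ((negInv α w : 𝕊 4) : 𝔼 5) = w
    rw [coe_negInv α hw]
    exact sectorInvFun_sectorMapExtNeg hw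
  open_source := by
    have h : IsOpen {x : 𝔼 5 | invQ α x < 1 ∧ 0 < invB α x} :=
      (isOpen_lt (contDiff_invQ α).continuous continuous_const).inter
        (isOpen_lt continuous_const (contDiff_invB α).continuous)
    exact h.preimage continuous_subtype_val
  open_target := isOpen_extDom (-1)
  continuousOn_toFun :=
    (contDiffOn_sectorInvFun α).continuousOn.comp continuous_subtype_val.continuousOn fun x hx => hx.1
  continuousOn_invFun := by
    rw [Topology.IsInducing.subtypeVal.continuousOn_iff]
    exact (contDiffOn_sectorMapExtNeg α).continuousOn.congr fun w hw => coe_negInv α hw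

/-- `Λ₊` is `sectorInvFun α` as a function (definitional). [folklore] -/
theorem posChart_apply (x : 𝕊 4) : posChart α x = sectorInvFun α x := rfl
/-- `Λ₋` is `sectorInvFun α` as a function (definitional). [folklore] -/
theorem negChart_apply (x : 𝕊 4) : negChart α x = sectorInvFun α x := rfl
/-- The source of `Λ₊` (definitional). [folklore] -/
theorem posChart_source : (posChart α).source = posSource α := rfl
/-- The source of `Λ₋` (definitional). [folklore] -/
theorem negChart_source : (negChart α).source = negSource α := rfl

/-- `Λ₊` lies in the maximal `C^∞` atlas of `S⁴`. [folklore] -/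
theorem posChart_mem_maximalAtlas : posChart α ∈ IsManifold.maximalAtlas (𝓡 4) ∞ (𝕊 4) := by
  rw [IsManifold.mem_maximalAtlas_iff_contMDiffOn]
  constructor
  · intro x hx
    refine ContMDiffAt.contMDiffWithinAt ?_
    have h1 : ContDiffAt ℝ ∞ (sectorInvFun α) (x : 𝔼 5) :=
      (contDiffOn_sectorInvFun α).contDiffAt ((isOpen_invDom α).mem_nhds hx.1)
    exact h1.contMDiffAt.comp x contMDiff_coe_sphere.contMDiffAt
  · intro w hw
    refine ContMDiffAt.contMDiffWithinAt ?_
    refine contMDiffAt_sphere_of_contDiffAt (isOpen_extDom 1) hw (fun w' hw' => coe_posInv α hw')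
      ((contDiffOn_sectorMapExtPos α).contDiffAt ((isOpen_extDom 1).mem_nhds hw)) ?_
    exact (posChart α).continuousOn_symm.continuousAt ((isOpen_extDom 1).mem_nhds hw)

/-- `Λ₋` lies in the maximal `C^∞` atlas of `S⁴`. [folklore] -/
theorem negChart_mem_maximalAtlas : negChart α ∈ IsManifold.maximalAtlas (𝓡 4) ∞ (𝕊 4) := by
  rw [IsManifold.mem_maximalAtlas_iff_contMDiffOn]
  constructor
  · intro x hx
    refine ContMDiffAt.contMDiffWithinAt ?_
    have h1 : ContDiffAt ℝ ∞ (sectorInvFun α) (x : 𝔼 5) :=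
      (contDiffOn_sectorInvFun α).contDiffAt ((isOpen_invDom α).mem_nhds hx.1)
    exact h1.contMDiffAt.comp x contMDiff_coe_sphere.contMDiffAt
  · intro w hw
    refine ContMDiffAt.contMDiffWithinAt ?_
    refine contMDiffAt_sphere_of_contDiffAt (isOpen_extDom (-1)) hw (fun w' hw' => coe_negInv α hw')
      ((contDiffOn_sectorMapExtNeg α).contDiffAt ((isOpen_extDom (-1)).mem_nhds hw)) ?_
    exact (negChart α).continuousOn_symm.continuousAt ((isOpen_extDom (-1)).mem_nhds hw)

/-- The sector map lands in `U₊` at points of `𝔻⁴ ∩ V₊`. [folklore] -/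
theorem sectorMap_mem_posSource {w : 𝔻 4} (hw : (w : 𝔼 4) ∈ extDom 1) : sectorMap α w ∈ posSource α := by
  have hw1 : ‖(w : 𝔼 4)‖ ≤ 1 := mem_closedBall_zero_iff.1 w.2
  have h := (posChart α).map_target hw
  rw [posChart] at h
  change posInv α w ∈ posSource α at h
  have heq : posInv α w = sectorMap α w :=
    Subtype.ext (by rw [coe_posInv α hw, coe_sectorMap, sectorMapExtPos_eq_sectorMapFun hw1 hw])
  rwa [heq] at h

/-- The sector map lands in `U₋` at points of `𝔻⁴ ∩ V₋`. [folklore] -/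
theorem sectorMap_mem_negSource {w : 𝔻 4} (hw : (w : 𝔼 4) ∈ extDom (-1)) : sectorMap α w ∈ negSource α := by
  have hw1 : ‖(w : 𝔼 4)‖ ≤ 1 := mem_closedBall_zero_iff.1 w.2
  have h := (negChart α).map_target hw
  rw [negChart] at h
  change negInv α w ∈ negSource α at h
  have heq : negInv α w = sectorMap α w :=
    Subtype.ext (by rw [coe_negInv α hw, coe_sectorMap, sectorMapExtNeg_eq_sectorMapFun hw1 hw])
  rwa [heq] at h

/-! ### The sector map is an immersion off the corner locus -/

/-- **Reduction of the immersion property at `w`** to: a chart `Λ` of `S⁴` in the maximal atlas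
which is `sectorInvFun α` as a function and contains `sectorMap α w` in its source, a chart `e` of
the atlas of `𝔻⁴` at `w` and a partial diffeomorphism `D` of `ℝ⁴` extending `e`; in the charts
`e` and `Λ ≫ D` the sector map reads as the identity. [folklore] -/
theorem isImmersionAtOfComplement_sectorMap_of_charts {w : 𝔻 4}
    (Λ : OpenPartialHomeomorph (𝕊 4) (𝔼 4)) (hΛ : Λ ∈ IsManifold.maximalAtlas (𝓡 4) ∞ (𝕊 4))
    (hΛapply : ∀ x, Λ x = sectorInvFun α x) (hwΛ : sectorMap α w ∈ Λ.source)
    (e : OpenPartialHomeomorph (𝔻 4) (EuclideanHalfSpace 4))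
    (he : e ∈ atlas (EuclideanHalfSpace 4) (𝔻 4)) (hx : w ∈ e.source)
    (D : OpenPartialHomeomorph (𝔼 4) (𝔼 4)) (hD : ContDiffOn ℝ ∞ D D.source)
    (hD' : ContDiffOn ℝ ∞ D.symm D.target) (hxD : (w : 𝔼 4) ∈ D.source)
    (htarget : ∀ z ∈ e.target, z.val ∈ D.target)
    (hsymm : ∀ z ∈ e.target, ((e.symm z : 𝔻 4) : 𝔼 4) = D.symm z.val) :
    Manifold.IsImmersionAtOfComplement PUnit.{1} (𝓡∂ 4) (𝓡 4) ∞ (sectorMap α) w := by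
  refine Manifold.IsImmersionAtOfComplement.mk_of_continuousAt
    (continuous_sectorMap α).continuousAt (ContinuousLinearEquiv.prodUnique ℝ (𝔼 4) PUnit.{1})
    e (Λ ≫ₕ D) hx ?_ (IsManifold.subset_maximalAtlas he)
    (trans_mem_maximalAtlas_of_contDiffOn hΛ _ hD hD') ?_
  · rw [OpenPartialHomeomorph.trans_source, mem_inter_iff, mem_preimage, hΛapply, coe_sectorMap,
      sectorInvFun_sectorMapFun (mem_closedBall_zero_iff.1 w.2)]
    exact ⟨hwΛ, hxD⟩
  · intro z hz
    rw [OpenPartialHomeomorph.extend_target] at hz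
    obtain ⟨hz, z, rfl⟩ := hz
    rw [mem_preimage, ModelWithCorners.left_inv] at hz
    simp only [comp_apply, OpenPartialHomeomorph.extend_coe, OpenPartialHomeomorph.extend_coe_symm,
      ModelWithCorners.left_inv, modelWithCornersSelf_coe, id, OpenPartialHomeomorph.trans_apply,
      hΛapply, coe_sectorMap]
    rw [sectorInvFun_sectorMapFun (mem_closedBall_zero_iff.1 (e.symm z).2), hsymm z hz,
      D.right_inv (htarget z hz)]
    rfl

/-- The immersion property at `w`, given a suitable chart `Λ` of `S⁴` (interior and boundary
points of the ball handled by the translated interior chart, resp. the polar boundary chart). [folklore] -/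
theorem isImmersionAt_sectorMap_of_chart {w : 𝔻 4}
    (Λ : OpenPartialHomeomorph (𝕊 4) (𝔼 4)) (hΛ : Λ ∈ IsManifold.maximalAtlas (𝓡 4) ∞ (𝕊 4))
    (hΛapply : ∀ x, Λ x = sectorInvFun α x) (hwΛ : sectorMap α w ∈ Λ.source) :
    Manifold.IsImmersionAt (𝓡∂ 4) (𝓡 4) ∞ (sectorMap α) w := by
  refine Manifold.IsImmersionAtOfComplement.isImmersionAt (F := PUnit.{1}) ?_
  by_cases hw : ‖(w : 𝔼 4)‖ < 1
  · set D : OpenPartialHomeomorph (𝔼 4) (𝔼 4) :=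
      (Homeomorph.addRight ((2 : ℝ) • closedBallBaseVector 3)).toOpenPartialHomeomorph with hD
    refine isImmersionAtOfComplement_sectorMap_of_charts α Λ hΛ hΛapply hwΛ (closedBallInteriorChart 3)
      (mem_insert _ _) hw D ?_ ?_ (mem_univ _) (fun z _ => mem_univ _) fun z hz => ?_
    · exact (contDiff_id.add contDiff_const).contDiffOn
    · exact (contDiff_id.sub contDiff_const).contDiffOn
    · rw [coe_closedBallInteriorChart_symm_apply (le_of_lt hz), hD,
        Homeomorph.toOpenPartialHomeomorph_symm_apply, Homeomorph.addRight_symm,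
        Homeomorph.coe_addRight, sub_eq_add_neg]
  · have hw1 : ‖(w : 𝔼 4)‖ = 1 := (mem_closedBall_zero_iff.1 w.2).antisymm (not_lt.1 hw)
    set p : 𝕊 3 := ⟨w, mem_sphere_zero_iff_norm.2 hw1⟩ with hp
    have hxe : w ∈ (closedBallBoundaryChart p).source := by
      have := mem_chart_source (EuclideanHalfSpace 4) w
      rwa [closedBall_chartAt_of_norm_eq_one hw1] at this
    exact isImmersionAtOfComplement_sectorMap_of_charts α Λ hΛ hΛapply hwΛ (closedBallBoundaryChart p)
      (mem_insert_of_mem _ (mem_range_self p)) hxe (polarChart p) (contDiffOn_polarChart p)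
      (contDiff_polarChart_symm p).contDiffOn hxe (fun z hz => hz) fun z hz =>
      coe_closedBallBoundaryChart_symm_eq_polarChart_symm p (le_of_lt hz)

/-- **The sector map is a `C^∞` immersion at every point off the corner locus `K`.** [folklore] -/
theorem isImmersionAt_sectorMap {w : 𝔻 4} (hK : ¬ ((w : 𝔼 4) 0 = 0 ∧ ‖(w : 𝔼 4)‖ = 1)) :
    Manifold.IsImmersionAt (𝓡∂ 4) (𝓡 4) ∞ (sectorMap α) w := by
  rcases mem_extDom_or hK with h | h
  · exact isImmersionAt_sectorMap_of_chart α (posChart α) (posChart_mem_maximalAtlas α)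
      (posChart_apply α) (sectorMap_mem_posSource α h)
  · exact isImmersionAt_sectorMap_of_chart α (negChart α) (negChart_mem_maximalAtlas α)
      (negChart_apply α) (sectorMap_mem_negSource α h)

end Literature.Topology.FourManifolds.GayKirby

/-- **Discharge of the named fact `Literature.Topology.FourManifolds.sectorMap_isImmersionAt`.** [cite: GayKirby2016, §2 (arXiv p. 5), first example] -/
theorem Literature.Topology.FourManifolds.sectorMap_isImmersionAt_holds : Literature.Topology.FourManifolds.sectorMap_isImmersionAt :=
  fun α _ hK => Literature.Topology.FourManifolds.GayKirby.isImmersionAt_sectorMap α hK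


namespace Literature.Topology.FourManifolds.GayKirby

local notation "𝔼 " n:arg => EuclideanSpace ℝ (Fin n)
local notation "𝕊 " n:arg => (Metric.sphere (0 : EuclideanSpace ℝ (Fin (n + 1))) 1)
local notation "𝔻 " n:arg => (Metric.closedBall (0 : EuclideanSpace ℝ (Fin n)) 1)

attribute [local instance] fact_finrank_euclideanSpace_succ

/-! ### Corner charts, ball side: `φ = (u, 2s, ς(v/‖v‖))` -/

/-- Mathlib's chart `stereographic' n (-q)` of `𝕊ⁿ` is centred at `q`: it maps `q` to `0`
(Mathlib's private `stereographic'_neg`; restated here — as `Literature.Topology.FourManifolds.stereographic'_neg_apply_self` of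
`StereographicInversion.lean` — to keep the imports of this file small). [folklore] -/
theorem stereographic'_neg_self {n : ℕ} (q : 𝕊 n) : stereographic' n (-q) q = 0 := by
  show (OrthonormalBasis.fromOrthogonalSpanSingleton (𝕜 := ℝ) n
    (ne_zero_of_mem_unit_sphere (-q))).repr (stereographic (norm_eq_of_mem_sphere (-q)) q) = 0
  rw [stereographic_neg_apply, map_zero]

/-- The `ℝ³`-component `v = (w₁, w₂, w₃)` of `w ∈ ℝ⁴ = ℝ × ℝ³`. [folklore] -/
def tail₄ (w : 𝔼 4) : 𝔼 3 := !₂[w 1, w 2, w 3]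

/-- `v₀ = w₁`. [folklore] -/
@[simp] theorem tail₄_apply_zero (w : 𝔼 4) : tail₄ w 0 = w 1 := rfl
/-- `v₁ = w₂`. [folklore] -/
@[simp] theorem tail₄_apply_one (w : 𝔼 4) : tail₄ w 1 = w 2 := rfl
/-- `v₂ = w₃`. [folklore] -/
@[simp] theorem tail₄_apply_two (w : 𝔼 4) : tail₄ w 2 = w 3 := rfl

/-- `‖v‖² = w₁² + w₂² + w₃²`. [folklore] -/
theorem norm_tail₄_sq (w : 𝔼 4) : ‖tail₄ w‖ ^ 2 = w 1 ^ 2 + w 2 ^ 2 + w 3 ^ 2 := by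
  rw [EuclideanSpace.norm_sq_eq]
  simp [Fin.sum_univ_three]

/-- `‖w‖² = s² + ‖v‖²`. [folklore] -/
theorem norm_sq_eq_secS_sq_add (w : 𝔼 4) : ‖w‖ ^ 2 = secS w ^ 2 + ‖tail₄ w‖ ^ 2 := by
  rw [norm_sq_eq_four, norm_tail₄_sq]

/-- `‖v‖² = 1 - u - s²`. [folklore] -/
theorem norm_tail₄_sq_eq (w : 𝔼 4) : ‖tail₄ w‖ ^ 2 = 1 - secU w - secS w ^ 2 := by
  have h := norm_sq_eq_secS_sq_add w
  rw [secU]; linarith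

/-- `v` is smooth (linear) in `w`. [folklore] -/
theorem contDiff_tail₄ : ContDiff ℝ ∞ tail₄ := by
  have hc : ∀ i : Fin 4, ContDiff ℝ ∞ fun w : 𝔼 4 => w i := fun i => contDiff_euclidean.mp contDiff_id i
  rw [contDiff_euclidean]
  intro i
  fin_cases i
  · exact hc 1
  · exact hc 2
  · exact hc 3

/-- The pair `(x₂, x₃)` of a vector of `ℝ⁴`. [folklore] -/
def lastTwo (x : 𝔼 4) : 𝔼 2 := !₂[x 2, x 3]

/-- `(x₂, x₃)` is smooth (linear) in `x`. [folklore] -/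
theorem contDiff_lastTwo : ContDiff ℝ ∞ lastTwo := by
  have hc : ∀ i : Fin 4, ContDiff ℝ ∞ fun w : 𝔼 4 => w i := fun i => contDiff_euclidean.mp contDiff_id i
  rw [contDiff_euclidean]
  intro i
  fin_cases i
  · exact hc 2
  · exact hc 3

variable (q : 𝕊 2)

/-- The corner chart of the ball at the direction `q ∈ S²`, as a formula `ℝ⁴ → ℝ⁴`:
`w ↦ (u, 2s, ς(v/‖v‖))` with `ς = stereographic' 2 (-q)` the chart of `S²` centred at `q`. [folklore] -/
def ballCornerFun (w : 𝔼 4) : 𝔼 4 :=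
  !₂[secU w, 2 * secS w, stereographic' 2 (-q) (radialProjection q (tail₄ w)) 0,
    stereographic' 2 (-q) (radialProjection q (tail₄ w)) 1]

/-- The inverse formula `ℝ⁴ → ℝ⁴`: `x ↦ (x₁/2, √(1 - x₀ - x₁²/4) · ς⁻¹(x₂, x₃))`. [folklore] -/
def ballCornerInv (x : 𝔼 4) : 𝔼 4 :=
  !₂[x 1 / 2,
    √(1 - x 0 - (x 1 / 2) ^ 2) * ((stereographic' 2 (-q)).symm (lastTwo x) : 𝕊 2).val 0,
    √(1 - x 0 - (x 1 / 2) ^ 2) * ((stereographic' 2 (-q)).symm (lastTwo x) : 𝕊 2).val 1,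
    √(1 - x 0 - (x 1 / 2) ^ 2) * ((stereographic' 2 (-q)).symm (lastTwo x) : 𝕊 2).val 2]

/-- Coordinate `0` of the corner chart: `u`. [folklore] -/
@[simp] theorem ballCornerFun_apply_zero (w : 𝔼 4) : ballCornerFun q w 0 = secU w := rfl
/-- Coordinate `1` of the corner chart: `2s`. [folklore] -/
@[simp] theorem ballCornerFun_apply_one (w : 𝔼 4) : ballCornerFun q w 1 = 2 * secS w := rfl
/-- Coordinate `2` of the corner chart: `ς(v/‖v‖)₀`. [folklore] -/
@[simp] theorem ballCornerFun_apply_two (w : 𝔼 4) :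
    ballCornerFun q w 2 = stereographic' 2 (-q) (radialProjection q (tail₄ w)) 0 := rfl
/-- Coordinate `3` of the corner chart: `ς(v/‖v‖)₁`. [folklore] -/
@[simp] theorem ballCornerFun_apply_three (w : 𝔼 4) :
    ballCornerFun q w 3 = stereographic' 2 (-q) (radialProjection q (tail₄ w)) 1 := rfl

/-- The angular part of the corner chart is `ς(v/‖v‖)`. [folklore] -/
theorem lastTwo_ballCornerFun (w : 𝔼 4) :
    lastTwo (ballCornerFun q w) = stereographic' 2 (-q) (radialProjection q (tail₄ w)) := by
  ext i; fin_cases i <;> rfl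

/-- Coordinate `0` of the inverse formula: `x₁/2`. [folklore] -/
@[simp] theorem ballCornerInv_apply_zero (x : 𝔼 4) : ballCornerInv q x 0 = x 1 / 2 := rfl

/-- The `ℝ³`-part of the inverse formula: `√(1 - x₀ - x₁²/4) · ς⁻¹(x₂, x₃)`. [folklore] -/
theorem tail₄_ballCornerInv (x : 𝔼 4) : tail₄ (ballCornerInv q x) =
    √(1 - x 0 - (x 1 / 2) ^ 2) • ((stereographic' 2 (-q)).symm (lastTwo x) : 𝕊 2).val := by
  ext i; fin_cases i <;> rfl

/-- `‖ballCornerInv x‖² = 1 - x₀` when `1 - x₀ - x₁²/4 ≥ 0`. [folklore] -/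
theorem norm_ballCornerInv_sq {x : 𝔼 4} (hx : 0 ≤ 1 - x 0 - (x 1 / 2) ^ 2) :
    ‖ballCornerInv q x‖ ^ 2 = 1 - x 0 := by
  rw [norm_sq_eq_secS_sq_add, tail₄_ballCornerInv, norm_smul, Real.norm_eq_abs,
    abs_of_nonneg (Real.sqrt_nonneg _), norm_eq_of_mem_sphere, mul_one, Real.sq_sqrt hx]
  show (x 1 / 2) ^ 2 + _ = _
  ring

/-- `s (ballCornerInv x) = x₁/2`. [folklore] -/
theorem secS_ballCornerInv (x : 𝔼 4) : secS (ballCornerInv q x) = x 1 / 2 := rfl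

/-- `u (ballCornerInv x) = x₀`. [folklore] -/
theorem secU_ballCornerInv {x : 𝔼 4} (hx : 0 ≤ 1 - x 0 - (x 1 / 2) ^ 2) : secU (ballCornerInv q x) = x 0 := by
  rw [secU, norm_ballCornerInv_sq q hx]; ring

/-- The open set `{v ≠ 0, v/‖v‖ ≠ -q} ⊆ ℝ⁴` on which the corner chart formula is smooth. [folklore] -/
def ballCornerDom : Set (𝔼 4) := {w | tail₄ w ≠ 0 ∧ ‖tail₄ w‖⁻¹ • tail₄ w ≠ -(q : 𝔼 3)}

/-- `ballCornerDom` is open. [folklore] -/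
theorem isOpen_ballCornerDom : IsOpen (ballCornerDom q) := by
  have hc : ContinuousOn (fun w : 𝔼 4 => ‖tail₄ w‖⁻¹ • tail₄ w) {w | tail₄ w ≠ 0} :=
    ((contDiff_tail₄.continuous.norm).continuousOn.inv₀ fun w hw => norm_ne_zero_iff.2 hw).smul
      contDiff_tail₄.continuous.continuousOn
  exact hc.isOpen_inter_preimage (isOpen_ne.preimage contDiff_tail₄.continuous) isOpen_ne

/-- The angular part `ς(v/‖v‖)` is smooth on `ballCornerDom`. [folklore] -/
theorem contDiffOn_stereographic'_radialProjection_tail₄ :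
    ContDiffOn ℝ ∞ (fun w => stereographic' 2 (-q) (radialProjection q (tail₄ w))) (ballCornerDom q) := by
  have heq : EqOn (fun w => stereographic' 2 (-q) (radialProjection q (tail₄ w)))
      (fun w => (OrthonormalBasis.fromOrthogonalSpanSingleton (𝕜 := ℝ) 2
        (ne_zero_of_mem_unit_sphere (-q))).repr
          (stereoToFun ((-q : 𝕊 2) : 𝔼 3) (‖tail₄ w‖⁻¹ • tail₄ w))) (ballCornerDom q) := by
    intro w hw
    simp only
    rw [stereographic'_eq_repr_stereoToFun, coe_radialProjection_of_ne_zero q hw.1]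
  refine ContDiffOn.congr (fun w hw => ContDiffAt.contDiffWithinAt ?_) heq
  obtain ⟨h0, hq⟩ := hw
  have htail : ContDiffAt ℝ ∞ tail₄ w := contDiff_tail₄.contDiffAt
  have hnorm : ContDiffAt ℝ ∞ (fun w => ‖tail₄ w‖) w := htail.norm ℝ h0
  refine contDiffAt_repr_stereoToFun_comp' (-q) ((hnorm.inv (norm_ne_zero_iff.2 h0)).smul htail) ?_ ?_
  · rw [norm_smul, norm_inv, norm_norm, inv_mul_cancel₀ (norm_ne_zero_iff.2 h0)]
  · rwa [coe_neg_sphere]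

/-- **The corner chart formula is smooth on `ballCornerDom`.** [folklore] -/
theorem contDiffOn_ballCornerFun : ContDiffOn ℝ ∞ (ballCornerFun q) (ballCornerDom q) := by
  have hst := contDiffOn_stereographic'_radialProjection_tail₄ q
  rw [contDiffOn_euclidean] at hst ⊢
  intro i
  fin_cases i
  · exact contDiff_secU.contDiffOn
  · exact (contDiff_const.mul contDiff_secS).contDiffOn
  · exact hst 0
  · exact hst 1

/-- The open set `{1 - x₀ - x₁²/4 > 0} ⊆ ℝ⁴` on which the inverse formula is smooth. [folklore] -/
def ballCornerInvDom : Set (𝔼 4) := {x | 0 < 1 - x 0 - (x 1 / 2) ^ 2}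

/-- `ballCornerInvDom` is open. [folklore] -/
theorem isOpen_ballCornerInvDom : IsOpen ballCornerInvDom := by
  have : Continuous fun x : 𝔼 4 => 1 - x 0 - (x 1 / 2) ^ 2 := by fun_prop
  exact isOpen_lt continuous_const this

/-- **The inverse formula is smooth on `ballCornerInvDom`.** [folklore] -/
theorem contDiffOn_ballCornerInv : ContDiffOn ℝ ∞ (ballCornerInv q) ballCornerInvDom := by
  have hc : ∀ i : Fin 4, ContDiff ℝ ∞ fun w : 𝔼 4 => w i := fun i => contDiff_euclidean.mp contDiff_id i
  have hsq : ContDiffOn ℝ ∞ (fun x : 𝔼 4 => √(1 - x 0 - (x 1 / 2) ^ 2)) ballCornerInvDom :=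
    ((contDiff_const.sub (hc 0)).sub (((hc 1).div_const _).pow 2)).contDiffOn.sqrt fun x hx => ne_of_gt hx
  have hy : ContDiff ℝ ∞ fun x : 𝔼 4 => (((stereographic' 2 (-q)).symm (lastTwo x) : 𝕊 2) : 𝔼 3) :=
    (contDiff_coe_stereographic'_symm (-q)).comp contDiff_lastTwo
  have hyi : ∀ i : Fin 3, ContDiff ℝ ∞ fun x : 𝔼 4 =>
      (((stereographic' 2 (-q)).symm (lastTwo x) : 𝕊 2) : 𝔼 3) i := fun i => contDiff_euclidean.mp hy i
  rw [contDiffOn_euclidean]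
  intro i
  fin_cases i
  · exact ((hc 1).div_const _).contDiffOn
  · exact hsq.mul (hyi 0).contDiffOn
  · exact hsq.mul (hyi 1).contDiffOn
  · exact hsq.mul (hyi 2).contDiffOn

/-- **The corner chart `φ_q` of `𝔻⁴`** at the direction `q ∈ S²`: `w ↦ (1 - ‖w‖², 2 w₀, ς(v/‖v‖))`
on `{v ≠ 0, v/‖v‖ ≠ -q}`, with values in the half-space model (first coordinate `u ≥ 0`), inverse
`z ↦ (z₁/2, √(1 - z₀ - z₁²/4) · ς⁻¹(z₂, z₃))` on `{z₀ + z₁²/4 < 1}` (made total by the radial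
retraction). [folklore] -/
def ballCornerChart : OpenPartialHomeomorph (𝔻 4) (EuclideanHalfSpace 4) where
  toFun w := ⟨ballCornerFun q w, secU_nonneg (mem_closedBall_zero_iff.1 w.2)⟩
  invFun z := closedBallRetraction 4 (ballCornerInv q z.val)
  source := {w | (w : 𝔼 4) ∈ ballCornerDom q}
  target := {z | z.val 0 + (z.val 1 / 2) ^ 2 < 1}
  map_source' w hw := by
    show secU w + (2 * secS w / 2) ^ 2 < 1
    have h := norm_tail₄_sq_eq (w : 𝔼 4)
    have hpos : 0 < ‖tail₄ (w : 𝔼 4)‖ := norm_pos_iff.2 hw.1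
    nlinarith
  map_target' z hz := by
    have hz' : z.val 0 + (z.val 1 / 2) ^ 2 < 1 := hz
    have hc : 0 < 1 - z.val 0 - (z.val 1 / 2) ^ 2 := by linarith
    have hle : ‖ballCornerInv q z.val‖ ≤ 1 := by
      have h := norm_ballCornerInv_sq q hc.le
      have h0 := z.2
      nlinarith [norm_nonneg (ballCornerInv q z.val)]
    show (closedBallRetraction 4 (ballCornerInv q z.val) : 𝔼 4) ∈ ballCornerDom q
    rw [closedBallRetraction_of_norm_le 4 hle, ballCornerDom, mem_setOf_eq, tail₄_ballCornerInv]
    set y : 𝕊 2 := (stereographic' 2 (-q)).symm (lastTwo z.val) with hy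
    have hsq : 0 < √(1 - z.val 0 - (z.val 1 / 2) ^ 2) := Real.sqrt_pos.2 hc
    have hys : y ∈ (stereographic' 2 (-q)).source := (stereographic' 2 (-q)).map_target (by simp)
    rw [stereographic'_source, mem_compl_singleton_iff] at hys
    refine ⟨smul_ne_zero hsq.ne' (ne_zero_of_mem_unit_sphere y), fun h => hys ?_⟩
    rw [norm_smul_coe_sphere hsq.le, smul_smul, inv_mul_cancel₀ hsq.ne', one_smul] at h
    exact Subtype.ext (by rw [h, coe_neg_sphere])
  left_inv' w hw := by
    obtain ⟨hw0, hwq⟩ := hw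
    have hw1 : ‖(w : 𝔼 4)‖ ≤ 1 := mem_closedBall_zero_iff.1 w.2
    apply Subtype.ext
    have hveq : ballCornerInv q (ballCornerFun q w) = (w : 𝔼 4) := by
      have htn : ‖tail₄ (w : 𝔼 4)‖ ^ 2 = 1 - secU w - secS w ^ 2 := norm_tail₄_sq_eq w
      have hc : √(1 - ballCornerFun q w 0 - (ballCornerFun q w 1 / 2) ^ 2) = ‖tail₄ (w : 𝔼 4)‖ := by
        rw [ballCornerFun_apply_zero, ballCornerFun_apply_one, ← Real.sqrt_sq (norm_nonneg _), htn]
        congr 1; ring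
      have hy : ((stereographic' 2 (-q)).symm (lastTwo (ballCornerFun q w)) : 𝕊 2) =
          radialProjection q (tail₄ (w : 𝔼 4)) := by
        rw [lastTwo_ballCornerFun]
        exact (stereographic' 2 (-q)).left_inv (radialProjection_mem_source_stereographic' hw0 hwq)
      have htail : tail₄ (ballCornerInv q (ballCornerFun q w)) = tail₄ (w : 𝔼 4) := by
        rw [tail₄_ballCornerInv, hc, hy, norm_smul_coe_radialProjection]
      ext i
      fin_cases i
      · show ballCornerFun q w 1 / 2 = (w : 𝔼 4) 0
        rw [ballCornerFun_apply_one, secS]; ring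
      · exact congrArg (· 0) htail
      · exact congrArg (· 1) htail
      · exact congrArg (· 2) htail
    show (closedBallRetraction 4 (ballCornerInv q (ballCornerFun q w)) : 𝔼 4) = w
    rw [hveq, closedBallRetraction_of_norm_le 4 hw1]
  right_inv' z hz := by
    have hz' : z.val 0 + (z.val 1 / 2) ^ 2 < 1 := hz
    have hc : 0 < 1 - z.val 0 - (z.val 1 / 2) ^ 2 := by linarith
    have hle : ‖ballCornerInv q z.val‖ ≤ 1 := by
      have h := norm_ballCornerInv_sq q hc.le
      have h0 := z.2
      nlinarith [norm_nonneg (ballCornerInv q z.val)]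
    apply Subtype.ext
    show ballCornerFun q (closedBallRetraction 4 (ballCornerInv q z.val)) = z.val
    rw [closedBallRetraction_of_norm_le 4 hle]
    have hsq : 0 < √(1 - z.val 0 - (z.val 1 / 2) ^ 2) := Real.sqrt_pos.2 hc
    have hrp : radialProjection q (tail₄ (ballCornerInv q z.val)) =
        (stereographic' 2 (-q)).symm (lastTwo z.val) := by
      rw [tail₄_ballCornerInv, radialProjection_smul q hsq]
    have hς : stereographic' 2 (-q) (radialProjection q (tail₄ (ballCornerInv q z.val))) = lastTwo z.val := by
      rw [hrp]; exact (stereographic' 2 (-q)).right_inv (by simp)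
    ext i
    fin_cases i
    · exact secU_ballCornerInv q hc.le
    · show 2 * secS (ballCornerInv q z.val) = z.val 1
      rw [secS_ballCornerInv]; ring
    · show stereographic' 2 (-q) (radialProjection q (tail₄ (ballCornerInv q z.val))) 0 = z.val 2
      rw [hς]; rfl
    · show stereographic' 2 (-q) (radialProjection q (tail₄ (ballCornerInv q z.val))) 1 = z.val 3
      rw [hς]; rfl
  open_source := (isOpen_ballCornerDom q).preimage continuous_subtype_val
  open_target := by
    have : Continuous fun z : EuclideanHalfSpace 4 => z.val 0 + (z.val 1 / 2) ^ 2 := by fun_prop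
    exact isOpen_Iio.preimage this
  continuousOn_toFun := by
    have hval : Topology.IsInducing (Subtype.val : EuclideanHalfSpace 4 → 𝔼 4) :=
      Topology.IsInducing.subtypeVal
    refine hval.continuousOn_iff.2 ?_
    exact (contDiffOn_ballCornerFun q).continuousOn.comp continuous_subtype_val.continuousOn fun w hw => hw
  continuousOn_invFun := by
    refine (continuous_closedBallRetraction 4).comp_continuousOn
      ((contDiffOn_ballCornerInv q).continuousOn.comp continuous_subtype_val.continuousOn fun z hz => ?_)
    have hz' : z.val 0 + (z.val 1 / 2) ^ 2 < 1 := hz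
    show 0 < 1 - z.val 0 - (z.val 1 / 2) ^ 2
    linarith

/-- The corner chart in coordinates (definitional). [folklore] -/
theorem ballCornerChart_apply (w : 𝔻 4) : (ballCornerChart q w).val = ballCornerFun q w := rfl

/-- The source of the corner chart (definitional). [folklore] -/
theorem ballCornerChart_source : (ballCornerChart q).source = {w : 𝔻 4 | (w : 𝔼 4) ∈ ballCornerDom q} := rfl

/-- The target of the corner chart (definitional). [folklore] -/
theorem ballCornerChart_target : (ballCornerChart q).target = {z | z.val 0 + (z.val 1 / 2) ^ 2 < 1} := rfl

/-- The inverse of the corner chart on its target is the inverse formula. [folklore] -/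
theorem coe_ballCornerChart_symm {z : EuclideanHalfSpace 4} (hz : z ∈ (ballCornerChart q).target) :
    (((ballCornerChart q).symm z : 𝔻 4) : 𝔼 4) = ballCornerInv q z.val := by
  have hz' : z.val 0 + (z.val 1 / 2) ^ 2 < 1 := hz
  have hc : 0 < 1 - z.val 0 - (z.val 1 / 2) ^ 2 := by linarith
  have hle : ‖ballCornerInv q z.val‖ ≤ 1 := by
    have h := norm_ballCornerInv_sq q hc.le
    have h0 := z.2
    nlinarith [norm_nonneg (ballCornerInv q z.val)]
  exact closedBallRetraction_of_norm_le 4 hle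

/-- **The corner chart `φ_q` lies in the maximal `C^∞` atlas of `𝔻⁴`** (its formula and the inverse
formula are smooth on open sets of `ℝ⁴`; smoothness into/out of `𝔻⁴` is tested in `ℝ⁴` by
`Literature.Topology.FourManifolds.contMDiff_coe_closedBall` / `ContMDiffAt.codRestrict_closedBall`). [folklore] -/
theorem ballCornerChart_mem_maximalAtlas :
    ballCornerChart q ∈ IsManifold.maximalAtlas (𝓡∂ 4) ∞ (𝔻 4) := by
  rw [IsManifold.mem_maximalAtlas_iff_contMDiffOn]
  constructor
  · intro w hw
    refine ContMDiffAt.contMDiffWithinAt ?_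
    rw [contMDiffAt_iff_target]
    refine ⟨(ballCornerChart q).continuousOn.continuousAt ((ballCornerChart q).open_source.mem_nhds hw), ?_⟩
    have key : extChartAt (𝓡∂ 4) (ballCornerChart q w) ∘ ballCornerChart q =
        fun w' : 𝔻 4 => ballCornerFun q (w' : 𝔼 4) := by
      funext w'
      rw [comp_apply, extChartAt_coe, comp_apply, chartAt_self_eq, OpenPartialHomeomorph.refl_apply,
        modelWithCornersEuclideanHalfSpace_apply]
      rfl
    rw [key]
    exact ((contDiffOn_ballCornerFun q).contDiffAt ((isOpen_ballCornerDom q).mem_nhds hw)).contMDiffAt.comp w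
      (contMDiff_coe_closedBall w)
  · intro z hz
    refine ContMDiffAt.contMDiffWithinAt ?_
    set f : EuclideanHalfSpace 4 → 𝔼 4 := fun z => (closedBallRetraction 4 (ballCornerInv q z.val) : 𝔼 4) with hf
    have h𝔻 : ∀ z, f z ∈ 𝔻 4 := fun z => (closedBallRetraction 4 (ballCornerInv q z.val)).2
    have hfs : ContMDiffAt (𝓡∂ 4) 𝓘(ℝ, 𝔼 4) ∞ f z := by
      have hz' : z.val 0 + (z.val 1 / 2) ^ 2 < 1 := hz
      have hmem : z.val ∈ ballCornerInvDom := by show 0 < 1 - z.val 0 - (z.val 1 / 2) ^ 2; linarith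
      have h1 : ContMDiffAt (𝓡∂ 4) 𝓘(ℝ, 𝔼 4) ∞ (fun z : EuclideanHalfSpace 4 => ballCornerInv q z.val) z :=
        ((contDiffOn_ballCornerInv q).contDiffAt (isOpen_ballCornerInvDom.mem_nhds hmem)).contMDiffAt.comp z
          (𝓡∂ 4).contMDiff.contMDiffAt
      refine h1.congr_of_eventuallyEq ?_
      filter_upwards [(ballCornerChart q).open_target.mem_nhds hz] with z' hz'
      exact coe_ballCornerChart_symm q hz'
    have h := ContMDiffAt.codRestrict_closedBall hfs h𝔻
    have heq : Set.codRestrict f (𝔻 4) h𝔻 = (ballCornerChart q).symm := by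
      funext z'; exact Subtype.ext rfl
    rwa [heq] at h

end Literature.Topology.FourManifolds.GayKirby


namespace Literature.Topology.FourManifolds.GayKirby

local notation "𝔼 " n:arg => EuclideanSpace ℝ (Fin n)
local notation "𝕊 " n:arg => (Metric.sphere (0 : EuclideanSpace ℝ (Fin (n + 1))) 1)
local notation "𝔻 " n:arg => (Metric.closedBall (0 : EuclideanSpace ℝ (Fin n)) 1)

attribute [local instance] fact_finrank_euclideanSpace_succ

/-! ### Corner charts, sphere side: `ψ = (√(m²) z, ς(t/‖t‖))` -/

/-- The plane vector `(r₀, r₁)` of `r ∈ ℝ⁴` placed in `ℝ⁵ = ℂ × ℝ³` (to reuse `invA`, `invB`, `invQ`). [folklore] -/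
def liftXY (r : 𝔼 4) : 𝔼 5 := !₂[r 0, r 1, 0, 0, 0]

/-- `invA` of a vector given in coordinates. [folklore] -/
theorem invA_vec (α a₀ a₁ a₂ a₃ a₄ : ℝ) : invA α !₂[a₀, a₁, a₂, a₃, a₄] =
    2 / √3 * (a₀ * Real.sin (α + 2 * π / 3) - a₁ * Real.cos (α + 2 * π / 3)) := rfl

/-- `invB` of a vector given in coordinates. [folklore] -/
theorem invB_vec (α a₀ a₁ a₂ a₃ a₄ : ℝ) : invB α !₂[a₀, a₁, a₂, a₃, a₄] =
    2 / √3 * (a₁ * Real.cos α - a₀ * Real.sin α) := rfl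

/-- `invQ` in terms of `(invA, invB)` (definitional). [folklore] -/
theorem invQ_eq (α : ℝ) (x : 𝔼 5) :
    invQ α x = (invA α x ^ 2 + invB α x ^ 2) / 2 - 2 * invA α x * invB α x := rfl

/-- `Q` is quadratic: scaling the plane vector by `t` scales `Q` by `t²` (the tail is irrelevant). [folklore] -/
theorem invQ_vec_scale (α t a₀ a₁ a₂ a₃ a₄ b₂ b₃ b₄ : ℝ) :
    invQ α !₂[t * a₀, t * a₁, a₂, a₃, a₄] = t ^ 2 * invQ α !₂[a₀, a₁, b₂, b₃, b₄] := by
  simp only [invQ_eq, invA_vec, invB_vec]; ring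

/-- A vector of `ℝ⁵` in coordinates. [folklore] -/
theorem eq_vec5 (x : 𝔼 5) : x = !₂[x 0, x 1, x 2, x 3, x 4] := by
  ext i; fin_cases i <;> rfl

/-- `Q (sectorMap w) < 1` (indeed `= 1 - 1/m²`). [folklore] -/
theorem invQ_sectorMapFun_lt_one {α : ℝ} {w : 𝔼 4} (hw : ‖w‖ ≤ 1) : invQ α (sectorMapFun α w) < 1 := by
  have h := invM2_sectorMapFun (α := α) hw
  rw [invM2] at h
  have hM := secM_pos w
  by_contra hQ
  push Not at hQ
  have : 1 / (1 - invQ α (sectorMapFun α w)) ≤ 0 := div_nonpos_of_nonneg_of_nonpos zero_le_one (by linarith)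
  rw [h] at this
  nlinarith

/-- The tail `t = (x₂, x₃, x₄)` of the sector map is `λ v`. [folklore] -/
theorem sliceTailProj_sectorMapFun (α : ℝ) (w : 𝔼 4) :
    sliceTailProj (sectorMapFun α w) = secL w • tail₄ w := by
  ext i; fin_cases i <;> rfl

/-- The tail projection `ℝ⁵ → ℝ³` is smooth (linear). [folklore] -/
theorem contDiff_sliceTailProj : ContDiff ℝ ∞ sliceTailProj := by
  have hc : ∀ i : Fin 5, ContDiff ℝ ∞ fun x : 𝔼 5 => x i := fun i => contDiff_euclidean.mp contDiff_id i
  rw [contDiff_euclidean]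
  intro i
  fin_cases i
  · exact hc 2
  · exact hc 3
  · exact hc 4

variable (α : ℝ) (q : 𝕊 2)

/-- The corner chart of `S⁴`, as a formula `ℝ⁵ → ℝ⁴`: `x ↦ (√(m²) x₀, √(m²) x₁, ς(t/‖t‖))`
(`h(z) = z/√(1 - Q(z)) = √(m²) z`, `ς` the chart of `S²` centred at `q`). [folklore] -/
def sphCornerFun (x : 𝔼 5) : 𝔼 4 :=
  !₂[√(invM2 α x) * x 0, √(invM2 α x) * x 1,
    stereographic' 2 (-q) (radialProjection q (sliceTailProj x)) 0,
    stereographic' 2 (-q) (radialProjection q (sliceTailProj x)) 1]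

/-- The domain `{Q < 1, t ≠ 0, t/‖t‖ ≠ -q} ⊆ ℝ⁵` of the corner chart formula. [folklore] -/
def sphCornerDom : Set (𝔼 5) :=
  {x | invQ α x < 1 ∧ sliceTailProj x ≠ 0 ∧ ‖sliceTailProj x‖⁻¹ • sliceTailProj x ≠ -(q : 𝔼 3)}

/-- `k = 1/√(1 + Q(r₀, r₁))`, the radial factor of `h⁻¹`. [folklore] -/
def cornK (r : 𝔼 4) : ℝ := (√(1 + invQ α (liftXY r)))⁻¹

/-- `c = √(1 - k² (r₀² + r₁²))` (`= ‖t‖`). [folklore] -/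
def cornC (r : 𝔼 4) : ℝ := √(1 - cornK α r ^ 2 * (r 0 ^ 2 + r 1 ^ 2))

/-- The inverse formula `ℝ⁴ → ℝ⁵`: `r ↦ (k r₀, k r₁, c · ς⁻¹(r₂, r₃))`. [folklore] -/
def sphCornerInvFun (r : 𝔼 4) : 𝔼 5 :=
  !₂[cornK α r * r 0, cornK α r * r 1,
    cornC α r * ((stereographic' 2 (-q)).symm (lastTwo r) : 𝕊 2).val 0,
    cornC α r * ((stereographic' 2 (-q)).symm (lastTwo r) : 𝕊 2).val 1,
    cornC α r * ((stereographic' 2 (-q)).symm (lastTwo r) : 𝕊 2).val 2]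

/-- The target `{1 + Q > 0, r₀² + r₁² < 1 + Q}` of the corner chart. [folklore] -/
def sphCornerTgt : Set (𝔼 4) :=
  {r | 0 < 1 + invQ α (liftXY r) ∧ r 0 ^ 2 + r 1 ^ 2 < 1 + invQ α (liftXY r)}

/-- The tail of the inverse formula is `c · ς⁻¹(r₂, r₃)`. [folklore] -/
theorem sliceTailProj_sphCornerInvFun (r : 𝔼 4) : sliceTailProj (sphCornerInvFun α q r) =
    cornC α r • ((stereographic' 2 (-q)).symm (lastTwo r) : 𝕊 2).val := by
  ext i; fin_cases i <;> rfl

/-- The angular part of the corner chart is `ς(t/‖t‖)`. [folklore] -/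
theorem lastTwo_sphCornerFun (x : 𝔼 5) :
    lastTwo (sphCornerFun α q x) = stereographic' 2 (-q) (radialProjection q (sliceTailProj x)) := by
  ext i; fin_cases i <;> rfl

variable {α q}

/-- `0 < k` on the target. [folklore] -/
theorem cornK_pos {r : 𝔼 4} (hr : r ∈ sphCornerTgt α) : 0 < cornK α r :=
  inv_pos.2 (Real.sqrt_pos.2 hr.1)

/-- `k² = 1/(1 + Q)` on the target. [folklore] -/
theorem cornK_sq {r : 𝔼 4} (hr : r ∈ sphCornerTgt α) : cornK α r ^ 2 = 1 / (1 + invQ α (liftXY r)) := by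
  rw [cornK, inv_pow, Real.sq_sqrt hr.1.le, one_div]

/-- `c² = 1 - k² (r₀² + r₁²)` on the target. [folklore] -/
theorem cornC_sq {r : 𝔼 4} (hr : r ∈ sphCornerTgt α) :
    cornC α r ^ 2 = 1 - cornK α r ^ 2 * (r 0 ^ 2 + r 1 ^ 2) := by
  rw [cornC, Real.sq_sqrt]
  rw [cornK_sq hr, sub_nonneg, one_div, inv_mul_le_iff₀ hr.1]
  linarith [hr.2]

/-- `0 < c` on the target. [folklore] -/
theorem cornC_pos {r : 𝔼 4} (hr : r ∈ sphCornerTgt α) : 0 < cornC α r := by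
  rw [cornC]
  refine Real.sqrt_pos.2 ?_
  rw [cornK_sq hr, sub_pos, one_div, inv_mul_lt_iff₀ hr.1]
  linarith [hr.2]

/-- The inverse formula lands on the unit sphere. [folklore] -/
theorem norm_sphCornerInvFun {r : 𝔼 4} (hr : r ∈ sphCornerTgt α) : ‖sphCornerInvFun α q r‖ = 1 := by
  have hsq : ‖sphCornerInvFun α q r‖ ^ 2 = 1 := by
    rw [norm_sq_eq_of_fin_five, sliceTailProj_sphCornerInvFun, norm_smul, Real.norm_eq_abs,
      abs_of_pos (cornC_pos hr), norm_eq_of_mem_sphere, mul_one, cornC_sq hr]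
    show (cornK α r * r 0) ^ 2 + (cornK α r * r 1) ^ 2 + _ = 1
    ring
  have h0 := norm_nonneg (sphCornerInvFun α q r)
  nlinarith

/-- `Q (sphCornerInvFun r) = k² Q(r₀, r₁)`. [folklore] -/
theorem invQ_sphCornerInvFun (r : 𝔼 4) :
    invQ α (sphCornerInvFun α q r) = cornK α r ^ 2 * invQ α (liftXY r) := by
  rw [sphCornerInvFun, liftXY, invQ_vec_scale]

/-- `Q (liftXY (sphCornerFun x)) = m² Q(x)` on `{Q < 1}`. [folklore] -/
theorem invQ_liftXY_sphCornerFun {x : 𝔼 5} (hQ : invQ α x < 1) :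
    invQ α (liftXY (sphCornerFun α q x)) = invM2 α x * invQ α x := by
  have h : liftXY (sphCornerFun α q x) = !₂[√(invM2 α x) * x 0, √(invM2 α x) * x 1, 0, 0, 0] := rfl
  have hx : invQ α x = invQ α !₂[x 0, x 1, x 2, x 3, x 4] := congrArg (invQ α) (eq_vec5 x)
  rw [h, invQ_vec_scale _ _ _ _ _ _ _ (x 2) (x 3) (x 4), ← hx, Real.sq_sqrt (invM2_pos hQ).le]

/-- `1 + Q (liftXY (sphCornerFun x)) = m²` on `{Q < 1}`. [folklore] -/
theorem one_add_invQ_liftXY_sphCornerFun {x : 𝔼 5} (hQ : invQ α x < 1) :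
    1 + invQ α (liftXY (sphCornerFun α q x)) = invM2 α x := by
  rw [invQ_liftXY_sphCornerFun hQ]
  linear_combination (-1 : ℝ) * invM2_rel hQ

/-- The corner chart formula maps `sphCornerDom ∩ S⁴` into the target. [folklore] -/
theorem sphCornerFun_mem_tgt {x : 𝔼 5} (hx1 : ‖x‖ = 1) (hx : x ∈ sphCornerDom α q) :
    sphCornerFun α q x ∈ sphCornerTgt α := by
  obtain ⟨hQ, ht, -⟩ := hx
  have hm := invM2_pos hQ
  refine ⟨by rw [one_add_invQ_liftXY_sphCornerFun hQ]; exact hm, ?_⟩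
  rw [one_add_invQ_liftXY_sphCornerFun hQ]
  show (√(invM2 α x) * x 0) ^ 2 + (√(invM2 α x) * x 1) ^ 2 < invM2 α x
  rw [mul_pow, mul_pow, Real.sq_sqrt hm.le, ← mul_add]
  have hn := norm_sq_eq_of_fin_five x
  rw [hx1, one_pow] at hn
  have htpos : 0 < ‖sliceTailProj x‖ := norm_pos_iff.2 ht
  nlinarith [mul_pos hm (mul_pos htpos htpos)]

/-- The inverse formula maps the target into `sphCornerDom`. [folklore] -/
theorem sphCornerInvFun_mem_dom {r : 𝔼 4} (hr : r ∈ sphCornerTgt α) : sphCornerInvFun α q r ∈ sphCornerDom α q := by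
  refine ⟨?_, ?_, ?_⟩
  · rw [invQ_sphCornerInvFun, cornK_sq hr, one_div, inv_mul_lt_iff₀ hr.1]
    linarith
  · rw [sliceTailProj_sphCornerInvFun]
    exact smul_ne_zero (cornC_pos hr).ne' (ne_zero_of_mem_unit_sphere _)
  · rw [sliceTailProj_sphCornerInvFun]
    set y : 𝕊 2 := (stereographic' 2 (-q)).symm (lastTwo r) with hy
    have hys : y ∈ (stereographic' 2 (-q)).source := (stereographic' 2 (-q)).map_target (by simp)
    rw [stereographic'_source, mem_compl_singleton_iff] at hys
    intro h
    apply hys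
    rw [norm_smul_coe_sphere (cornC_pos hr).le, smul_smul, inv_mul_cancel₀ (cornC_pos hr).ne', one_smul] at h
    exact Subtype.ext (by rw [h, coe_neg_sphere])

/-- **`sphCornerInvFun ∘ sphCornerFun = id` on `sphCornerDom ∩ S⁴`.** [folklore] -/
theorem sphCornerInvFun_sphCornerFun {x : 𝔼 5} (hx1 : ‖x‖ = 1) (hx : x ∈ sphCornerDom α q) :
    sphCornerInvFun α q (sphCornerFun α q x) = x := by
  obtain ⟨hQ, ht, htq⟩ := hx
  have hm := invM2_pos hQ
  have hsm : 0 < √(invM2 α x) := Real.sqrt_pos.2 hm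
  have htgt := sphCornerFun_mem_tgt hx1 ⟨hQ, ht, htq⟩
  have hk : cornK α (sphCornerFun α q x) = (√(invM2 α x))⁻¹ := by
    rw [cornK, one_add_invQ_liftXY_sphCornerFun hQ]
  have hk0 : cornK α (sphCornerFun α q x) * (√(invM2 α x) * x 0) = x 0 := by
    rw [hk, ← mul_assoc, inv_mul_cancel₀ hsm.ne', one_mul]
  have hk1 : cornK α (sphCornerFun α q x) * (√(invM2 α x) * x 1) = x 1 := by
    rw [hk, ← mul_assoc, inv_mul_cancel₀ hsm.ne', one_mul]
  have hc : cornC α (sphCornerFun α q x) = ‖sliceTailProj x‖ := by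
    rw [cornC, ← Real.sqrt_sq (norm_nonneg (sliceTailProj x))]
    congr 1
    show 1 - cornK α (sphCornerFun α q x) ^ 2 * ((√(invM2 α x) * x 0) ^ 2 + (√(invM2 α x) * x 1) ^ 2) = _
    have hn := norm_sq_eq_of_fin_five x
    rw [hx1, one_pow] at hn
    rw [hk, inv_pow, Real.sq_sqrt hm.le, mul_pow, mul_pow, Real.sq_sqrt hm.le]
    field_simp
    linarith
  have hy : ((stereographic' 2 (-q)).symm (lastTwo (sphCornerFun α q x)) : 𝕊 2) =
      radialProjection q (sliceTailProj x) := by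
    rw [lastTwo_sphCornerFun]
    exact (stereographic' 2 (-q)).left_inv (radialProjection_mem_source_stereographic' ht htq)
  have htail : sliceTailProj (sphCornerInvFun α q (sphCornerFun α q x)) = sliceTailProj x := by
    rw [sliceTailProj_sphCornerInvFun, hc, hy, norm_smul_coe_radialProjection]
  ext i
  fin_cases i
  · exact hk0
  · exact hk1
  · exact congrArg (· 0) htail
  · exact congrArg (· 1) htail
  · exact congrArg (· 2) htail

/-- **`sphCornerFun ∘ sphCornerInvFun = id` on the target.** [folklore] -/
theorem sphCornerFun_sphCornerInvFun {r : 𝔼 4} (hr : r ∈ sphCornerTgt α) :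
    sphCornerFun α q (sphCornerInvFun α q r) = r := by
  have hk := cornK_pos hr
  have hm2 : invM2 α (sphCornerInvFun α q r) = 1 + invQ α (liftXY r) := by
    rw [invM2, invQ_sphCornerInvFun, cornK_sq hr, div_mul_eq_mul_div, one_mul, one_sub_div hr.1.ne',
      add_sub_cancel_right, one_div_one_div]
  have hsm : √(invM2 α (sphCornerInvFun α q r)) = (cornK α r)⁻¹ := by
    rw [hm2, cornK, inv_inv]
  have hς : stereographic' 2 (-q) (radialProjection q (sliceTailProj (sphCornerInvFun α q r))) = lastTwo r := by
    rw [sliceTailProj_sphCornerInvFun, radialProjection_smul q (cornC_pos hr)]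
    exact (stereographic' 2 (-q)).right_inv (by simp)
  ext i
  fin_cases i
  · show √(invM2 α (sphCornerInvFun α q r)) * (cornK α r * r 0) = r 0
    rw [hsm, ← mul_assoc, inv_mul_cancel₀ hk.ne', one_mul]
  · show √(invM2 α (sphCornerInvFun α q r)) * (cornK α r * r 1) = r 1
    rw [hsm, ← mul_assoc, inv_mul_cancel₀ hk.ne', one_mul]
  · show stereographic' 2 (-q) (radialProjection q (sliceTailProj (sphCornerInvFun α q r))) 0 = r 2
    rw [hς]; rfl
  · show stereographic' 2 (-q) (radialProjection q (sliceTailProj (sphCornerInvFun α q r))) 1 = r 3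
    rw [hς]; rfl

/-- `sphCornerDom` is open. [folklore] -/
theorem isOpen_sphCornerDom (α : ℝ) (q : 𝕊 2) : IsOpen (sphCornerDom α q) := by
  have hc : ContinuousOn (fun x : 𝔼 5 => ‖sliceTailProj x‖⁻¹ • sliceTailProj x) {x | sliceTailProj x ≠ 0} :=
    ((contDiff_sliceTailProj.continuous.norm).continuousOn.inv₀ fun x hx => norm_ne_zero_iff.2 hx).smul
      contDiff_sliceTailProj.continuous.continuousOn
  have h2 : IsOpen {x : 𝔼 5 | sliceTailProj x ≠ 0 ∧ ‖sliceTailProj x‖⁻¹ • sliceTailProj x ≠ -(q : 𝔼 3)} :=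
    hc.isOpen_inter_preimage (isOpen_ne.preimage contDiff_sliceTailProj.continuous) isOpen_ne
  exact (isOpen_invDom α).inter h2

/-- `sphCornerTgt` is open. [folklore] -/
theorem isOpen_sphCornerTgt (α : ℝ) : IsOpen (sphCornerTgt α) := by
  have hl : Continuous liftXY := by
    refine continuous_euclidean fun i => ?_
    fin_cases i <;> simp [liftXY] <;> fun_prop
  have hQ : Continuous fun r : 𝔼 4 => 1 + invQ α (liftXY r) :=
    continuous_const.add ((contDiff_invQ α).continuous.comp hl)
  have hr : Continuous fun r : 𝔼 4 => r 0 ^ 2 + r 1 ^ 2 := by fun_prop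
  exact (isOpen_lt continuous_const hQ).inter (isOpen_lt hr hQ)

/-- `liftXY` is smooth (linear). [folklore] -/
theorem contDiff_liftXY : ContDiff ℝ ∞ liftXY := by
  have hc : ∀ i : Fin 4, ContDiff ℝ ∞ fun w : 𝔼 4 => w i := fun i => contDiff_euclidean.mp contDiff_id i
  rw [contDiff_euclidean]
  intro i
  fin_cases i
  · exact hc 0
  · exact hc 1
  · exact contDiff_const
  · exact contDiff_const
  · exact contDiff_const

/-- The angular part `ς(t/‖t‖)` is smooth on `sphCornerDom`. [folklore] -/
theorem contDiffOn_stereographic'_radialProjection_sliceTailProj (α : ℝ) (q : 𝕊 2) :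
    ContDiffOn ℝ ∞ (fun x => stereographic' 2 (-q) (radialProjection q (sliceTailProj x))) (sphCornerDom α q) := by
  have heq : EqOn (fun x => stereographic' 2 (-q) (radialProjection q (sliceTailProj x)))
      (fun x => (OrthonormalBasis.fromOrthogonalSpanSingleton (𝕜 := ℝ) 2
        (ne_zero_of_mem_unit_sphere (-q))).repr
          (stereoToFun ((-q : 𝕊 2) : 𝔼 3) (‖sliceTailProj x‖⁻¹ • sliceTailProj x))) (sphCornerDom α q) := by
    intro x hx
    simp only
    rw [stereographic'_eq_repr_stereoToFun, coe_radialProjection_of_ne_zero q hx.2.1]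
  refine ContDiffOn.congr (fun x hx => ContDiffAt.contDiffWithinAt ?_) heq
  obtain ⟨-, h0, hq⟩ := hx
  have htail : ContDiffAt ℝ ∞ sliceTailProj x := contDiff_sliceTailProj.contDiffAt
  have hnorm : ContDiffAt ℝ ∞ (fun x => ‖sliceTailProj x‖) x := htail.norm ℝ h0
  refine contDiffAt_repr_stereoToFun_comp' (-q) ((hnorm.inv (norm_ne_zero_iff.2 h0)).smul htail) ?_ ?_
  · rw [norm_smul, norm_inv, norm_norm, inv_mul_cancel₀ (norm_ne_zero_iff.2 h0)]
  · rwa [coe_neg_sphere]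

/-- **The corner chart formula is smooth on `sphCornerDom`.** [folklore] -/
theorem contDiffOn_sphCornerFun (α : ℝ) (q : 𝕊 2) : ContDiffOn ℝ ∞ (sphCornerFun α q) (sphCornerDom α q) := by
  have hc : ∀ i : Fin 5, ContDiff ℝ ∞ fun x : 𝔼 5 => x i := fun i => contDiff_euclidean.mp contDiff_id i
  have hst := contDiffOn_stereographic'_radialProjection_sliceTailProj α q
  have hsq : ContDiffOn ℝ ∞ (fun x => √(invM2 α x)) (sphCornerDom α q) :=
    ((contDiffOn_invM2 α).mono fun x hx => hx.1).sqrt fun x hx => (invM2_pos hx.1).ne'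
  rw [contDiffOn_euclidean] at hst ⊢
  intro i
  fin_cases i
  · exact hsq.mul (hc 0).contDiffOn
  · exact hsq.mul (hc 1).contDiffOn
  · exact hst 0
  · exact hst 1

/-- **The inverse formula is smooth on the target.** [folklore] -/
theorem contDiffOn_sphCornerInvFun (α : ℝ) (q : 𝕊 2) : ContDiffOn ℝ ∞ (sphCornerInvFun α q) (sphCornerTgt α) := by
  have hc : ∀ i : Fin 4, ContDiff ℝ ∞ fun w : 𝔼 4 => w i := fun i => contDiff_euclidean.mp contDiff_id i
  have hQ : ContDiff ℝ ∞ fun r : 𝔼 4 => 1 + invQ α (liftXY r) :=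
    contDiff_const.add ((contDiff_invQ α).comp contDiff_liftXY)
  have hK : ContDiffOn ℝ ∞ (cornK α) (sphCornerTgt α) := by
    unfold cornK
    exact (hQ.contDiffOn.sqrt fun r hr => hr.1.ne').inv fun r hr => (Real.sqrt_pos.2 hr.1).ne'
  have hC : ContDiffOn ℝ ∞ (cornC α) (sphCornerTgt α) := by
    unfold cornC
    refine (contDiffOn_const.sub ((hK.pow 2).mul (((hc 0).pow 2).add ((hc 1).pow 2)).contDiffOn)).sqrt
      fun r hr => ?_
    have h := cornC_pos hr
    rw [cornC, Real.sqrt_pos] at h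
    exact h.ne'
  have hy : ContDiff ℝ ∞ fun r : 𝔼 4 => (((stereographic' 2 (-q)).symm (lastTwo r) : 𝕊 2) : 𝔼 3) :=
    (contDiff_coe_stereographic'_symm (-q)).comp contDiff_lastTwo
  have hyi : ∀ i : Fin 3, ContDiff ℝ ∞ fun r : 𝔼 4 =>
      (((stereographic' 2 (-q)).symm (lastTwo r) : 𝕊 2) : 𝔼 3) i := fun i => contDiff_euclidean.mp hy i
  rw [contDiffOn_euclidean]
  intro i
  fin_cases i
  · exact hK.mul (hc 0).contDiffOn
  · exact hK.mul (hc 1).contDiffOn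
  · exact hC.mul (hyi 0).contDiffOn
  · exact hC.mul (hyi 1).contDiffOn
  · exact hC.mul (hyi 2).contDiffOn

open Classical in
/-- The (total) inverse of the corner chart of `S⁴`: the inverse formula on the target, junk elsewhere. [folklore] -/
def sphCornerInv (α : ℝ) (q : 𝕊 2) (r : 𝔼 4) : 𝕊 4 :=
  if h : r ∈ sphCornerTgt α then ⟨sphCornerInvFun α q r, mem_sphere_zero_iff_norm.2 (norm_sphCornerInvFun h)⟩
  else junkPoint α

/-- On the target the total inverse is the inverse formula. [folklore] -/
theorem coe_sphCornerInv (α : ℝ) (q : 𝕊 2) {r : 𝔼 4} (hr : r ∈ sphCornerTgt α) :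
    ((sphCornerInv α q r : 𝕊 4) : 𝔼 5) = sphCornerInvFun α q r := by
  rw [sphCornerInv, dif_pos hr]

variable (α q)

/-- **The corner chart `ψ_{α,q}` of `S⁴`** near the central surface: `(z, t) ↦ (√(m²) z, ς(t/‖t‖))`
on `{Q(z) < 1, t ≠ 0, t/‖t‖ ≠ -q}` (`h(z) = √(m²(z)) z = z/√(1 - Q(z))` straightens nothing but
rescales radially so that `h(Z(w)) = y₁ E₁ + y₀ E₀`). [folklore] -/
def sphCornerChart : OpenPartialHomeomorph (𝕊 4) (𝔼 4) where
  toFun x := sphCornerFun α q x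
  invFun := sphCornerInv α q
  source := {x | (x : 𝔼 5) ∈ sphCornerDom α q}
  target := sphCornerTgt α
  map_source' x hx := sphCornerFun_mem_tgt (norm_eq_of_mem_sphere x) hx
  map_target' r hr := by
    show ((sphCornerInv α q r : 𝕊 4) : 𝔼 5) ∈ sphCornerDom α q
    rw [coe_sphCornerInv α q hr]
    exact sphCornerInvFun_mem_dom hr
  left_inv' x hx := by
    apply Subtype.ext
    rw [coe_sphCornerInv α q (sphCornerFun_mem_tgt (norm_eq_of_mem_sphere x) hx)]
    exact sphCornerInvFun_sphCornerFun (norm_eq_of_mem_sphere x) hx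
  right_inv' r hr := by
    show sphCornerFun α q ((sphCornerInv α q r : 𝕊 4) : 𝔼 5) = r
    rw [coe_sphCornerInv α q hr]
    exact sphCornerFun_sphCornerInvFun hr
  open_source := (isOpen_sphCornerDom α q).preimage continuous_subtype_val
  open_target := isOpen_sphCornerTgt α
  continuousOn_toFun :=
    (contDiffOn_sphCornerFun α q).continuousOn.comp continuous_subtype_val.continuousOn fun x hx => hx
  continuousOn_invFun := by
    rw [Topology.IsInducing.subtypeVal.continuousOn_iff]
    exact (contDiffOn_sphCornerInvFun α q).continuousOn.congr fun r hr => coe_sphCornerInv α q hr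

/-- The corner chart of `S⁴` in coordinates (definitional). [folklore] -/
theorem sphCornerChart_apply (x : 𝕊 4) : sphCornerChart α q x = sphCornerFun α q x := rfl

/-- The source of the corner chart of `S⁴` (definitional). [folklore] -/
theorem sphCornerChart_source : (sphCornerChart α q).source = {x : 𝕊 4 | (x : 𝔼 5) ∈ sphCornerDom α q} := rfl

/-- **The corner chart `ψ_{α,q}` lies in the maximal `C^∞` atlas of `S⁴`.** [folklore] -/
theorem sphCornerChart_mem_maximalAtlas : sphCornerChart α q ∈ IsManifold.maximalAtlas (𝓡 4) ∞ (𝕊 4) := by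
  rw [IsManifold.mem_maximalAtlas_iff_contMDiffOn]
  constructor
  · intro x hx
    refine ContMDiffAt.contMDiffWithinAt ?_
    have h1 : ContDiffAt ℝ ∞ (sphCornerFun α q) (x : 𝔼 5) :=
      (contDiffOn_sphCornerFun α q).contDiffAt ((isOpen_sphCornerDom α q).mem_nhds hx)
    exact h1.contMDiffAt.comp x contMDiff_coe_sphere.contMDiffAt
  · intro r hr
    refine ContMDiffAt.contMDiffWithinAt ?_
    refine contMDiffAt_sphere_of_contDiffAt (isOpen_sphCornerTgt α) hr (fun r' hr' => coe_sphCornerInv α q hr')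
      ((contDiffOn_sphCornerInvFun α q).contDiffAt ((isOpen_sphCornerTgt α).mem_nhds hr)) ?_
    exact (sphCornerChart α q).continuousOn_symm.continuousAt ((isOpen_sphCornerTgt α).mem_nhds hr)

end Literature.Topology.FourManifolds.GayKirby


namespace Literature.Topology.FourManifolds.GayKirby

local notation "𝔼 " n:arg => EuclideanSpace ℝ (Fin n)
local notation "𝕊 " n:arg => (Metric.sphere (0 : EuclideanSpace ℝ (Fin (n + 1))) 1)
local notation "𝔻 " n:arg => (Metric.closedBall (0 : EuclideanSpace ℝ (Fin n)) 1)

attribute [local instance] fact_finrank_euclideanSpace_succ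

/-! ### The linear map `A` taking the quadrant to the sector, and the corner chart equation -/

/-- The linear map `A : ℝ⁴ → ℝ⁴`, `(y₀, y₁, y₂, y₃) ↦ (y₁ E₁ + y₀ E₀, y₂, y₃)` (the quadrant
`{y₀, y₁ ≥ 0}` goes to the sector spanned by `E₁ = e^{iα}`, `E₀ = e^{i(α + 2π/3)}`), as a linear
equivalence with inverse `X ↦ (b(X), a(X), X₂, X₃)`. [folklore] -/
def cornerLinearEquiv (α : ℝ) : (𝔼 4) ≃ₗ[ℝ] 𝔼 4 where
  toFun y := !₂[y 1 * Real.cos α + y 0 * Real.cos (α + 2 * π / 3),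
    y 1 * Real.sin α + y 0 * Real.sin (α + 2 * π / 3), y 2, y 3]
  invFun X := !₂[invB α (liftXY X), invA α (liftXY X), X 2, X 3]
  map_add' y y' := by ext i; fin_cases i <;> simp <;> ring
  map_smul' c y := by ext i; fin_cases i <;> simp <;> ring
  left_inv y := by
    have hl : liftXY !₂[y 1 * Real.cos α + y 0 * Real.cos (α + 2 * π / 3),
        y 1 * Real.sin α + y 0 * Real.sin (α + 2 * π / 3), y 2, y 3] =
        !₂[y 1 * Real.cos α + y 0 * Real.cos (α + 2 * π / 3),
          y 1 * Real.sin α + y 0 * Real.sin (α + 2 * π / 3), 0, 0, 0] := rfl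
    ext i
    fin_cases i
    · show invB α (liftXY _) = y 0
      rw [hl, invB_edge]
    · show invA α (liftXY _) = y 1
      rw [hl, invA_edge]
    · rfl
    · rfl
  right_inv X := by
    ext i
    fin_cases i
    · show invA α (liftXY X) * Real.cos α + invB α (liftXY X) * Real.cos (α + 2 * π / 3) = X 0
      exact (apply_zero_eq_invA_invB α (liftXY X)).symm
    · show invA α (liftXY X) * Real.sin α + invB α (liftXY X) * Real.sin (α + 2 * π / 3) = X 1
      exact (apply_one_eq_invA_invB α (liftXY X)).symm
    · rfl
    · rfl

/-- `A` as a continuous linear automorphism of `ℝ⁴`. [folklore] -/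
def cornerLinear (α : ℝ) : (𝔼 4) ≃L[ℝ] 𝔼 4 := (cornerLinearEquiv α).toContinuousLinearEquiv

/-- The inverse of `A` in coordinates. [folklore] -/
theorem cornerLinear_symm_apply (α : ℝ) (X : 𝔼 4) :
    (cornerLinear α).symm X = !₂[invB α (liftXY X), invA α (liftXY X), X 2, X 3] := rfl

/-- **The corner chart equation.**  For `x` in the half-space with `x₀ + x₁²/4 < 1` and
`w' = ballCornerInv q x` (so `u(w') = x₀`, `2 s(w') = x₁`, `v(w')/‖v(w')‖ = ς⁻¹(x₂, x₃)`):
`A⁻¹ (ψ (sectorMap α w')) = cornerUnbend x` — by construction `(y₀, y₁)(w') = cornerUnbend (u, 2s)`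
and `√(m²(Z)) · Z = y₁ E₁ + y₀ E₀`. [cite: DouadyHerault1973, Appendice] -/
theorem cornerLinear_symm_sphCornerFun_sectorMapFun (α : ℝ) (q : 𝕊 2) {x : 𝔼 4} (hx0 : 0 ≤ x 0)
    (hx : x 0 + (x 1 / 2) ^ 2 < 1) :
    (cornerLinear α).symm (sphCornerFun α q (sectorMapFun α (ballCornerInv q x))) = cornerUnbend x := by
  set w' : 𝔼 4 := ballCornerInv q x with hw'
  have hc : 0 < 1 - x 0 - (x 1 / 2) ^ 2 := by linarith
  have hle : ‖w'‖ ≤ 1 := by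
    have h := norm_ballCornerInv_sq q hc.le
    nlinarith [norm_nonneg (ballCornerInv q x)]
  have hU : secU w' = x 0 := secU_ballCornerInv q hc.le
  have hS : 2 * secS w' = x 1 := by rw [hw', secS_ballCornerInv]; ring
  have hN : secN w' = √(x 0 ^ 2 + x 1 ^ 2) := by rw [secN, hU, hS]
  have hY₀ : secY₀ w' = cornerUnbend x 0 := by rw [secY₀, cornerUnbend_apply_zero, hN, hS]
  have hY₁ : secY₁ w' = cornerUnbend x 1 := by rw [secY₁, cornerUnbend_apply_one, hN, hS]
  have hM := secM_pos w'
  have hm2 : √(invM2 α (sectorMapFun α w')) = secM w' := by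
    rw [invM2_sectorMapFun hle, Real.sqrt_sq hM.le]
  -- the tail of `e w'` is `λ c y` with `y = ς⁻¹ (x₂, x₃)`
  have hsq : 0 < √(1 - x 0 - (x 1 / 2) ^ 2) := Real.sqrt_pos.2 hc
  have htail : sliceTailProj (sectorMapFun α w') =
      (secL w' * √(1 - x 0 - (x 1 / 2) ^ 2)) • ((stereographic' 2 (-q)).symm (lastTwo x) : 𝕊 2).val := by
    rw [sliceTailProj_sectorMapFun, hw', tail₄_ballCornerInv, smul_smul]
  have hς : stereographic' 2 (-q) (radialProjection q (sliceTailProj (sectorMapFun α w'))) = lastTwo x := by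
    rw [htail, radialProjection_smul q (mul_pos (secL_pos w') hsq)]
    exact (stereographic' 2 (-q)).right_inv (by simp)
  have hψ : sphCornerFun α q (sectorMapFun α w') =
      !₂[secY₁ w' * Real.cos α + secY₀ w' * Real.cos (α + 2 * π / 3),
        secY₁ w' * Real.sin α + secY₀ w' * Real.sin (α + 2 * π / 3), x 2, x 3] := by
    ext i
    fin_cases i
    · show √(invM2 α (sectorMapFun α w')) * sectorMapFun α w' 0 = _
      rw [hm2, sectorMapFun_apply_zero, mul_div_cancel₀ _ hM.ne']
      rfl
    · show √(invM2 α (sectorMapFun α w')) * sectorMapFun α w' 1 = _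
      rw [hm2, sectorMapFun_apply_one, mul_div_cancel₀ _ hM.ne']
      rfl
    · show stereographic' 2 (-q) (radialProjection q (sliceTailProj (sectorMapFun α w'))) 0 = x 2
      rw [hς]; rfl
    · show stereographic' 2 (-q) (radialProjection q (sliceTailProj (sectorMapFun α w'))) 1 = x 3
      rw [hς]; rfl
  have hl : liftXY !₂[secY₁ w' * Real.cos α + secY₀ w' * Real.cos (α + 2 * π / 3),
      secY₁ w' * Real.sin α + secY₀ w' * Real.sin (α + 2 * π / 3), x 2, x 3] =
      !₂[secY₁ w' * Real.cos α + secY₀ w' * Real.cos (α + 2 * π / 3),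
        secY₁ w' * Real.sin α + secY₀ w' * Real.sin (α + 2 * π / 3), 0, 0, 0] := rfl
  rw [hψ, cornerLinear_symm_apply, hl, invB_edge, invA_edge, hY₀, hY₁]
  ext i
  fin_cases i <;> rfl

/-- **The sector map has the corner model along `K`**: `IsCornerAt (sectorMap α) w` for
`w₀ = 0`, `‖w‖ = 1`, with the charts `φ = ballCornerChart q`, `ψ = sphCornerChart α q`
(`q = v(w) ∈ S²`) and `A = cornerLinear α`. [cite: GayKirby2016, §2 (arXiv p. 5), first example; Def. 1, first bullet (arXiv p. 3)] -/
theorem isCornerAt_sectorMap (α : ℝ) {w : 𝔻 4} (h0 : (w : 𝔼 4) 0 = 0) (h1 : ‖(w : 𝔼 4)‖ = 1) :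
    IsCornerAt (sectorMap α) w := by
  have htn : ‖tail₄ (w : 𝔼 4)‖ = 1 := by
    have h := norm_sq_eq_secS_sq_add (w : 𝔼 4)
    rw [h1, secS, h0] at h
    have h2 : ‖tail₄ (w : 𝔼 4)‖ ^ 2 = 1 := by linarith
    have h3 := norm_nonneg (tail₄ (w : 𝔼 4))
    nlinarith
  set q : 𝕊 2 := ⟨tail₄ (w : 𝔼 4), mem_sphere_zero_iff_norm.2 htn⟩ with hq
  have htw : tail₄ (w : 𝔼 4) = (q : 𝔼 3) := rfl
  have hqne : (q : 𝔼 3) ≠ -(q : 𝔼 3) := fun h => by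
    have h2 : (2 : ℝ) • (q : 𝔼 3) = 0 := by
      rw [two_smul]; nth_rewrite 2 [h]; exact add_neg_cancel _
    exact ne_zero_of_mem_unit_sphere q ((smul_eq_zero.1 h2).resolve_left two_ne_zero)
  have hwsrc : w ∈ (ballCornerChart q).source := by
    show (w : 𝔼 4) ∈ ballCornerDom q
    rw [ballCornerDom, mem_setOf_eq, htw, norm_eq_of_mem_sphere, inv_one, one_smul]
    exact ⟨ne_zero_of_mem_unit_sphere q, hqne⟩
  refine ⟨ballCornerChart q, sphCornerChart α q, cornerLinear α, ballCornerChart_mem_maximalAtlas q,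
    sphCornerChart_mem_maximalAtlas α q, hwsrc, fun w' hw' => ?_, ?_, fun x hx => ?_⟩
  · -- `φ.source ⊆ e ⁻¹' ψ.source`
    show ((sectorMap α w' : 𝕊 4) : 𝔼 5) ∈ sphCornerDom α q
    have hw'1 : ‖(w' : 𝔼 4)‖ ≤ 1 := mem_closedBall_zero_iff.1 w'.2
    obtain ⟨ht0, htq⟩ := hw'
    refine ⟨invQ_sectorMapFun_lt_one hw'1, ?_, ?_⟩
    · rw [coe_sectorMap, sliceTailProj_sectorMapFun]
      exact smul_ne_zero (secL_pos _).ne' ht0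
    · rw [coe_sectorMap, sliceTailProj_sectorMapFun, norm_smul, Real.norm_eq_abs,
        abs_of_pos (secL_pos _), mul_inv_rev, smul_smul, inv_mul_cancel_right₀ (secL_pos _).ne']
      exact htq
  · -- `φ w = 0`
    show ballCornerFun q w = 0
    have hU : secU (w : 𝔼 4) = 0 := (secU_eq_zero_iff _).2 h1
    have hrp : radialProjection q (tail₄ (w : 𝔼 4)) = q := by
      rw [htw]; exact radialProjection_coe_sphere q q
    ext i
    fin_cases i
    · exact hU
    · show 2 * secS (w : 𝔼 4) = 0
      rw [secS, h0, mul_zero]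
    · show stereographic' 2 (-q) (radialProjection q (tail₄ (w : 𝔼 4))) 0 = 0
      rw [hrp, stereographic'_neg_self]; rfl
    · show stereographic' 2 (-q) (radialProjection q (tail₄ (w : 𝔼 4))) 1 = 0
      rw [hrp, stereographic'_neg_self]; rfl
  · -- the corner equation
    rw [OpenPartialHomeomorph.extend_target] at hx
    obtain ⟨hx, z, rfl⟩ := hx
    rw [mem_preimage, ModelWithCorners.left_inv] at hx
    have hz : z.val 0 + (z.val 1 / 2) ^ 2 < 1 := hx
    have hsymm : ((ballCornerChart q).extend (𝓡∂ 4)).symm ((𝓡∂ 4) z) = (ballCornerChart q).symm z := by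
      rw [OpenPartialHomeomorph.extend_coe_symm, comp_apply, ModelWithCorners.left_inv]
    rw [hsymm, sphCornerChart_apply, coe_sectorMap, coe_ballCornerChart_symm q hx,
      modelWithCornersEuclideanHalfSpace_apply, cornerLinear_symm_sphCornerFun_sectorMapFun α q z.2 hz]
    exact ⟨cornerUnbend_mem_cornerQuadrant _, cornerFold_cornerUnbend z.2⟩

end Literature.Topology.FourManifolds.GayKirby

namespace Literature.Topology.FourManifolds

local notation "𝔼 " n:arg => EuclideanSpace ℝ (Fin n)
local notation "𝕊 " n:arg => (Metric.sphere (0 : EuclideanSpace ℝ (Fin (n + 1))) 1)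
local notation "𝔻 " n:arg => (Metric.closedBall (0 : EuclideanSpace ℝ (Fin n)) 1)

attribute [local instance] fact_finrank_euclideanSpace_succ

/-- **Discharge of the named fact `Literature.Topology.FourManifolds.sectorMap_isCornerAt`.** [cite: GayKirby2016, §2 (arXiv p. 5), first example; Def. 1, first bullet (arXiv p. 3)] -/
theorem sectorMap_isCornerAt_holds : sectorMap_isCornerAt :=
  fun α _ h0 h1 => GayKirby.isCornerAt_sectorMap α h0 h1

/-- **Clause (ii) of `Literature.Topology.FourManifolds.IsGKTrisection` for Gay–Kirby's sectors of `S⁴` holds** — discharge of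
the named fact `Literature.Topology.FourManifolds.sphereSector_sectors` (`SphereTrisections.lean`): each sector
`X_j = {2πj/3 ≤ θ ≤ 2π(j+1)/3}` of the round `S⁴` is the image of the closed unit `4`-ball (one
`0`-handle, no `1`-handle) under the topological embedding `GayKirby.sectorMap (2πj/3)`, a `C^∞`
immersion off the corner locus with the corner model `A ∘ cornerUnbend` along it, and
`X_j ∩ X_l ⊆ e(∂𝔻⁴)`.  Print (GK Def. 1, first bullet): "For each `i = 1, 2, 3`, there is a
diffeomorphism `φᵢ : Xᵢ → Z_k`" (`k = 0`, `Z₀ = B⁴`), read with corners along `F` as explained in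
the docstring of `Literature.Topology.FourManifolds.IsGKTrisection`. [cite: GayKirby2016, §2 (arXiv p. 5), first example; Def. 1, first bullet (arXiv p. 3)] -/
theorem sphereSector_sectors_holds : sphereSector_sectors :=
  sphereSector_sectors_of_sectorMap sectorMap_isImmersionAt_holds sectorMap_isCornerAt_holds

/-- **Gay–Kirby's genus-`0` trisection of the round `S⁴` (§2, first example) is a trisection in
the sense of `Literature.Topology.FourManifolds.IsBalancedGKTrisection`** — discharge of the named fact
`Literature.Topology.FourManifolds.sphereSector_isBalancedGKTrisection`: all three clauses are now proved
(`GayKirby.iUnion_sphereSector_eq_univ`, `sphereSector_sectors_holds`, `sphereSector_handlebodies_holds`).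
Print: "`S⁴ ⊂ ℂ × ℝ³` can be explicitly divided into three pieces
`X_j = {(re^{iθ}, x₃, x₄, x₅) | 2πj/3 ≤ θ ≤ 2π(j+1)/3}`, giving a genus `0` trisection of `S⁴`."
[cite: GayKirby2016, §2 (arXiv p. 5), first example] -/
theorem sphereSector_isBalancedGKTrisection_holds : sphereSector_isBalancedGKTrisection :=
  sphereSector_isBalancedGKTrisection_of_sectors sphereSector_sectors_holds

/-- **The round `S⁴` admits a genus-`0` trisection** (with corners along the central surface) —
discharge of `Literature.Topology.FourManifolds.sphere_genusZero_gkTrisection`; in particular `Literature.Topology.FourManifolds.IsGKTrisection` is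
non-vacuous. [cite: GayKirby2016, §2 (arXiv p. 5), first example] -/
theorem sphere_genusZero_gkTrisection_holds : sphere_genusZero_gkTrisection :=
  sphereSector_isBalancedGKTrisection_holds.sphere_genusZero_gkTrisection

/-- **The trisection genus of `S⁴` (over `IsGKTrisection`) is `0`.** [cite: GayKirby2016, §2 (arXiv p. 5), first example] -/
theorem sphere_gkTrisectionGenus_eq_zero_holds :
    gkTrisectionGenus (Metric.sphere (0 : EuclideanSpace ℝ (Fin 5)) 1) = 0 :=
  sphere_gkTrisectionGenus_eq_zero sphere_genusZero_gkTrisection_holds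

/-- **(d′) `Literature.Topology.FourManifolds.sphere_gkTrisections` from the stabilisation fact (c′) alone**: the standard
`(3 + 3m, 1 + m)`-trisections of `S⁴` with their group trisections now depend only on
`Literature.Topology.FourManifolds.exists_stabilized_gkTrisection` (GK Def. 8 / Lemma 10 with AGK Thm. 5).
[cite: GayKirby2016, §2 (arXiv p. 5), first three examples; Def. 8 and Lemma 10 (arXiv p. 4)] -/
theorem sphere_gkTrisections_of_stabilization (hc : exists_stabilized_gkTrisection.{0}) :
    sphere_gkTrisections :=
  sphere_gkTrisections_of_sectors sphereSector_sectors_holds hc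

end Literature.Topology.FourManifolds

end
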